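import Summits.ValiantsHypothesis.ValiantsHypothesis.Theses.NewtonUnitEquations
import Mathlib.Data.Finsupp.Lex
import Mathlib.RingTheory.MvPolynomial.EulerIdentity
import Mathlib.Analysis.LocallyConvex.Separation
import Mathlib.Analysis.Convex.Extreme
import Mathlib.Analysis.Convex.Topology

/-!
# val-idea-35 g10 — the WRONSKIAN TRANSFER at homogeneous rank three
(crux `stmt-ValiantsHypothesis-5906` `TwoProducts`, SIDE ladder of card «table-rank-ladder», rung 3-LIN; memo
`EXPT-rank3-wronskian-g10.md`).

Nothing here closes 5906 / `PlanarCellBound`; **VP ≠ VNP is NOT proved**.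

SETTING.  `w = (w₀,w₁,w₂)`, `wᵢ ∈ ℂ[x,y]` with `≤ t` monomials each, `P ∈ ℂ[W₀,W₁,W₂]` HOMOGENEOUS of degree `m`,
`D = P(w)`.  `J(F,G) = θ₀F·θ₁G − θ₁F·θ₀G` is the toric Jacobian of g9 (`θᵢ = Xᵢ∂ᵢ`), and the NEW OBJECT is the
toric Wronskian `Ω(w) = w₀·J(w₁,w₂) + w₁·J(w₂,w₀) + w₂·J(w₀,w₁) = det [w ; θ₀w ; θ₁w]` (`≤ t³` monomials).

KERNEL THEOREMS (0 sorry, axioms {propext, Classical.choice, Quot.sound}):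
* `wronskianRule` (+ cyclic `wronskianRule₀`, `wronskianRule₁`) — Euler's identity plus the two chain rules `J(D,w₀)`,
  `J(D,w₁)` ELIMINATE to `Ω(w) · (∂₂P)(w) = w₁·J(D,w₀) − w₀·J(D,w₁) + m·J(w₀,w₁)·D =: L_m^{w₀,w₁} D`
  (composition ↦ PRODUCT again, one rank up from g9's `chainRule`);
* `coeff_ell_top` — above a `ν`-top point `γ` of `F` the coefficient of `X^{γ+p₀+p₁}` in `L_k^{u,v} F` is
  `F_γ·u_{p₀}·v_{p₁}·λ_k(γ)`, `λ_k(γ) = det(γ − k·p₀, p₀ − p₁)` (`p₀, p₁` the unique `ν`-tops of `u, v`);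
* `wronskianTransfer : WronskianTransfer` — THE LOAD-BEARING STEP: if `ν` is an edge direction of `F ≠ 0` then `ν` is an
  edge direction of `L_k^{u,v} F`, unless `ν` is LINE-SPECIAL for `F` (`|top set| = 2`, one point on the line `λ_k = 0`);
* `dependentCase3` — `Ω(w) = 0` ⇒ no such `ν` is an edge direction of `Q(w)`, `Q` homogeneous;
* `twoProductsLinRankThree_of_law`, `rankThreeLinearLaw_of_explicit` (`portPlan3_tail`) — the explicit bound gives the
  law (`c = 4`), and the law DECIDES `TwoProducts` on every table whose `2m` rows span a `≤ 3`-dimensional linear space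
  (`TwoProductsLinRankThree`; this class strictly contains g9's K13 = rows in `span{1,w₀,w₁}`);
* rev 2, `section TowerKernel3` — **THE LAW AND THE CLASS THEOREM IN KERNEL**: `rankThreeLinearLaw : RankThreeLinearLaw`
  (crude chart bookkeeping, `c = 22`) and `twoProductsLinRankThree : TwoProductsLinRankThree`, assembled from the verbatim
  g9 chart machinery (`TowerKernel` Stages A/B, `ostrowski`) and the rank-3 replacements `X3` (ALL pair crossings of
  `S₀∪S₁∪S₂`), `echelon3` (per-arc echelon generators), `linePoint_eq`/`spec3_le_two` (≤ 2 line-specials per chart-arc and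
  level), `step3`/`tower3` (the one-operator tower through `∂₂`), `aeval_rank1`/`not_isEdgeDir_C_mul_pow` (rank-one branch).
PAPER ONLY (memo §3; exact-checked by `loc-g10/rank3_check.py`, 141 659 instances, 0 violations): the SHARP constant
`nv(P(w)) ≤ t³ + 9t²(4m+1)` = `RankThreeExplicitBound` (arc count with `nv Ω ≤ t³` shared across arcs); the kernel's
`(m+2)²²(t+2)²²` is the two-chart, per-arc `|Eset Ω'| ≤ |supp Ω'|²` version of the same tower — same mathematics, cruder
bookkeeping, exactly as g9's kernel `c = 5` versus its memo's arc count.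
ONSET OF RECORD (memo §4): homogeneous rank 4 = affine rank 3 with `1` in the row span (the γ1 tables `1 + u_j`): there
Euler + two chain rules are 3 equations in 4 unknowns, `L D = Ω·(∂₂P)(w) + J(w₀,w₁)·(∂_c P̃)(w)` is a SUM of two products.
-/

noncomputable section
set_option linter.dupNamespace false

namespace Summit.ValiantsHypothesis.ValiantsHypothesis.Cruxes.TwoProducts.ValIdea35g10

open scoped BigOperators Pointwise
open MvPolynomial

abbrev Poly2 := MvPolynomial (Fin 2) ℂ
abbrev Poly3 := MvPolynomial (Fin 3) ℂ

/-- Planar embedding of an exponent (verbatim `TwoProducts` / g8 / g9). -/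
def emb : (Fin 2 →₀ ℕ) → (Fin 2 → ℝ) := fun e i => ((e i : ℕ) : ℝ)

/-- Number of vertices of the Newton polygon of `D` (verbatim `TwoProducts` / g8 / g9). -/
def nv (D : Poly2) : ℕ :=
  (Set.extremePoints ℝ (convexHull ℝ (emb '' (D.support : Set (Fin 2 →₀ ℕ))))).ncard

/-- Euler derivation `θᵢ = Xᵢ ∂ᵢ` (verbatim g9). -/
def theta (i : Fin 2) (F : Poly2) : Poly2 := X i * pderiv i F

/-- Toric Jacobian `J(F,G) = θ₀F·θ₁G − θ₁F·θ₀G` (verbatim g9). -/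
def jac (F G : Poly2) : Poly2 := theta 0 F * theta 1 G - theta 1 F * theta 0 G

/-! ## The new object -/

/-- TORIC WRONSKIAN of three bivariate polynomials: `Ω(w) = det [w ; θ₀ w ; θ₁ w]`
`= w₀ J(w₁,w₂) + w₁ J(w₂,w₀) + w₂ J(w₀,w₁)`.  Trilinear, alternating, `Ω(Bw) = det B · Ω(w)`,
`supp Ω ⊆ S₀+S₁+S₂` (`≤ t³` monomials); `Ω = 0` iff `w₁/w₀, w₂/w₀` are algebraically dependent. -/
def omega (w : Fin 3 → Poly2) : Poly2 :=
  w 0 * jac (w 1) (w 2) + w 1 * jac (w 2) (w 0) + w 2 * jac (w 0) (w 1)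

/-- The first-order operator `L_k^{u,v} F = v·J(F,u) − u·J(F,v) + k·J(u,v)·F` (for `F = Q(w)` with `Q` homogeneous of
degree `k`, `L_k^{w₀,w₁} F = Ω(w)·(∂₂Q)(w)` — `wronskianRule`). -/
def ell (k : ℕ) (u v F : Poly2) : Poly2 := v * jac F u - u * jac F v + (k : ℂ) • (jac u v * F)

/-! ## Statements (paper theorems of the memo) -/

/-- (VERDICT #42 (P2)) the `P(w) = 0` corner of the laws below: the zero polynomial has no vertex. -/
theorem nv_zero : nv 0 = 0 := by
  simp [nv]

/-- RANK-THREE LINEAR LAW (memo §3 Theorem, coarse form): `Newt P(w₀,w₁,w₂)` has `poly(m,t)` vertices for HOMOGENEOUS `P`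
of degree `m`.  READING (VERDICT #42 (P2)): `t` bounds the sparsity of the three GENERATORS `w i` ONLY — `P` is any
homogeneous polynomial with any number of monomials (this is NOT a sparse-`P` statement); `w 2 = 1`, `w = 0` and
`P(w) = 0` (`nv_zero`) are allowed corners.  (Non-homogeneous `P` of rank 3 = homogeneous rank 4 is the ONSET of record,
memo §4: not claimed.) -/
def RankThreeLinearLaw : Prop :=
  ∃ c : ℕ, ∀ (m t : ℕ) (P : Poly3) (w : Fin 3 → Poly2),
    P.IsHomogeneous m → (∀ i, (w i).support.card ≤ t) →
    nv (MvPolynomial.aeval w P) ≤ (m + 2) ^ c * (t + 2) ^ c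

/-- RANK-THREE EXPLICIT BOUND (memo §3 Theorem): `nv P(w) ≤ t³ + 9t²(4m+1)`
(`|X| ≤ 9t²` crossing directions, `nv Ω ≤ t³`, `≤ 4` line-special directions per (arc, tower level), `m` levels, `≤ 9t²` arcs). -/
def RankThreeExplicitBound : Prop :=
  ∀ (m t : ℕ) (P : Poly3) (w : Fin 3 → Poly2),
    P.IsHomogeneous m → (∀ i, (w i).support.card ≤ t) →
    nv (MvPolynomial.aeval w P) ≤ t ^ 3 + 9 * t ^ 2 * (4 * m + 1)

/-- The class of `TwoProducts` instances DECIDED by the law: tables `f, g : Fin m → ℂ[x,y]` all of whose `2m` rows lie in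
the span of three `t`-sparse polynomials `w₀,w₁,w₂` (w.l.o.g. three of the rows).  Bound polynomial in `m` AND `t`. -/
def TwoProductsLinRankThree : Prop :=
  ∃ c : ℕ, ∀ (m t : ℕ) (f g : Fin m → Poly2) (w : Fin 3 → Poly2),
    (∀ j, ∃ a : Fin 3 → ℂ, f j = ∑ i, a i • w i) → (∀ j, ∃ a : Fin 3 → ℂ, g j = ∑ i, a i • w i) →
    (∀ i, (w i).support.card ≤ t) →
    nv (∏ j, f j - ∏ j, g j) ≤ (m + 2) ^ c * (t + 2) ^ c

/-! ## Vocabulary of the transfer (verbatim g9 where marked) -/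

/-- `ν`-weight of an exponent (verbatim g9). -/
def wt (ν : Fin 2 → ℝ) (e : Fin 2 →₀ ℕ) : ℝ := ν 0 * ((e 0 : ℕ) : ℝ) + ν 1 * ((e 1 : ℕ) : ℝ)

/-- `ν` is an EDGE DIRECTION of `Newt F` (verbatim g9). -/
def IsEdgeDir (ν : Fin 2 → ℝ) (F : Poly2) : Prop :=
  ∃ p ∈ F.support, ∃ q ∈ F.support, p ≠ q ∧ (∀ r ∈ F.support, wt ν r ≤ wt ν p) ∧ wt ν q = wt ν p

/-- integer determinant of two exponents (verbatim g9) -/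
def idet (γ s : Fin 2 →₀ ℕ) : ℤ := ((γ 0 : ℕ) : ℤ) * ((s 1 : ℕ) : ℤ) - ((γ 1 : ℕ) : ℤ) * ((s 0 : ℕ) : ℤ)

/-- `p` is the STRICT `ν`-top exponent of `w` (on an arc of directions avoiding the `≤ 9t²` crossing directions of
`S₀ ∪ S₁ ∪ S₂`, every `wᵢ'` of the `ν`-echelon basis has one, and the three pivots have distinct weights). -/
def IsUniqueTop (ν : Fin 2 → ℝ) (w : Poly2) (p : Fin 2 →₀ ℕ) : Prop :=
  p ∈ w.support ∧ ∀ s ∈ w.support, s ≠ p → wt ν s < wt ν p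

/-- The multiplier of the transfer: `λ_k(γ) = det(γ,p₀) − det(γ,p₁) + k·det(p₀,p₁) = det(γ − k·p₀, p₀ − p₁)`;
it vanishes exactly on the LINE through `k·p₀` and `k·p₁`. -/
def lam (k : ℕ) (p₀ p₁ γ : Fin 2 →₀ ℕ) : ℤ := idet γ p₀ - idet γ p₁ + (k : ℤ) * idet p₀ p₁

/-- `ν` is LINE-SPECIAL for `F` (w.r.t. `k, p₀, p₁`): the `ν`-top set of `supp F` is exactly two points, one ON the line
`λ_k = 0`.  Such a point is a vertex of `Newt F` on a fixed line, so there are `≤ 2·2 = 4` line-special directions per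
(arc, `F`) — the only directions the transfer can lose. -/
def IsLineSpecial (ν : Fin 2 → ℝ) (F : Poly2) (k : ℕ) (p₀ p₁ : Fin 2 →₀ ℕ) : Prop :=
  ∃ p ∈ F.support, ∃ q ∈ F.support, p ≠ q ∧ (∀ r ∈ F.support, wt ν r ≤ wt ν p) ∧ wt ν q = wt ν p ∧
    (∀ r ∈ F.support, wt ν r = wt ν p → r = p ∨ r = q) ∧ (lam k p₀ p₁ p = 0 ∨ lam k p₀ p₁ q = 0)

/-- WRONSKIAN TRANSFER (typed; PROVED below as `wronskianTransfer`). -/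
def WronskianTransfer : Prop :=
  ∀ (ν : Fin 2 → ℝ) (F u v : Poly2) (k : ℕ) (p₀ p₁ : Fin 2 →₀ ℕ),
    F ≠ 0 → IsUniqueTop ν u p₀ → IsUniqueTop ν v p₁ → wt ν p₀ ≠ wt ν p₁ → IsEdgeDir ν F →
    IsLineSpecial ν F k p₀ p₁ ∨ IsEdgeDir ν (ell k u v F)

/-- PORT PLAN (statement of the remaining, routine bookkeeping; memo §3): echelon basis per arc (linear algebra on `≤ 3t`
support points), `wronskianRule` + `wronskianTransfer` + Ostrowski (g9 `ostrowski`, verbatim) along the tower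
`F_j = (∂₂^j P')(w')`, `j < m`, and the vertex count `nv ≤ |X| + nv Ω + Σ_arcs Σ_j #special`. -/
def PortPlan3 : Prop :=
  (WronskianTransfer → RankThreeExplicitBound) ∧ (RankThreeExplicitBound → RankThreeLinearLaw) ∧
  (RankThreeLinearLaw → TwoProductsLinRankThree)


/-! ## Kernel: the WRONSKIAN RULE (Euler + two chain rules eliminate to a product), sorry-free -/

theorem jac_self (F : Poly2) : jac F F = 0 := by
  unfold jac; ring

/-- `F ↦ J(F, G)` as a `ℂ`-derivation of `ℂ[x,y]` (verbatim g9). -/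
def jacDer (G : Poly2) : Derivation ℂ Poly2 Poly2 :=
  (X 0 * theta 1 G) • (pderiv 0 : Derivation ℂ Poly2 Poly2) -
    (X 1 * theta 0 G) • (pderiv 1 : Derivation ℂ Poly2 Poly2)

theorem jacDer_apply (G F : Poly2) : jacDer G F = jac F G := by
  simp only [jacDer, Derivation.sub_apply, Derivation.smul_apply, smul_eq_mul, jac, theta]
  ring

/-- Chain rule for derivations along polynomial maps: `D(p(a)) = Σ_i (∂_i p)(a) · D(a_i)` (verbatim g9; folklore). -/
theorem derivation_map_aeval {R A M : Type*} [CommRing R] [CommRing A] [Algebra R A] [AddCommGroup M] [Module A M]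
    [Module R M] {σ : Type*} [Fintype σ] [DecidableEq σ]
    (D : Derivation R A M) (a : σ → A) (p : MvPolynomial σ R) :
    D (aeval a p) = ∑ i, aeval a (pderiv i p) • D (a i) := by
  induction p using MvPolynomial.induction_on with
  | C r => simp
  | add p q hp hq =>
    simp only [map_add, hp, hq, add_smul, Finset.sum_add_distrib]
  | mul_X p s hp =>
    have hX : ∀ i : σ, aeval a (pderiv i (X s : MvPolynomial σ R)) = if s = i then (1 : A) else 0 := by
      intro i
      rw [pderiv_X, Pi.single_apply]
      split_ifs <;> simp
    have hR : ∀ i, aeval a (pderiv i (p * X s)) • D (a i) =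
        (a s * aeval a (pderiv i p)) • D (a i) + (if s = i then aeval a p • D (a i) else 0) := by
      intro i
      rw [Derivation.leibniz, map_add, smul_eq_mul, smul_eq_mul, map_mul, map_mul, aeval_X, hX,
        add_smul, add_comm]
      congr 1
      split_ifs <;> simp
    rw [map_mul, aeval_X, Derivation.leibniz, hp]
    simp_rw [hR, Finset.sum_add_distrib, Finset.sum_ite_eq, Finset.mem_univ, if_true]
    rw [add_comm, Finset.smul_sum]
    congr 1
    refine Finset.sum_congr rfl fun i _ => ?_
    rw [smul_smul]

/-- THREE-variable chain rule for the biderivation `J`: `J(P(w), G) = Σᵢ (∂ᵢP)(w) · J(wᵢ, G)`. -/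
theorem chainRule3 (P : Poly3) (w : Fin 3 → Poly2) (G : Poly2) :
    jac (aeval w P) G = ∑ i : Fin 3, aeval w (pderiv i P) * jac (w i) G := by
  have h := derivation_map_aeval (jacDer G) w P
  rw [jacDer_apply] at h
  rw [h]
  simp only [Fin.sum_univ_three, smul_eq_mul, jacDer_apply]

/-- Euler's identity, evaluated at `w`: `Σᵢ wᵢ·(∂ᵢP)(w) = m·P(w)`. -/
theorem euler_aeval (P : Poly3) (m : ℕ) (hP : P.IsHomogeneous m) (w : Fin 3 → Poly2) :
    ∑ i : Fin 3, w i * aeval w (pderiv i P) = (m : ℂ) • aeval w P := by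
  have h := congrArg (aeval w) hP.sum_X_mul_pderiv
  rw [map_sum, map_nsmul] at h
  simp_rw [map_mul, aeval_X] at h
  rw [h, Nat.cast_smul_eq_nsmul]

/-- **THE WRONSKIAN RULE in the kernel** (identity (I) of the memo): for `P` homogeneous of degree `m`,
`Ω(w) · (∂₂P)(w) = w₁·J(P(w),w₀) − w₀·J(P(w),w₁) + m·J(w₀,w₁)·P(w)`. -/
theorem wronskianRule (w : Fin 3 → Poly2) (P : Poly3) (m : ℕ) (hP : P.IsHomogeneous m) :
    omega w * aeval w (pderiv 2 P) = ell m (w 0) (w 1) (aeval w P) := by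
  have hE := euler_aeval P m hP w
  have h0 := chainRule3 P w (w 0)
  have h1 := chainRule3 P w (w 1)
  simp only [Fin.sum_univ_three] at hE h0 h1
  rw [Algebra.smul_def] at hE
  unfold ell
  rw [h0, h1, Algebra.smul_def]
  unfold omega jac
  linear_combination (theta 0 (w 0) * theta 1 (w 1) - theta 1 (w 0) * theta 0 (w 1)) * hE

/-- The cyclic companions (same proof): `Ω·(∂₀P)(w) = L_m^{w₁,w₂} P(w)` and `Ω·(∂₁P)(w) = L_m^{w₂,w₀} P(w)`. -/
theorem wronskianRule₀ (w : Fin 3 → Poly2) (P : Poly3) (m : ℕ) (hP : P.IsHomogeneous m) :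
    omega w * aeval w (pderiv 0 P) = ell m (w 1) (w 2) (aeval w P) := by
  have hE := euler_aeval P m hP w
  have h1 := chainRule3 P w (w 1)
  have h2 := chainRule3 P w (w 2)
  simp only [Fin.sum_univ_three] at hE h1 h2
  rw [Algebra.smul_def] at hE
  unfold ell
  rw [h1, h2, Algebra.smul_def]
  unfold omega jac
  linear_combination (theta 0 (w 1) * theta 1 (w 2) - theta 1 (w 1) * theta 0 (w 2)) * hE

theorem wronskianRule₁ (w : Fin 3 → Poly2) (P : Poly3) (m : ℕ) (hP : P.IsHomogeneous m) :
    omega w * aeval w (pderiv 1 P) = ell m (w 2) (w 0) (aeval w P) := by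
  have hE := euler_aeval P m hP w
  have h2 := chainRule3 P w (w 2)
  have h0 := chainRule3 P w (w 0)
  simp only [Fin.sum_univ_three] at hE h2 h0
  rw [Algebra.smul_def] at hE
  unfold ell
  rw [h2, h0, Algebra.smul_def]
  unfold omega jac
  linear_combination (theta 0 (w 2) * theta 1 (w 0) - theta 1 (w 2) * theta 0 (w 0)) * hE


/-! ## Kernel: support and coefficient bookkeeping (verbatim g9 where marked) -/

theorem theta_monomial (i : Fin 2) (s : Fin 2 →₀ ℕ) (a : ℂ) :
    theta i (monomial s a) = monomial s (a * (s i : ℂ)) := by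
  unfold theta
  rw [pderiv_monomial]
  by_cases h : s i = 0
  · simp [h]
  · rw [show (X i : Poly2) = monomial (Finsupp.single i 1) 1 from rfl, monomial_mul, one_mul,
      add_tsub_cancel_of_le (Finsupp.single_le_iff.mpr (Nat.one_le_iff_ne_zero.mpr h))]

theorem theta_eq_sum (i : Fin 2) (F : Poly2) :
    theta i F = ∑ s ∈ F.support, monomial s (coeff s F * (s i : ℂ)) := by
  conv_lhs => rw [F.as_sum]
  unfold theta
  rw [map_sum, Finset.mul_sum]
  refine Finset.sum_congr rfl fun s _ => ?_
  have := theta_monomial i s (coeff s F)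
  unfold theta at this
  exact this

/-- `θᵢ` does not enlarge supports (verbatim g9). -/
theorem support_theta_subset (i : Fin 2) (F : Poly2) : (theta i F).support ⊆ F.support := by
  rw [theta_eq_sum]
  intro e he
  obtain ⟨s, hs, hes⟩ := Finset.mem_biUnion.mp (MvPolynomial.support_sum he)
  have := MvPolynomial.support_monomial_subset hes
  rw [Finset.mem_singleton] at this
  rwa [this]

/-- `supp J(F,G) ⊆ supp F + supp G` (verbatim g9). -/
theorem support_jac_subset (F G : Poly2) : (jac F G).support ⊆ F.support + G.support := by
  unfold jac
  refine (MvPolynomial.support_sub ..).trans (Finset.union_subset ?_ ?_)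
  · exact (MvPolynomial.support_mul _ _).trans
      (Finset.add_subset_add (support_theta_subset 0 F) (support_theta_subset 1 G))
  · exact (MvPolynomial.support_mul _ _).trans
      (Finset.add_subset_add (support_theta_subset 1 F) (support_theta_subset 0 G))

/-- `supp Ω(w) ⊆ S₀ + S₁ + S₂`, hence `≤ t³` monomials. -/
theorem support_omega_subset (w : Fin 3 → Poly2) :
    (omega w).support ⊆ (w 0).support + (w 1).support + (w 2).support := by
  unfold omega
  refine (MvPolynomial.support_add).trans (Finset.union_subset ((MvPolynomial.support_add).trans
    (Finset.union_subset ?_ ?_)) ?_)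
  · refine (MvPolynomial.support_mul _ _).trans ?_
    refine (Finset.add_subset_add_left (support_jac_subset (w 1) (w 2))).trans ?_
    rw [← add_assoc]
  · refine (MvPolynomial.support_mul _ _).trans ?_
    refine (Finset.add_subset_add_left (support_jac_subset (w 2) (w 0))).trans ?_
    rw [← add_assoc, add_right_comm, add_comm ((w 1).support)]
  · refine (MvPolynomial.support_mul _ _).trans ?_
    refine (Finset.add_subset_add_left (support_jac_subset (w 0) (w 1))).trans ?_
    rw [← add_assoc, add_rotate]

theorem card_support_omega_le (w : Fin 3 → Poly2) (t : ℕ) (hw : ∀ i, (w i).support.card ≤ t) :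
    (omega w).support.card ≤ t ^ 3 := by
  calc (omega w).support.card ≤ ((w 0).support + (w 1).support + (w 2).support).card :=
        Finset.card_le_card (support_omega_subset w)
    _ ≤ ((w 0).support + (w 1).support).card * (w 2).support.card := Finset.card_add_le
    _ ≤ ((w 0).support.card * (w 1).support.card) * (w 2).support.card :=
        Nat.mul_le_mul_right _ Finset.card_add_le
    _ ≤ (t * t) * t := Nat.mul_le_mul (Nat.mul_le_mul (hw 0) (hw 1)) (hw 2)
    _ = t ^ 3 := by ring

theorem wt_add (ν : Fin 2 → ℝ) (a b : Fin 2 →₀ ℕ) : wt ν (a + b) = wt ν a + wt ν b := by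
  simp only [wt, Finsupp.add_apply, Nat.cast_add]; ring

theorem coeff_eq_zero_of_not_mem {F : Poly2} {a : Fin 2 →₀ ℕ} (ha : a ∉ F.support) : coeff a F = 0 := by
  simpa [MvPolynomial.mem_support_iff] using ha

/-- Coefficient of a product at a sum with a unique support decomposition (verbatim g9). -/
theorem coeff_mul_of_unique (F G : Poly2) (a₀ b₀ : Fin 2 →₀ ℕ)
    (h : ∀ a ∈ F.support, ∀ b ∈ G.support, a + b = a₀ + b₀ → a = a₀ ∧ b = b₀) :
    coeff (a₀ + b₀) (F * G) = coeff a₀ F * coeff b₀ G := by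
  rw [coeff_mul]
  apply Finset.sum_eq_single (a₀, b₀)
  · rintro ⟨a, b⟩ hab hne
    rw [Finset.HasAntidiagonal.mem_antidiagonal] at hab
    by_cases ha : a ∈ F.support
    · by_cases hb : b ∈ G.support
      · obtain ⟨rfl, rfl⟩ := h a ha b hb hab
        exact absurd rfl hne
      · simp only [coeff_eq_zero_of_not_mem hb, mul_zero]
    · simp only [coeff_eq_zero_of_not_mem ha, zero_mul]
  · intro hn
    exfalso; apply hn
    rw [Finset.HasAntidiagonal.mem_antidiagonal]

theorem idet_zero_right (γ : Fin 2 →₀ ℕ) : idet γ 0 = 0 := by simp [idet]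

/-- `J(F,w)` as an explicit double sum of monomials (verbatim g9). -/
theorem jac_eq_sum (F w : Poly2) :
    jac F w = ∑ γ ∈ F.support, ∑ s ∈ w.support,
      monomial (γ + s) (coeff γ F * coeff s w * ((idet γ s : ℤ) : ℂ)) := by
  unfold jac
  rw [theta_eq_sum 0 F, theta_eq_sum 1 w, theta_eq_sum 1 F, theta_eq_sum 0 w,
    Finset.sum_mul_sum, Finset.sum_mul_sum, ← Finset.sum_sub_distrib]
  refine Finset.sum_congr rfl fun γ _ => ?_
  rw [← Finset.sum_sub_distrib]
  refine Finset.sum_congr rfl fun s _ => ?_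
  rw [monomial_mul, monomial_mul, ← map_sub]
  congr 1
  simp only [idet, Int.cast_sub, Int.cast_mul, Int.cast_natCast]
  ring

theorem coeff_jac (F w : Poly2) (u : Fin 2 →₀ ℕ) :
    coeff u (jac F w) = ∑ x ∈ F.support ×ˢ w.support,
      (if x.1 + x.2 = u then coeff x.1 F * coeff x.2 w * ((idet x.1 x.2 : ℤ) : ℂ) else 0) := by
  rw [jac_eq_sum, coeff_sum, Finset.sum_product]
  refine Finset.sum_congr rfl fun γ _ => ?_
  rw [coeff_sum]
  refine Finset.sum_congr rfl fun s _ => ?_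
  rw [coeff_monomial]

theorem IsUniqueTop.le {ν : Fin 2 → ℝ} {w : Poly2} {p : Fin 2 →₀ ℕ} (h : IsUniqueTop ν w p) :
    ∀ s ∈ w.support, wt ν s ≤ wt ν p := by
  intro s hs
  by_cases hsp : s = p
  · rw [hsp]
  · exact le_of_lt (h.2 s hs hsp)

theorem IsUniqueTop.eq_of_le {ν : Fin 2 → ℝ} {w : Poly2} {p : Fin 2 →₀ ℕ} (h : IsUniqueTop ν w p)
    {s : Fin 2 →₀ ℕ} (hs : s ∈ w.support) (hle : wt ν p ≤ wt ν s) : s = p := by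
  by_contra hsp
  exact absurd (h.2 s hs hsp) (not_lt.mpr hle)

/-- weights on `supp J(A,B)` are bounded by top weight of `A` plus top weight of `B` -/
theorem wt_le_of_mem_support_jac (ν : Fin 2 → ℝ) (A B : Poly2) (a b : ℝ)
    (hA : ∀ x ∈ A.support, wt ν x ≤ a) (hB : ∀ y ∈ B.support, wt ν y ≤ b) :
    ∀ z ∈ (jac A B).support, wt ν z ≤ a + b := by
  intro z hz
  obtain ⟨x, hx, y, hy, rfl⟩ := Finset.mem_add.mp (support_jac_subset A B hz)
  rw [wt_add]; linarith [hA x hx, hB y hy]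

theorem wt_le_of_mem_support_mul (ν : Fin 2 → ℝ) (A B : Poly2) (a b : ℝ)
    (hA : ∀ x ∈ A.support, wt ν x ≤ a) (hB : ∀ y ∈ B.support, wt ν y ≤ b) :
    ∀ z ∈ (A * B).support, wt ν z ≤ a + b := by
  intro z hz
  obtain ⟨x, hx, y, hy, rfl⟩ := Finset.mem_add.mp (MvPolynomial.support_mul A B hz)
  rw [wt_add]; linarith [hA x hx, hB y hy]

/-- The TOP coefficient of `J(F,w)` above a top point `γ₀` of `F`, when `p` is the unique top of `w`. -/
theorem coeff_jac_uniqueTop (ν : Fin 2 → ℝ) (F w : Poly2) (p γ₀ : Fin 2 →₀ ℕ) (hw : IsUniqueTop ν w p)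
    (hγ₀ : γ₀ ∈ F.support) (htop : ∀ r ∈ F.support, wt ν r ≤ wt ν γ₀) :
    coeff (γ₀ + p) (jac F w) = coeff γ₀ F * coeff p w * ((idet γ₀ p : ℤ) : ℂ) := by
  have hp := hw.1
  rw [coeff_jac]
  rw [Finset.sum_eq_single (γ₀, p)]
  · simp
  · rintro ⟨γ, s⟩ hx hne
    obtain ⟨hγ, hs⟩ := Finset.mem_product.mp hx
    dsimp only
    split_ifs with h
    · exfalso
      by_cases hse : s = p
      · subst hse
        exact hne (Prod.ext (add_right_cancel h) rfl)
      · have hlt := hw.2 s hs hse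
        have hle := htop γ hγ
        have hw' : wt ν γ + wt ν s = wt ν γ₀ + wt ν p := by rw [← wt_add, ← wt_add, h]
        linarith
    · rfl
  · intro hn
    exact absurd (Finset.mem_product.mpr ⟨hγ₀, hp⟩) hn

/-- All weights on `supp (L_k^{u,v} F)` are `≤ wt γ₀ + wt p₀ + wt p₁` (`γ₀` a top point of `F`). -/
theorem wt_le_of_mem_support_ell (ν : Fin 2 → ℝ) (F u v : Poly2) (k : ℕ) (p₀ p₁ γ₀ : Fin 2 →₀ ℕ)
    (hu : IsUniqueTop ν u p₀) (hv : IsUniqueTop ν v p₁) (htop : ∀ r ∈ F.support, wt ν r ≤ wt ν γ₀) :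
    ∀ r ∈ (ell k u v F).support, wt ν r ≤ wt ν γ₀ + wt ν p₀ + wt ν p₁ := by
  intro r hr
  unfold ell at hr
  rcases Finset.mem_union.mp (MvPolynomial.support_add hr) with h12 | h3
  · rcases Finset.mem_union.mp ((MvPolynomial.support_sub ..) h12) with hA | hB
    · have := wt_le_of_mem_support_mul ν v (jac F u) (wt ν p₁) (wt ν γ₀ + wt ν p₀) hv.le
        (wt_le_of_mem_support_jac ν F u (wt ν γ₀) (wt ν p₀) htop hu.le) r hA
      linarith
    · have := wt_le_of_mem_support_mul ν u (jac F v) (wt ν p₀) (wt ν γ₀ + wt ν p₁) hu.le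
        (wt_le_of_mem_support_jac ν F v (wt ν γ₀) (wt ν p₁) htop hv.le) r hB
      linarith
  · have h3' := MvPolynomial.support_smul h3
    have := wt_le_of_mem_support_mul ν (jac u v) F (wt ν p₀ + wt ν p₁) (wt ν γ₀)
      (wt_le_of_mem_support_jac ν u v (wt ν p₀) (wt ν p₁) hu.le hv.le) htop r h3'
    linarith

/-- **TOP COEFFICIENT FORMULA**: above a top point `γ` of `F`, the coefficient of `X^{γ+p₀+p₁}` in `L_k^{u,v} F` is
`F_γ · u_{p₀} · v_{p₁} · λ_k(γ)` — so it vanishes iff `γ` lies on the line `λ_k = 0`. -/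
theorem coeff_ell_top (ν : Fin 2 → ℝ) (F u v : Poly2) (k : ℕ) (p₀ p₁ γ : Fin 2 →₀ ℕ)
    (hu : IsUniqueTop ν u p₀) (hv : IsUniqueTop ν v p₁)
    (hγ : γ ∈ F.support) (htop : ∀ r ∈ F.support, wt ν r ≤ wt ν γ) :
    coeff (γ + p₀ + p₁) (ell k u v F) = coeff γ F * coeff p₀ u * coeff p₁ v * ((lam k p₀ p₁ γ : ℤ) : ℂ) := by
  have hA : coeff (γ + p₀ + p₁) (v * jac F u) = coeff p₁ v * (coeff γ F * coeff p₀ u * ((idet γ p₀ : ℤ) : ℂ)) := by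
    rw [show γ + p₀ + p₁ = p₁ + (γ + p₀) from add_comm _ _]
    rw [coeff_mul_of_unique v (jac F u) p₁ (γ + p₀) ?_, coeff_jac_uniqueTop ν F u p₀ γ hu hγ htop]
    intro a ha b hb hab
    have hwa := hv.le a ha
    have hwb := wt_le_of_mem_support_jac ν F u (wt ν γ) (wt ν p₀) htop hu.le b hb
    have hsum := congrArg (wt ν) hab
    simp only [wt_add] at hsum
    have ha' : a = p₁ := hv.eq_of_le ha (by linarith)
    refine ⟨ha', ?_⟩
    rw [ha'] at hab
    exact add_left_cancel hab
  have hB : coeff (γ + p₀ + p₁) (u * jac F v) = coeff p₀ u * (coeff γ F * coeff p₁ v * ((idet γ p₁ : ℤ) : ℂ)) := by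
    rw [show γ + p₀ + p₁ = p₀ + (γ + p₁) by rw [add_right_comm, add_comm]]
    rw [coeff_mul_of_unique u (jac F v) p₀ (γ + p₁) ?_, coeff_jac_uniqueTop ν F v p₁ γ hv hγ htop]
    intro a ha b hb hab
    have hwa := hu.le a ha
    have hwb := wt_le_of_mem_support_jac ν F v (wt ν γ) (wt ν p₁) htop hv.le b hb
    have hsum := congrArg (wt ν) hab
    simp only [wt_add] at hsum
    have ha' : a = p₀ := hu.eq_of_le ha (by linarith)
    refine ⟨ha', ?_⟩
    rw [ha'] at hab
    exact add_left_cancel hab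
  have hC : coeff (γ + p₀ + p₁) (jac u v * F) = coeff p₀ u * coeff p₁ v * ((idet p₀ p₁ : ℤ) : ℂ) * coeff γ F := by
    rw [show γ + p₀ + p₁ = (p₀ + p₁) + γ by rw [add_assoc, add_comm]]
    rw [coeff_mul_of_unique (jac u v) F (p₀ + p₁) γ ?_, coeff_jac_uniqueTop ν u v p₁ p₀ hv hu.1 hu.le]
    intro a ha b hb hab
    obtain ⟨x, hx, y, hy, rfl⟩ := Finset.mem_add.mp (support_jac_subset u v ha)
    have hwb := htop b hb
    have hsum := congrArg (wt ν) hab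
    simp only [wt_add] at hsum
    have hx' : x = p₀ := hu.eq_of_le hx (by linarith [hu.le x hx, hv.le y hy])
    have hy' : y = p₁ := hv.eq_of_le hy (by linarith [hu.le x hx, hv.le y hy])
    rw [hx', hy'] at hab ⊢
    exact ⟨rfl, add_left_cancel hab⟩
  unfold ell
  rw [coeff_add, coeff_sub, coeff_smul, hA, hB, hC, smul_eq_mul]
  simp only [lam, Int.cast_add, Int.cast_sub, Int.cast_mul, Int.cast_natCast]
  ring


/-! ## Kernel: the WRONSKIAN TRANSFER (the load-bearing step of rung 3-LIN), sorry-free -/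

/-- Two points of equal `ν`-weight on the line `λ_k = 0` coincide, because that line has direction `p₀ − p₁` and
`⟨ν, p₀ − p₁⟩ ≠ 0`. -/
theorem onLine_unique (ν : Fin 2 → ℝ) (k : ℕ) (p₀ p₁ γ₁ γ₂ : Fin 2 →₀ ℕ) (h01 : wt ν p₀ ≠ wt ν p₁)
    (hw : wt ν γ₁ = wt ν γ₂) (h1 : lam k p₀ p₁ γ₁ = 0) (h2 : lam k p₀ p₁ γ₂ = 0) : γ₁ = γ₂ := by
  have h1r : ((lam k p₀ p₁ γ₁ : ℤ) : ℝ) = 0 := by exact_mod_cast h1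
  have h2r : ((lam k p₀ p₁ γ₂ : ℤ) : ℝ) = 0 := by exact_mod_cast h2
  simp only [lam, idet, Int.cast_add, Int.cast_sub, Int.cast_mul, Int.cast_natCast] at h1r h2r
  unfold wt at hw h01
  -- d = γ₁ − γ₂, e = p₀ − p₁ :  det(d,e) = 0, ⟨ν,d⟩ = 0  ⇒  ⟨ν,e⟩·d = 0
  have L : (((γ₁ 0 : ℕ) : ℝ) - ((γ₂ 0 : ℕ) : ℝ)) * (((p₀ 1 : ℕ) : ℝ) - ((p₁ 1 : ℕ) : ℝ)) -
      (((γ₁ 1 : ℕ) : ℝ) - ((γ₂ 1 : ℕ) : ℝ)) * (((p₀ 0 : ℕ) : ℝ) - ((p₁ 0 : ℕ) : ℝ)) = 0 := by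
    linear_combination h1r - h2r
  have H : ν 0 * (((γ₁ 0 : ℕ) : ℝ) - ((γ₂ 0 : ℕ) : ℝ)) + ν 1 * (((γ₁ 1 : ℕ) : ℝ) - ((γ₂ 1 : ℕ) : ℝ)) = 0 := by
    linear_combination hw
  have W0 : (ν 0 * ((p₀ 0 : ℕ) : ℝ) + ν 1 * ((p₀ 1 : ℕ) : ℝ) - (ν 0 * ((p₁ 0 : ℕ) : ℝ) + ν 1 * ((p₁ 1 : ℕ) : ℝ))) *
      (((γ₁ 0 : ℕ) : ℝ) - ((γ₂ 0 : ℕ) : ℝ)) = 0 := by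
    linear_combination (((p₀ 0 : ℕ) : ℝ) - ((p₁ 0 : ℕ) : ℝ)) * H + (ν 1) * L
  have W1 : (ν 0 * ((p₀ 0 : ℕ) : ℝ) + ν 1 * ((p₀ 1 : ℕ) : ℝ) - (ν 0 * ((p₁ 0 : ℕ) : ℝ) + ν 1 * ((p₁ 1 : ℕ) : ℝ))) *
      (((γ₁ 1 : ℕ) : ℝ) - ((γ₂ 1 : ℕ) : ℝ)) = 0 := by
    linear_combination (((p₀ 1 : ℕ) : ℝ) - ((p₁ 1 : ℕ) : ℝ)) * H - (ν 0) * L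
  have hW : ν 0 * ((p₀ 0 : ℕ) : ℝ) + ν 1 * ((p₀ 1 : ℕ) : ℝ) - (ν 0 * ((p₁ 0 : ℕ) : ℝ) + ν 1 * ((p₁ 1 : ℕ) : ℝ)) ≠ 0 :=
    sub_ne_zero.mpr h01
  have e0 : ((γ₁ 0 : ℕ) : ℝ) = ((γ₂ 0 : ℕ) : ℝ) := by
    have := (mul_eq_zero.mp W0).resolve_left hW
    linarith
  have e1 : ((γ₁ 1 : ℕ) : ℝ) = ((γ₂ 1 : ℕ) : ℝ) := by
    have := (mul_eq_zero.mp W1).resolve_left hW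
    linarith
  ext i
  fin_cases i
  · exact_mod_cast e0
  · exact_mod_cast e1

/-- **THE WRONSKIAN TRANSFER in the kernel.** -/
theorem wronskianTransfer : WronskianTransfer := by
  intro ν F u v k p₀ p₁ hF hu hv h01 hedge
  obtain ⟨p, hp, q, hq, hpq, hpmax, hwq⟩ := hedge
  by_cases hax : ∃ γ₁ ∈ F.support, ∃ γ₂ ∈ F.support,
      γ₁ ≠ γ₂ ∧ wt ν γ₁ = wt ν p ∧ wt ν γ₂ = wt ν p ∧ lam k p₀ p₁ γ₁ ≠ 0 ∧ lam k p₀ p₁ γ₂ ≠ 0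
  · -- Case A: two top points OFF the line ⇒ an edge of `L F` in direction ν
    right
    obtain ⟨γ₁, h1, γ₂, h2, hne, hw1, hw2, hl1, hl2⟩ := hax
    have top1 : ∀ r ∈ F.support, wt ν r ≤ wt ν γ₁ := fun r hr => hw1 ▸ hpmax r hr
    have top2 : ∀ r ∈ F.support, wt ν r ≤ wt ν γ₂ := fun r hr => hw2 ▸ hpmax r hr
    have mem : ∀ γ ∈ F.support, (∀ r ∈ F.support, wt ν r ≤ wt ν γ) → lam k p₀ p₁ γ ≠ 0 →
        γ + p₀ + p₁ ∈ (ell k u v F).support := by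
      intro γ hγ htop hl
      rw [MvPolynomial.mem_support_iff, coeff_ell_top ν F u v k p₀ p₁ γ hu hv hγ htop]
      refine mul_ne_zero (mul_ne_zero (mul_ne_zero ?_ ?_) ?_) ?_
      · exact MvPolynomial.mem_support_iff.mp hγ
      · exact MvPolynomial.mem_support_iff.mp hu.1
      · exact MvPolynomial.mem_support_iff.mp hv.1
      · exact_mod_cast hl
    refine ⟨γ₁ + p₀ + p₁, mem γ₁ h1 top1 hl1, γ₂ + p₀ + p₁, mem γ₂ h2 top2 hl2, ?_, ?_, ?_⟩
    · intro h
      exact hne (add_right_cancel (add_right_cancel h))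
    · intro r hr
      have := wt_le_of_mem_support_ell ν F u v k p₀ p₁ γ₁ hu hv top1 r hr
      rw [wt_add, wt_add]
      exact this
    · simp only [wt_add, hw1, hw2]
  · -- Case B: at most one top point off the line ⇒ ν is line-special for F
    left
    push Not at hax
    have uniq : ∀ γ₁ γ₂ : Fin 2 →₀ ℕ, wt ν γ₁ = wt ν p → wt ν γ₂ = wt ν p →
        lam k p₀ p₁ γ₁ = 0 → lam k p₀ p₁ γ₂ = 0 → γ₁ = γ₂ :=
      fun γ₁ γ₂ hw1 hw2 hl1 hl2 => onLine_unique ν k p₀ p₁ γ₁ γ₂ h01 (hw1.trans hw2.symm) hl1 hl2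
    refine ⟨p, hp, q, hq, hpq, hpmax, hwq, ?_, ?_⟩
    · intro r hr hwr
      by_contra hnot
      push Not at hnot
      obtain ⟨hrp, hrq⟩ := hnot
      by_cases hpa : lam k p₀ p₁ p = 0
      · have hqa : lam k p₀ p₁ q ≠ 0 := fun h => hpq (uniq p q rfl hwq hpa h)
        have hra : lam k p₀ p₁ r ≠ 0 := fun h => hrp (uniq r p hwr rfl h hpa)
        exact hra (hax q hq r hr (fun h => hrq h.symm) hwq hwr hqa)
      · have hqa : lam k p₀ p₁ q = 0 := hax p hp q hq hpq rfl hwq hpa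
        have hra : lam k p₀ p₁ r = 0 := hax p hp r hr (fun h => hrp h.symm) rfl hwr hpa
        exact hrq (uniq r q hwr hwq hra hqa)
    · by_contra hno
      push Not at hno
      exact hno.2 (hax p hp q hq hpq rfl hwq hno.1)

/-- **DEPENDENT CASE in the kernel** (`Ω = 0`, i.e. `w₁/w₀, w₂/w₀` algebraically dependent): then NO direction with
distinct-weight unique tops of `w₀, w₁` is an edge direction of `Q(w)` (`Q` homogeneous) — on an arc off the crossing
directions this says `EN(P(w)) ⊆ X`, `nv ≤ 9t²`. -/
theorem dependentCase3 (ν : Fin 2 → ℝ) (w : Fin 3 → Poly2) (p₀ p₁ : Fin 2 →₀ ℕ) (Q : Poly3) (k : ℕ)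
    (hΩ : omega w = 0) (h0 : IsUniqueTop ν (w 0) p₀) (h1 : IsUniqueTop ν (w 1) p₁) (h01 : wt ν p₀ ≠ wt ν p₁)
    (hQ : Q.IsHomogeneous k) : ¬ IsEdgeDir ν (aeval w Q) := by
  intro hedge
  have hL : ell k (w 0) (w 1) (aeval w Q) = 0 := by rw [← wronskianRule w Q k hQ, hΩ, zero_mul]
  obtain ⟨p, hp, q, hq, hpq, hpmax, hwq⟩ := hedge
  have onl : ∀ γ ∈ (aeval w Q).support, wt ν γ = wt ν p → lam k p₀ p₁ γ = 0 := by
    intro γ hγ hw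
    have htop : ∀ r ∈ (aeval w Q).support, wt ν r ≤ wt ν γ := fun r hr => hw ▸ hpmax r hr
    have hc := coeff_ell_top ν _ (w 0) (w 1) k p₀ p₁ γ h0 h1 hγ htop
    rw [hL, coeff_zero] at hc
    have h3 : ((lam k p₀ p₁ γ : ℤ) : ℂ) = 0 := by
      rcases mul_eq_zero.mp hc.symm with h | h
      · rcases mul_eq_zero.mp h with h | h
        · rcases mul_eq_zero.mp h with h | h
          · exact absurd h (MvPolynomial.mem_support_iff.mp hγ)
          · exact absurd h (MvPolynomial.mem_support_iff.mp h0.1)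
        · exact absurd h (MvPolynomial.mem_support_iff.mp h1.1)
      · exact h
    exact_mod_cast h3
  exact hpq (onLine_unique ν k p₀ p₁ p q h01 hwq.symm (onl p hp rfl) (onl q hq hwq))


/-! ## Kernel: the law decides the `TwoProducts` class «rows in a 3-dimensional linear span», sorry-free -/

theorem linForm_isHomogeneous (a : Fin 3 → ℂ) : (∑ i : Fin 3, C (a i) * X i : Poly3).IsHomogeneous 1 := by
  apply IsHomogeneous.sum
  intro i _
  exact (isHomogeneous_X ℂ i).C_mul (a i)

theorem prodLin_isHomogeneous (m : ℕ) (a : Fin m → Fin 3 → ℂ) :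
    (∏ j : Fin m, ∑ i : Fin 3, C (a j i) * X i : Poly3).IsHomogeneous m := by
  have h := IsHomogeneous.prod (Finset.univ : Finset (Fin m)) (fun j => (∑ i : Fin 3, C (a j i) * X i : Poly3))
    (fun _ => 1) (fun j _ => linForm_isHomogeneous (a j))
  simpa using h

theorem aeval_linForm (w : Fin 3 → Poly2) (a : Fin 3 → ℂ) :
    aeval w (∑ i : Fin 3, C (a i) * X i : Poly3) = ∑ i, a i • w i := by
  rw [map_sum]
  refine Finset.sum_congr rfl fun i _ => ?_
  rw [map_mul, aeval_C, aeval_X, MvPolynomial.algebraMap_eq, MvPolynomial.smul_eq_C_mul]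

/-- `RankThreeLinearLaw → TwoProductsLinRankThree`: with `P := ∏ⱼ(Σᵢ aⱼᵢ Xᵢ) − ∏ⱼ(Σᵢ bⱼᵢ Xᵢ)` (homogeneous of degree
`m`), `P(w) = ∏ f − ∏ g`. -/
theorem twoProductsLinRankThree_of_law (h : RankThreeLinearLaw) : TwoProductsLinRankThree := by
  obtain ⟨c, hc⟩ := h
  refine ⟨c, fun m t f g w hf hg hw => ?_⟩
  choose a ha using hf
  choose b hb using hg
  have hP : ((∏ j : Fin m, ∑ i : Fin 3, C (a j i) * X i) - ∏ j : Fin m, ∑ i : Fin 3, C (b j i) * X i : Poly3).IsHomogeneous m :=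
    (prodLin_isHomogeneous m a).sub (prodLin_isHomogeneous m b)
  have hev : aeval w ((∏ j : Fin m, ∑ i : Fin 3, C (a j i) * X i) - ∏ j : Fin m, ∑ i : Fin 3, C (b j i) * X i : Poly3)
      = ∏ j, f j - ∏ j, g j := by
    rw [map_sub, map_prod, map_prod]
    simp_rw [aeval_linForm, ← ha, ← hb]
  rw [← hev]
  exact hc m t _ w hP hw

/-- The arithmetic `t³ + 9t²(4m+1) ≤ (m+2)⁴(t+2)⁴`. -/
theorem explicit_le_pow (m t : ℕ) : t ^ 3 + 9 * t ^ 2 * (4 * m + 1) ≤ (m + 2) ^ 4 * (t + 2) ^ 4 := by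
  have h1 : 4 * m + 1 ≤ (m + 2) ^ 2 := by
    have e : (m + 2) ^ 2 = 4 * m + 1 + (m ^ 2 + 3) := by ring
    rw [e]; exact Nat.le_add_right _ _
  have h2 : t ^ 3 + 9 * t ^ 2 ≤ (t + 2) ^ 4 := by
    have e : (t + 2) ^ 4 = t ^ 3 + 9 * t ^ 2 + (t ^ 4 + 7 * t ^ 3 + 15 * t ^ 2 + 32 * t + 16) := by ring
    rw [e]; exact Nat.le_add_right _ _
  have h3 : (m + 2) ^ 2 ≤ (m + 2) ^ 4 := Nat.pow_le_pow_right (by omega) (by omega)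
  calc t ^ 3 + 9 * t ^ 2 * (4 * m + 1) ≤ t ^ 3 * (m + 2) ^ 2 + 9 * t ^ 2 * (m + 2) ^ 2 :=
        Nat.add_le_add (Nat.le_mul_of_pos_right _ (by positivity)) (Nat.mul_le_mul_left _ h1)
    _ = (m + 2) ^ 2 * (t ^ 3 + 9 * t ^ 2) := by ring
    _ ≤ (m + 2) ^ 4 * (t + 2) ^ 4 := Nat.mul_le_mul h3 h2

theorem rankThreeLinearLaw_of_explicit (h : RankThreeExplicitBound) : RankThreeLinearLaw :=
  ⟨4, fun m t P w hP hw => (h m t P w hP hw).trans (explicit_le_pow m t)⟩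

/-- STATUS of `PortPlan3`: conjuncts 2 and 3 are kernel theorems; conjunct 1 with its SHARP constant is paper, but its
purpose — `RankThreeLinearLaw`, hence `TwoProductsLinRankThree` — is reached directly in kernel by `section TowerKernel3`
below (`rankThreeLinearLaw`, `twoProductsLinRankThree`, crude `c = 22`). -/
theorem portPlan3_tail : (RankThreeExplicitBound → RankThreeLinearLaw) ∧ (RankThreeLinearLaw → TwoProductsLinRankThree) :=
  ⟨rankThreeLinearLaw_of_explicit, twoProductsLinRankThree_of_law⟩


/-! ## KERNEL PORT of `PortPlan3.1` (crude form): `RankThreeLinearLaw` and `TwoProductsLinRankThree` — section `TowerKernel3` -/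

section TowerKernel3
open scoped Classical

/-! ### (verbatim g9 `RankTwoJacobian_val_idea_35_g9.lean` @a021fde990ed, section `TowerKernel` + Ostrowski block: generic chart machinery, Stage A, Stage B, Eset bookkeeping — copied byte-for-byte so the later port dedups against the landed `Theorems/TwoProducts/RankTwoJacobian*` modules) -/

/-- LEMMA 4 (Ostrowski; memo §1): initial forms are multiplicative over a domain, so a product has an edge in direction
`ν` iff one of the factors does. -/
def Ostrowski : Prop :=
  ∀ (ν : Fin 2 → ℝ) (F G : Poly2), F ≠ 0 → G ≠ 0 → (IsEdgeDir ν (F * G) ↔ IsEdgeDir ν F ∨ IsEdgeDir ν G)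

theorem support_nonempty' {F : Poly2} (hF : F ≠ 0) : F.support.Nonempty :=
  Finset.nonempty_of_ne_empty (by rwa [Ne, MvPolynomial.support_eq_empty])


/-- The lex-MAX version of the unique-decomposition argument. -/
theorem decomp_max (ν : Fin 2 → ℝ) (F G : Poly2) (p q a₀ b₀ : Fin 2 →₀ ℕ)
    (hpmax : ∀ r ∈ F.support, wt ν r ≤ wt ν p) (hqmax : ∀ r ∈ G.support, wt ν r ≤ wt ν q)
    (ha₀ : wt ν a₀ = wt ν p) (hb₀ : wt ν b₀ = wt ν q)
    (hla : ∀ e ∈ F.support, wt ν e = wt ν p → toLex e ≤ toLex a₀)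
    (hlb : ∀ e ∈ G.support, wt ν e = wt ν q → toLex e ≤ toLex b₀) :
    ∀ a ∈ F.support, ∀ b ∈ G.support, a + b = a₀ + b₀ → a = a₀ ∧ b = b₀ := by
  intro a ha b hb hab
  have hw : wt ν a + wt ν b = wt ν p + wt ν q := by
    rw [← wt_add, hab, wt_add, ha₀, hb₀]
  have hwa : wt ν a = wt ν p := by linarith [hpmax a ha, hqmax b hb]
  have hwb : wt ν b = wt ν q := by linarith [hpmax a ha, hqmax b hb]
  have h1 := hla a ha hwa
  have h2 := hlb b hb hwb
  have hsum : toLex a + toLex b = toLex a₀ + toLex b₀ := by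
    show toLex (a + b) = toLex (a₀ + b₀); rw [hab]
  have haeq : a = a₀ := by
    rcases h1.lt_or_eq with hlt | heq
    · exact absurd hsum (ne_of_lt (add_lt_add_of_lt_of_le hlt h2))
    · exact toLex_inj.mp heq
  refine ⟨haeq, ?_⟩
  rw [haeq] at hab
  exact add_left_cancel hab

/-- The lex-MIN version. -/
theorem decomp_min (ν : Fin 2 → ℝ) (F G : Poly2) (p q a₀ b₀ : Fin 2 →₀ ℕ)
    (hpmax : ∀ r ∈ F.support, wt ν r ≤ wt ν p) (hqmax : ∀ r ∈ G.support, wt ν r ≤ wt ν q)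
    (ha₀ : wt ν a₀ = wt ν p) (hb₀ : wt ν b₀ = wt ν q)
    (hla : ∀ e ∈ F.support, wt ν e = wt ν p → toLex a₀ ≤ toLex e)
    (hlb : ∀ e ∈ G.support, wt ν e = wt ν q → toLex b₀ ≤ toLex e) :
    ∀ a ∈ F.support, ∀ b ∈ G.support, a + b = a₀ + b₀ → a = a₀ ∧ b = b₀ := by
  intro a ha b hb hab
  have hw : wt ν a + wt ν b = wt ν p + wt ν q := by
    rw [← wt_add, hab, wt_add, ha₀, hb₀]
  have hwa : wt ν a = wt ν p := by linarith [hpmax a ha, hqmax b hb]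
  have hwb : wt ν b = wt ν q := by linarith [hpmax a ha, hqmax b hb]
  have h1 := hla a ha hwa
  have h2 := hlb b hb hwb
  have hsum : toLex a₀ + toLex b₀ = toLex a + toLex b := by
    show toLex (a₀ + b₀) = toLex (a + b); rw [hab]
  have haeq : a = a₀ := by
    rcases h1.lt_or_eq with hlt | heq
    · exact absurd hsum (ne_of_lt (add_lt_add_of_lt_of_le hlt h2))
    · exact (toLex_inj.mp heq).symm
  refine ⟨haeq, ?_⟩
  rw [haeq] at hab
  exact add_left_cancel hab

/-- An edge of `F` survives multiplication by any `G ≠ 0` (half of Ostrowski). -/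
theorem isEdgeDir_mul_left (ν : Fin 2 → ℝ) (F G : Poly2) (hG : G ≠ 0) (hFe : IsEdgeDir ν F) :
    IsEdgeDir ν (F * G) := by
  obtain ⟨p, hp, p', hp', hpp', hpmax, hwp'⟩ := hFe
  obtain ⟨q, hq, hqmax⟩ := Finset.exists_max_image G.support (wt ν) (support_nonempty' hG)
  set TF := F.support.filter (fun e => wt ν e = wt ν p) with hTF
  set TG := G.support.filter (fun e => wt ν e = wt ν q) with hTG
  have hpTF : p ∈ TF := Finset.mem_filter.mpr ⟨hp, rfl⟩
  have hp'TF : p' ∈ TF := Finset.mem_filter.mpr ⟨hp', hwp'⟩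
  have hqTG : q ∈ TG := Finset.mem_filter.mpr ⟨hq, rfl⟩
  obtain ⟨aM, haM, haMmax⟩ := Finset.exists_max_image TF (fun e => toLex e) ⟨p, hpTF⟩
  obtain ⟨am, ham, hammin⟩ := Finset.exists_min_image TF (fun e => toLex e) ⟨p, hpTF⟩
  obtain ⟨bM, hbM, hbMmax⟩ := Finset.exists_max_image TG (fun e => toLex e) ⟨q, hqTG⟩
  obtain ⟨bm, hbm, hbmmin⟩ := Finset.exists_min_image TG (fun e => toLex e) ⟨q, hqTG⟩
  have haM' := Finset.mem_filter.mp haM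
  have ham' := Finset.mem_filter.mp ham
  have hbM' := Finset.mem_filter.mp hbM
  have hbm' := Finset.mem_filter.mp hbm
  -- aM ≠ am because TF has the two elements p ≠ p'
  have hlt_a : toLex am < toLex aM := by
    rcases (hammin p hpTF).lt_or_eq with h1 | h1
    · exact lt_of_lt_of_le h1 (haMmax p hpTF)
    · rcases (hammin p' hp'TF).lt_or_eq with h2 | h2
      · exact lt_of_lt_of_le h2 (haMmax p' hp'TF)
      · exact absurd (toLex_inj.mp (h1.symm.trans h2)) hpp'
  have hle_b : toLex bm ≤ toLex bM := (hbmmin q hqTG).trans (hbMmax q hqTG)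
  -- unique decompositions
  have hdecM := decomp_max ν F G p q aM bM hpmax hqmax haM'.2 hbM'.2
    (fun e he hwe => haMmax e (Finset.mem_filter.mpr ⟨he, hwe⟩))
    (fun e he hwe => hbMmax e (Finset.mem_filter.mpr ⟨he, hwe⟩))
  have hdecm := decomp_min ν F G p q am bm hpmax hqmax ham'.2 hbm'.2
    (fun e he hwe => hammin e (Finset.mem_filter.mpr ⟨he, hwe⟩))
    (fun e he hwe => hbmmin e (Finset.mem_filter.mpr ⟨he, hwe⟩))
  have hsM : aM + bM ∈ (F * G).support := by
    rw [MvPolynomial.mem_support_iff, coeff_mul_of_unique F G aM bM hdecM]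
    exact mul_ne_zero (MvPolynomial.mem_support_iff.mp haM'.1) (MvPolynomial.mem_support_iff.mp hbM'.1)
  have hsm : am + bm ∈ (F * G).support := by
    rw [MvPolynomial.mem_support_iff, coeff_mul_of_unique F G am bm hdecm]
    exact mul_ne_zero (MvPolynomial.mem_support_iff.mp ham'.1) (MvPolynomial.mem_support_iff.mp hbm'.1)
  have hne : aM + bM ≠ am + bm := by
    intro h
    have h' : toLex aM + toLex bM = toLex am + toLex bm := by
      show toLex (aM + bM) = toLex (am + bm); rw [h]
    exact absurd h'.symm (ne_of_lt (add_lt_add_of_lt_of_le hlt_a hle_b))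
  refine ⟨aM + bM, hsM, am + bm, hsm, hne, ?_, ?_⟩
  · intro r hr
    obtain ⟨a, ha, b, hb, rfl⟩ := Finset.mem_add.mp (MvPolynomial.support_mul F G hr)
    rw [wt_add, wt_add, haM'.2, hbM'.2]
    linarith [hpmax a ha, hqmax b hb]
  · rw [wt_add, wt_add, haM'.2, hbM'.2, ham'.2, hbm'.2]

/-- **LEMMA 4 in the kernel** (Ostrowski): over the domain `ℂ`, `ν` is an edge direction of `F·G` iff it is one
of `F` or of `G`. -/
theorem ostrowski : Ostrowski := by
  intro ν F G hF hG
  constructor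
  · intro hFG
    by_contra hnot
    push Not at hnot
    obtain ⟨hnF, hnG⟩ := hnot
    obtain ⟨p, hp, hpmax⟩ := Finset.exists_max_image F.support (wt ν) (support_nonempty' hF)
    obtain ⟨q, hq, hqmax⟩ := Finset.exists_max_image G.support (wt ν) (support_nonempty' hG)
    have huF : ∀ a ∈ F.support, wt ν a = wt ν p → a = p := by
      intro a ha hwa
      by_contra hne
      exact hnF ⟨p, hp, a, ha, fun h => hne h.symm, hpmax, hwa⟩
    have huG : ∀ b ∈ G.support, wt ν b = wt ν q → b = q := by
      intro b hb hwb
      by_contra hne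
      exact hnG ⟨q, hq, b, hb, fun h => hne h.symm, hqmax, hwb⟩
    have hdec : ∀ a ∈ F.support, ∀ b ∈ G.support, wt ν (a + b) = wt ν (p + q) → a = p ∧ b = q := by
      intro a ha b hb hw
      rw [wt_add, wt_add] at hw
      have hwa : wt ν a = wt ν p := by linarith [hpmax a ha, hqmax b hb]
      have hwb : wt ν b = wt ν q := by linarith [hpmax a ha, hqmax b hb]
      exact ⟨huF a ha hwa, huG b hb hwb⟩
    have hpq : p + q ∈ (F * G).support := by
      rw [MvPolynomial.mem_support_iff, coeff_mul_of_unique F G p q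
        (fun a ha b hb he => hdec a ha b hb (by rw [he]))]
      exact mul_ne_zero (MvPolynomial.mem_support_iff.mp hp) (MvPolynomial.mem_support_iff.mp hq)
    obtain ⟨r, hr, r', hr', hne, hrmax, hwr'⟩ := hFG
    have key : ∀ s ∈ (F * G).support, wt ν s = wt ν r → s = p + q := by
      intro s hs hws
      obtain ⟨a, ha, b, hb, rfl⟩ := Finset.mem_add.mp (MvPolynomial.support_mul F G hs)
      have hle : wt ν (p + q) ≤ wt ν r := hrmax _ hpq
      have hge : wt ν (a + b) ≤ wt ν (p + q) := by
        rw [wt_add, wt_add]; linarith [hpmax a ha, hqmax b hb]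
      have hab := hdec a ha b hb (by linarith)
      rw [hab.1, hab.2]
    exact hne ((key r hr rfl).trans (key r' hr' hwr').symm)
  · rintro (hFe | hGe)
    · exact isEdgeDir_mul_left ν F G hG hFe
    · rw [mul_comm]; exact isEdgeDir_mul_left ν G F hF hGe



abbrev Expo := Fin 2 →₀ ℕ

/-- chart direction `(l, σ)`, `σ = ±1` -/
def dir (σ l : ℝ) : Fin 2 → ℝ := ![l, σ]

theorem wt_dir (σ l : ℝ) (q : Expo) :
    wt (dir σ l) q = l * ((q 0 : ℕ) : ℝ) + σ * ((q 1 : ℕ) : ℝ) := by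
  simp [wt, dir]

/-- a tie (≥ 2 top points) of the finite exponent set `S` in direction `ν`;
`IsEdgeDir ν F` is literally `TieIn ν F.support`. -/
def TieIn (ν : Fin 2 → ℝ) (S : Finset Expo) : Prop :=
  ∃ p ∈ S, ∃ q ∈ S, p ≠ q ∧ (∀ r ∈ S, wt ν r ≤ wt ν p) ∧ wt ν q = wt ν p

/-- `p` is the unique top point of `S` in direction `ν` -/
def IsUTop (ν : Fin 2 → ℝ) (S : Finset Expo) (p : Expo) : Prop :=
  p ∈ S ∧ ∀ r ∈ S, r ≠ p → wt ν r < wt ν p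

theorem utop_unique {ν : Fin 2 → ℝ} {S : Finset Expo} {p p' : Expo} (hp : IsUTop ν S p)
    (hp' : IsUTop ν S p') : p = p' := by
  by_contra h
  have h1 := hp.2 p' hp'.1 (Ne.symm h)
  have h2 := hp'.2 p hp.1 h
  linarith

theorem not_tie_of_utop {ν : Fin 2 → ℝ} {S : Finset Expo} {p : Expo} (hp : IsUTop ν S p) :
    ¬ TieIn ν S := by
  rintro ⟨a, ha, b, hb, hab, hamax, hba⟩
  -- a and b are both tops; p is the unique top, so a = p and b = p
  have ha' : a = p := by
    by_contra h; have := hp.2 a ha h; have := hamax p hp.1; linarith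
  have hb' : b = p := by
    by_contra h; have := hp.2 b hb h; have := hamax p hp.1; linarith
  exact hab (ha'.trans hb'.symm)

theorem expo_eq_of_coords {a b : Expo} (h0 : a 0 = b 0) (h1 : a 1 = b 1) : a = b := by
  ext i; fin_cases i <;> assumption

theorem sigma_ne_zero {σ : ℝ} (hσ : σ = 1 ∨ σ = -1) : σ ≠ 0 := by
  rcases hσ with h | h <;> simp [h]

/-- in a chart, equal weights and equal first coordinates force equality -/
theorem eq_of_wt_eq {σ : ℝ} (hσ : σ = 1 ∨ σ = -1) {l : ℝ} {a b : Expo} (h0 : a 0 = b 0)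
    (hw : wt (dir σ l) a = wt (dir σ l) b) : a = b := by
  apply expo_eq_of_coords h0
  rw [wt_dir, wt_dir, h0] at hw
  have h2 : σ * ((a 1 : ℕ) : ℝ) = σ * ((b 1 : ℕ) : ℝ) := by linarith
  have := mul_left_cancel₀ (sigma_ne_zero hσ) h2
  exact_mod_cast this

/-- the crossing value of the pair `(a,b)` (with `a 0 ≠ b 0`) in chart `σ` -/
def cross (σ : ℝ) (a b : Expo) : ℝ :=
  σ * (((b 1 : ℕ) : ℝ) - ((a 1 : ℕ) : ℝ)) / (((a 0 : ℕ) : ℝ) - ((b 0 : ℕ) : ℝ))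

theorem wt_sub_eq (σ l : ℝ) (a b : Expo) :
    wt (dir σ l) a - wt (dir σ l) b =
      l * (((a 0 : ℕ) : ℝ) - ((b 0 : ℕ) : ℝ)) + σ * (((a 1 : ℕ) : ℝ) - ((b 1 : ℕ) : ℝ)) := by
  rw [wt_dir, wt_dir]; ring

theorem sub_ne_zero_of_ne0 {a b : Expo} (h0 : a 0 ≠ b 0) :
    (((a 0 : ℕ) : ℝ) - ((b 0 : ℕ) : ℝ)) ≠ 0 := by
  intro h; apply h0; exact_mod_cast (sub_eq_zero.mp h)

theorem wt_eq_imp_cross {σ l : ℝ} {a b : Expo} (h0 : a 0 ≠ b 0)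
    (hw : wt (dir σ l) a = wt (dir σ l) b) : l = cross σ a b := by
  have hd := sub_ne_zero_of_ne0 h0
  unfold cross
  rw [eq_div_iff hd]
  have := wt_sub_eq σ l a b
  rw [hw, sub_self] at this
  linarith

/-- `g(x) := wt_x a − wt_x b = (x − cross) · (a0 − b0)` -/
theorem wt_sub_eq_cross {σ : ℝ} (x : ℝ) {a b : Expo} (h0 : a 0 ≠ b 0) :
    wt (dir σ x) a - wt (dir σ x) b = (x - cross σ a b) * (((a 0 : ℕ) : ℝ) - ((b 0 : ℕ) : ℝ)) := by
  have hd := sub_ne_zero_of_ne0 h0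
  rw [wt_sub_eq]; unfold cross
  field_simp
  ring

/-! ### Stage A: the upper envelope of lines — between two distinct unique tops lies a tie -/

theorem exists_tie_between {σ : ℝ} (_hσ : σ = 1 ∨ σ = -1) (S : Finset Expo) {p p' : Expo} {l l' : ℝ}
    (hll : l < l') (hp : IsUTop (dir σ l) S p) (hp' : IsUTop (dir σ l') S p') (hne : p ≠ p') :
    ∃ μ, l < μ ∧ μ < l' ∧ TieIn (dir σ μ) S := by
  have gp'l : 0 < wt (dir σ l) p - wt (dir σ l) p' := sub_pos.mpr (hp.2 p' hp'.1 (Ne.symm hne))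
  have gp'l' : wt (dir σ l') p - wt (dir σ l') p' < 0 := sub_neg.mpr (hp'.2 p hp.1 hne)
  -- slope of g_{p'} is (p0 − p'0),必 negative
  have hslope : p 0 < p' 0 := by
    by_contra h; push Not at h
    have h' : ((p' 0 : ℕ) : ℝ) ≤ ((p 0 : ℕ) : ℝ) := by exact_mod_cast h
    rw [wt_sub_eq] at gp'l gp'l'
    nlinarith
  set Q := S.filter (fun q => p 0 < q 0) with hQ
  have hp'Q : p' ∈ Q := Finset.mem_filter.mpr ⟨hp'.1, hslope⟩
  set C := Q.image (cross σ p) with hC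
  have hCne : C.Nonempty := ⟨_, Finset.mem_image_of_mem _ hp'Q⟩
  -- key facts for q with q0 > p0
  have key : ∀ q ∈ Q, l < cross σ p q ∧
      ∀ x, x ≤ cross σ p q → 0 ≤ wt (dir σ x) p - wt (dir σ x) q := by
    intro q hq
    obtain ⟨hqS, hq0⟩ := Finset.mem_filter.mp hq
    have hne0 : p 0 ≠ q 0 := Nat.ne_of_lt hq0
    have hA : (((p 0 : ℕ) : ℝ) - ((q 0 : ℕ) : ℝ)) < 0 := by
      have : ((p 0 : ℕ) : ℝ) < ((q 0 : ℕ) : ℝ) := by exact_mod_cast hq0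
      linarith
    have hqp : q ≠ p := by rintro rfl; exact lt_irrefl _ hq0
    have gl : 0 < wt (dir σ l) p - wt (dir σ l) q := sub_pos.mpr (hp.2 q hqS hqp)
    rw [wt_sub_eq_cross l hne0] at gl
    refine ⟨?_, ?_⟩
    · by_contra h; push Not at h
      have : (l - cross σ p q) * (((p 0 : ℕ) : ℝ) - ((q 0 : ℕ) : ℝ)) ≤ 0 :=
        mul_nonpos_of_nonneg_of_nonpos (sub_nonneg.mpr h) hA.le
      linarith
    · intro x hx
      rw [wt_sub_eq_cross x hne0]
      exact mul_nonneg_of_nonpos_of_nonpos (sub_nonpos.mpr hx) hA.le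
  set μ := C.min' hCne with hμ
  obtain ⟨qs, hqsQ, hqs⟩ := Finset.mem_image.mp (C.min'_mem hCne)
  have hqsμ : cross σ p qs = μ := by rw [hqs, hμ]
  have hqsS : qs ∈ S := (Finset.mem_filter.mp hqsQ).1
  have hqs0 : p 0 < qs 0 := (Finset.mem_filter.mp hqsQ).2
  refine ⟨μ, ?_, ?_, ?_⟩
  · rw [← hqsμ]; exact (key qs hqsQ).1
  · -- μ ≤ cross p p' < l'
    have h1 : μ ≤ cross σ p p' := C.min'_le _ (Finset.mem_image_of_mem _ hp'Q)
    have hne0 : p 0 ≠ p' 0 := Nat.ne_of_lt hslope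
    have h2 : cross σ p p' < l' := by
      rw [wt_sub_eq_cross l' hne0] at gp'l'
      by_contra h; push Not at h
      have hA : (((p 0 : ℕ) : ℝ) - ((p' 0 : ℕ) : ℝ)) < 0 := by
        have : ((p 0 : ℕ) : ℝ) < ((p' 0 : ℕ) : ℝ) := by exact_mod_cast hslope
        linarith
      have : 0 ≤ (l' - cross σ p p') * (((p 0 : ℕ) : ℝ) - ((p' 0 : ℕ) : ℝ)) :=
        mul_nonneg_of_nonpos_of_nonpos (sub_nonpos.mpr h) hA.le
      linarith
    linarith
  · refine ⟨p, hp.1, qs, hqsS, ?_, ?_, ?_⟩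
    · rintro rfl; exact lt_irrefl _ hqs0
    · intro r hr
      by_cases hr0 : p 0 < r 0
      · have hrQ : r ∈ Q := Finset.mem_filter.mpr ⟨hr, hr0⟩
        have hle : μ ≤ cross σ p r := C.min'_le _ (Finset.mem_image_of_mem _ hrQ)
        have := (key r hrQ).2 μ hle
        linarith
      · push Not at hr0
        by_cases hrp : r = p
        · rw [hrp]
        · have gl : 0 < wt (dir σ l) p - wt (dir σ l) r := sub_pos.mpr (hp.2 r hr hrp)
          have hμl : l < μ := by rw [← hqsμ]; exact (key qs hqsQ).1
          have hA : 0 ≤ (((p 0 : ℕ) : ℝ) - ((r 0 : ℕ) : ℝ)) := by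
            have : ((r 0 : ℕ) : ℝ) ≤ ((p 0 : ℕ) : ℝ) := by exact_mod_cast hr0
            linarith
          have e1 := wt_sub_eq σ l p r
          have e2 := wt_sub_eq σ μ p r
          nlinarith
    · have hne0 : p 0 ≠ qs 0 := Nat.ne_of_lt hqs0
      have := wt_sub_eq_cross (σ := σ) μ hne0
      rw [hqsμ, sub_self, zero_mul] at this
      linarith

/-- counting unique tops in a chart: at most `#ties + 1` -/
theorem card_utop_le {σ : ℝ} (hσ : σ = 1 ∨ σ = -1) (S : Finset Expo) (E : Finset ℝ)
    (hE : ∀ μ, TieIn (dir σ μ) S → μ ∈ E) (T : Finset Expo)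
    (hT : ∀ p ∈ T, ∃ l, IsUTop (dir σ l) S p) : T.card ≤ E.card + 1 := by
  choose! lam hlam using hT
  let g : Expo → WithTop ℝ := fun p => (E.filter (fun μ => lam p < μ)).min
  have hg_mem : ∀ p ∈ T, g p ∈ insert ⊤ (E.image (fun μ : ℝ => (μ : WithTop ℝ))) := by
    intro p _
    rcases h : g p with _ | a
    · exact Finset.mem_insert_self _ _
    · apply Finset.mem_insert_of_mem
      have ha : a ∈ E.filter (fun μ => lam p < μ) := Finset.mem_of_min h
      exact Finset.mem_image_of_mem _ (Finset.mem_filter.mp ha).1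
  have hg_gt : ∀ p, ((lam p : ℝ) : WithTop ℝ) < g p := by
    intro p
    rcases h : g p with _ | a
    · exact WithTop.coe_lt_top _
    · have ha : a ∈ E.filter (fun μ => lam p < μ) := Finset.mem_of_min h
      exact WithTop.coe_lt_coe.mpr (Finset.mem_filter.mp ha).2
  have hlt : ∀ p ∈ T, ∀ p' ∈ T, p ≠ p' → lam p < lam p' → g p < g p' := by
    intro p hp p' hp' hne h
    obtain ⟨μ, h1, h2, htie⟩ := exists_tie_between hσ S h (hlam p hp) (hlam p' hp') hne
    have hgp : g p ≤ (μ : WithTop ℝ) := Finset.min_le (Finset.mem_filter.mpr ⟨hE μ htie, h1⟩)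
    have : (μ : WithTop ℝ) < g p' :=
      lt_trans (WithTop.coe_lt_coe.mpr h2) (hg_gt p')
    exact lt_of_le_of_lt hgp this
  have hinj : Set.InjOn g T := by
    intro p hp p' hp' hgg
    by_contra hne
    rcases lt_trichotomy (lam p) (lam p') with h | h | h
    · exact absurd hgg (ne_of_lt (hlt p hp p' hp' hne h))
    · have e1 := hlam p hp
      rw [h] at e1
      exact hne (utop_unique e1 (hlam p' hp'))
    · exact absurd hgg.symm (ne_of_lt (hlt p' hp' p hp (Ne.symm hne) h))
  calc T.card ≤ (insert ⊤ (E.image (fun μ : ℝ => (μ : WithTop ℝ)))).card :=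
        Finset.card_le_card_of_injOn g (fun p hp => hg_mem p hp) hinj
    _ ≤ (E.image (fun μ : ℝ => (μ : WithTop ℝ))).card + 1 := Finset.card_insert_le _ _
    _ ≤ E.card + 1 := by
        have := Finset.card_image_le (s := E) (f := fun μ : ℝ => (μ : WithTop ℝ)); omega

theorem isEdgeDir_iff_tie (ν : Fin 2 → ℝ) (F : Poly2) : IsEdgeDir ν F ↔ TieIn ν F.support := Iff.rfl

def EV (σ : ℝ) (F : Poly2) : Finset ℝ :=
  ((F.support ×ˢ F.support).filter (fun x => x.1 0 ≠ x.2 0)).image (fun x => cross σ x.1 x.2)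

theorem mem_EV_of_tie {σ : ℝ} (hσ : σ = 1 ∨ σ = -1) {F : Poly2} {μ : ℝ} (h : TieIn (dir σ μ) F.support) :
    μ ∈ EV σ F := by
  obtain ⟨p, hp, q, hq, hpq, -, hqp⟩ := h
  have h0 : q 0 ≠ p 0 := fun h0 => hpq (eq_of_wt_eq hσ h0 hqp).symm
  have hμ : μ = cross σ q p := wt_eq_imp_cross h0 hqp
  unfold EV; rw [Finset.mem_image]
  exact ⟨(q, p), Finset.mem_filter.mpr ⟨Finset.mem_product.mpr ⟨hq, hp⟩, h0⟩, hμ.symm⟩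

theorem card_EV_le (σ : ℝ) (F : Poly2) : (EV σ F).card ≤ F.support.card * F.support.card := by
  unfold EV
  refine Finset.card_image_le.trans ((Finset.card_filter_le _ _).trans ?_)
  rw [Finset.card_product]

def Eset (σ : ℝ) (F : Poly2) : Finset ℝ := (EV σ F).filter (fun μ => TieIn (dir σ μ) F.support)

theorem mem_Eset {σ : ℝ} (hσ : σ = 1 ∨ σ = -1) {F : Poly2} {μ : ℝ} :
    μ ∈ Eset σ F ↔ IsEdgeDir (dir σ μ) F := by
  unfold Eset; rw [Finset.mem_filter, isEdgeDir_iff_tie]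
  exact ⟨fun h => h.2, fun h => ⟨mem_EV_of_tie hσ h, h⟩⟩

theorem card_Eset_le (σ : ℝ) (F : Poly2) : (Eset σ F).card ≤ F.support.card * F.support.card :=
  (Finset.card_filter_le _ _).trans (card_EV_le σ F)

theorem Eset_zero (σ : ℝ) : Eset σ (0 : Poly2) = ∅ := by
  unfold Eset EV; simp


/-- C4: a point that is a top at two chart values is the UNIQUE top strictly in between -/
theorem utop_between {σ : ℝ} (hσ : σ = 1 ∨ σ = -1) {F : Poly2} {x m y : ℝ} (hxm : x < m) (hmy : m < y)
    {a : Expo} (haS : a ∈ F.support) (hx : ∀ r ∈ F.support, wt (dir σ x) r ≤ wt (dir σ x) a)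
    (hy : ∀ r ∈ F.support, wt (dir σ y) r ≤ wt (dir σ y) a) : IsUTop (dir σ m) F.support a := by
  refine ⟨haS, fun r hr hra => ?_⟩
  have e1 := wt_sub_eq σ x r a
  have e2 := wt_sub_eq σ m r a
  have e3 := wt_sub_eq σ y r a
  have g1 : wt (dir σ x) r - wt (dir σ x) a ≤ 0 := sub_nonpos.mpr (hx r hr)
  have g3 : wt (dir σ y) r - wt (dir σ y) a ≤ 0 := sub_nonpos.mpr (hy r hr)
  set A := ((r 0 : ℕ) : ℝ) - ((a 0 : ℕ) : ℝ) with hA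
  set B := σ * (((r 1 : ℕ) : ℝ) - ((a 1 : ℕ) : ℝ)) with hB
  by_contra hge; push Not at hge
  have g2 : 0 ≤ wt (dir σ m) r - wt (dir σ m) a := sub_nonneg.mpr hge
  -- x A + B ≤ 0, y A + B ≤ 0, m A + B ≥ 0 with x < m < y ⇒ A = 0 and B = 0
  have hA0 : A = 0 := by
    rcases lt_trichotomy A 0 with h | h | h
    · nlinarith
    · exact h
    · nlinarith
  have hB0 : B = 0 := by rw [e2, hA0] at g2; rw [e1, hA0] at g1; linarith
  have h0 : r 0 = a 0 := by
    have : ((r 0 : ℕ) : ℝ) = ((a 0 : ℕ) : ℝ) := by linarith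
    exact_mod_cast this
  have h1 : r 1 = a 1 := by
    have : σ * (((r 1 : ℕ) : ℝ) - ((a 1 : ℕ) : ℝ)) = 0 := hB0
    rcases mul_eq_zero.mp this with h | h
    · exact absurd h (sigma_ne_zero hσ)
    · have : ((r 1 : ℕ) : ℝ) = ((a 1 : ℕ) : ℝ) := by linarith
      exact_mod_cast this
  exact hra (expo_eq_of_coords h0 h1)


theorem ne_zero_of_isEdgeDir {ν : Fin 2 → ℝ} {F : Poly2} (h : IsEdgeDir ν F) : F ≠ 0 := by
  rintro rfl
  obtain ⟨p, hp, -⟩ := h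
  simp at hp

/-! ### Stage B: vertices are chart-unique tops (or the two horizontal extremes) -/

theorem emb_injective : Function.Injective emb := by
  intro a b h
  ext i
  have := congrFun h i
  simp only [emb] at this
  exact_mod_cast this

def Tset (σ : ℝ) (F : Poly2) : Finset Expo := F.support.filter (fun p => ∃ l, IsUTop (dir σ l) F.support p)
def Hmax (F : Poly2) : Finset Expo := F.support.filter (fun p => ∀ q ∈ F.support, q ≠ p → q 0 < p 0)
def Hmin (F : Poly2) : Finset Expo := F.support.filter (fun p => ∀ q ∈ F.support, q ≠ p → p 0 < q 0)

theorem card_Hmax_le_one (F : Poly2) : (Hmax F).card ≤ 1 := by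
  rw [Finset.card_le_one]
  intro a ha b hb
  obtain ⟨haS, ha'⟩ := Finset.mem_filter.mp ha
  obtain ⟨hbS, hb'⟩ := Finset.mem_filter.mp hb
  by_contra h
  have h1 := ha' b hbS (Ne.symm h)
  have h2 := hb' a haS h
  omega

theorem card_Hmin_le_one (F : Poly2) : (Hmin F).card ≤ 1 := by
  rw [Finset.card_le_one]
  intro a ha b hb
  obtain ⟨haS, ha'⟩ := Finset.mem_filter.mp ha
  obtain ⟨hbS, hb'⟩ := Finset.mem_filter.mp hb
  by_contra h
  have h1 := ha' b hbS (Ne.symm h)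
  have h2 := hb' a haS h
  omega

theorem card_Tset_le {σ : ℝ} (hσ : σ = 1 ∨ σ = -1) (F : Poly2) : (Tset σ F).card ≤ (Eset σ F).card + 1 :=
  card_utop_le hσ F.support (Eset σ F) (fun _ h => (mem_Eset hσ).mpr h) (Tset σ F)
    (fun _ hp => (Finset.mem_filter.mp hp).2)

theorem f_emb (f : (Fin 2 → ℝ) →L[ℝ] ℝ) (q : Expo) :
    f (emb q) = wt ![f (Pi.single 0 1), f (Pi.single 1 1)] q := by
  have : emb q = ((q 0 : ℕ) : ℝ) • (Pi.single 0 1 : Fin 2 → ℝ) + ((q 1 : ℕ) : ℝ) • (Pi.single 1 1 : Fin 2 → ℝ) := by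
    ext i; fin_cases i <;> simp [emb]
  rw [this, map_add, map_smul, map_smul]
  simp [wt]
  ring

theorem extreme_subset (F : Poly2) :
    Set.extremePoints ℝ (convexHull ℝ (emb '' (F.support : Set Expo))) ⊆
      emb '' ((Tset 1 F ∪ Tset (-1) F ∪ Hmax F ∪ Hmin F : Finset Expo) : Set Expo) := by
  intro v hv
  set S : Set (Fin 2 → ℝ) := emb '' (F.support : Set Expo) with hS
  have hSfin : S.Finite := (F.support.finite_toSet).image emb
  have hvS : v ∈ S := extremePoints_convexHull_subset hv
  obtain ⟨p, hpS, rfl⟩ := hvS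
  have hpS' : p ∈ F.support := hpS
  -- v ∉ convexHull (S \ {v})
  have hnot : emb p ∉ convexHull ℝ (S \ {emb p}) := by
    have h := ((convex_convexHull ℝ S).mem_extremePoints_iff_mem_sdiff_convexHull_sdiff).mp hv
    intro hin
    apply h.2
    refine convexHull_mono ?_ hin
    exact Set.sdiff_subset_sdiff_left (subset_convexHull ℝ S)
  obtain ⟨f, u, hfu, huv⟩ := geometric_hahn_banach_closed_point (convex_convexHull ℝ _)
    ((hSfin.subset Set.sdiff_subset).isClosed_convexHull ℝ) hnot
  set ν : Fin 2 → ℝ := ![f (Pi.single 0 1), f (Pi.single 1 1)] with hν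
  have hstrict : ∀ q ∈ F.support, q ≠ p → wt ν q < wt ν p := by
    intro q hq hqp
    have hq' : emb q ∈ convexHull ℝ (S \ {emb p}) := by
      apply subset_convexHull
      refine ⟨⟨q, hq, rfl⟩, ?_⟩
      intro h; exact hqp (emb_injective h)
    have := hfu _ hq'
    rw [← f_emb, ← f_emb]; linarith
  -- chart reduction
  rw [Finset.coe_union, Finset.coe_union, Finset.coe_union, Set.image_union, Set.image_union, Set.image_union]
  rcases lt_trichotomy (ν 1) 0 with h1 | h1 | h1
  · -- σ = -1, l = ν0 / (-ν1)
    apply Or.inl; apply Or.inl; apply Or.inr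
    refine ⟨p, ?_, rfl⟩
    refine Finset.mem_filter.mpr ⟨hpS', ν 0 / (-ν 1), hpS', fun r hr hrp => ?_⟩
    have := hstrict r hr hrp
    unfold wt at this
    rw [wt_dir, wt_dir]
    have hn : 0 < -ν 1 := by linarith
    have hν1 : ν 1 ≠ 0 := ne_of_lt h1
    rw [← sub_pos]
    have : 0 < (ν 0 * ((p 0 : ℕ) : ℝ) + ν 1 * ((p 1 : ℕ) : ℝ)) - (ν 0 * ((r 0 : ℕ) : ℝ) + ν 1 * ((r 1 : ℕ) : ℝ)) := by linarith
    have key : (ν 0 / -ν 1 * ((p 0 : ℕ) : ℝ) + -1 * ((p 1 : ℕ) : ℝ)) - (ν 0 / -ν 1 * ((r 0 : ℕ) : ℝ) + -1 * ((r 1 : ℕ) : ℝ))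
        = ((ν 0 * ((p 0 : ℕ) : ℝ) + ν 1 * ((p 1 : ℕ) : ℝ)) - (ν 0 * ((r 0 : ℕ) : ℝ) + ν 1 * ((r 1 : ℕ) : ℝ))) / (-ν 1) := by
      field_simp; ring
    rw [key]; exact div_pos this hn
  · -- ν 1 = 0: horizontal
    by_cases h0 : 0 ≤ ν 0
    · apply Or.inl; apply Or.inr
      refine ⟨p, Finset.mem_filter.mpr ⟨hpS', fun q hq hqp => ?_⟩, rfl⟩
      have := hstrict q hq hqp
      unfold wt at this; rw [h1] at this
      simp only [zero_mul, add_zero] at this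
      rcases h0.lt_or_eq with h0 | h0
      · have : ((q 0 : ℕ) : ℝ) < ((p 0 : ℕ) : ℝ) := lt_of_mul_lt_mul_left this h0.le
        exact_mod_cast this
      · exfalso; rw [← h0] at this; simp at this
    · apply Or.inr
      push Not at h0
      refine ⟨p, Finset.mem_filter.mpr ⟨hpS', fun q hq hqp => ?_⟩, rfl⟩
      have := hstrict q hq hqp
      unfold wt at this; rw [h1] at this
      simp only [zero_mul, add_zero] at this
      have : ((p 0 : ℕ) : ℝ) < ((q 0 : ℕ) : ℝ) := by nlinarith
      exact_mod_cast this
  · -- σ = 1, l = ν0 / ν1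
    apply Or.inl; apply Or.inl; apply Or.inl
    refine ⟨p, ?_, rfl⟩
    refine Finset.mem_filter.mpr ⟨hpS', ν 0 / ν 1, hpS', fun r hr hrp => ?_⟩
    have := hstrict r hr hrp
    unfold wt at this
    rw [wt_dir, wt_dir, ← sub_pos]
    have hν1 : ν 1 ≠ 0 := ne_of_gt h1
    have : 0 < (ν 0 * ((p 0 : ℕ) : ℝ) + ν 1 * ((p 1 : ℕ) : ℝ)) - (ν 0 * ((r 0 : ℕ) : ℝ) + ν 1 * ((r 1 : ℕ) : ℝ)) := by linarith
    have key : (ν 0 / ν 1 * ((p 0 : ℕ) : ℝ) + 1 * ((p 1 : ℕ) : ℝ)) - (ν 0 / ν 1 * ((r 0 : ℕ) : ℝ) + 1 * ((r 1 : ℕ) : ℝ))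
        = ((ν 0 * ((p 0 : ℕ) : ℝ) + ν 1 * ((p 1 : ℕ) : ℝ)) - (ν 0 * ((r 0 : ℕ) : ℝ) + ν 1 * ((r 1 : ℕ) : ℝ))) / ν 1 := by
      field_simp
    rw [key]; exact div_pos this h1

theorem nv_le (F : Poly2) : nv F ≤ (Eset 1 F).card + (Eset (-1) F).card + 4 := by
  have hsub := extreme_subset F
  have hfin : (emb '' ((Tset 1 F ∪ Tset (-1) F ∪ Hmax F ∪ Hmin F : Finset Expo) : Set Expo)).Finite :=
    (Finset.finite_toSet _).image emb
  unfold nv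
  refine (Set.ncard_le_ncard hsub hfin).trans ?_
  refine (Set.ncard_image_le (Finset.finite_toSet _)).trans ?_
  rw [Set.ncard_coe_finset]
  have h1 := card_Tset_le (σ := 1) (Or.inl rfl) F
  have h2 := card_Tset_le (σ := -1) (Or.inr rfl) F
  have h3 := card_Hmax_le_one F
  have h4 := card_Hmin_le_one F
  calc (Tset 1 F ∪ Tset (-1) F ∪ Hmax F ∪ Hmin F).card
      ≤ (Tset 1 F).card + (Tset (-1) F).card + (Hmax F).card + (Hmin F).card := by
        refine (Finset.card_union_le _ _).trans (Nat.add_le_add_right ?_ _)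
        refine (Finset.card_union_le _ _).trans (Nat.add_le_add_right ?_ _)
        exact Finset.card_union_le _ _
    _ ≤ (Eset 1 F).card + (Eset (-1) F).card + 4 := by omega


theorem nv_C_le (a : ℂ) : nv (C a : Poly2) ≤ 1 := by
  unfold nv
  have hsub : ((C a : Poly2).support : Set Expo) ⊆ {0} := by
    intro s hs
    have hs' : s ∈ (C a : Poly2).support := hs
    rw [MvPolynomial.mem_support_iff, coeff_C] at hs'
    by_contra hne
    exact hs' (if_neg (fun h => hne h.symm))
  have h2 : emb '' ((C a : Poly2).support : Set Expo) ⊆ {emb 0} := by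
    rintro _ ⟨s, hs, rfl⟩; exact congrArg emb (hsub hs)
  have h3 : Set.extremePoints ℝ (convexHull ℝ (emb '' ((C a : Poly2).support : Set Expo))) ⊆ {emb 0} :=
    extremePoints_convexHull_subset.trans h2
  exact (Set.ncard_le_ncard h3 (Set.finite_singleton _)).trans (by rw [Set.ncard_singleton])


/-! ### Rank 3 — R1: the carrier set `S3`, the exceptional chart values `X3` (ALL pair crossings), arcs
Off `X3 σ w` the chart weight is injective on `S3 w`, so every nonzero `G` with `supp G ⊆ S3 w` has a unique top,
and that top is constant along an arc (a maximal run of chart values with the same number of exceptional values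
below it). -/

/-- the union of the three generator supports -/
def S3 (w : Fin 3 → Poly2) : Finset Expo := (w 0).support ∪ (w 1).support ∪ (w 2).support

theorem mem_S3 {w : Fin 3 → Poly2} {a : Expo} : a ∈ S3 w ↔ ∃ i, a ∈ (w i).support := by
  unfold S3; simp only [Finset.mem_union]
  constructor
  · rintro ((h | h) | h)
    exacts [⟨0, h⟩, ⟨1, h⟩, ⟨2, h⟩]
  · rintro ⟨i, h⟩
    fin_cases i
    exacts [Or.inl (Or.inl h), Or.inl (Or.inr h), Or.inr h]

theorem support_subset_S3 (w : Fin 3 → Poly2) (i : Fin 3) : (w i).support ⊆ S3 w :=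
  fun _ h => mem_S3.mpr ⟨i, h⟩

theorem card_S3_le {w : Fin 3 → Poly2} {t : ℕ} (hw : ∀ i, (w i).support.card ≤ t) : (S3 w).card ≤ 3 * t := by
  unfold S3
  calc ((w 0).support ∪ (w 1).support ∪ (w 2).support).card
      ≤ ((w 0).support ∪ (w 1).support).card + (w 2).support.card := Finset.card_union_le _ _
    _ ≤ ((w 0).support.card + (w 1).support.card) + (w 2).support.card :=
        Nat.add_le_add_right (Finset.card_union_le _ _) _
    _ ≤ (t + t) + t := Nat.add_le_add (Nat.add_le_add (hw 0) (hw 1)) (hw 2)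
    _ = 3 * t := by ring

/-- exceptional chart values: the crossings of ALL pairs of carrier points with distinct first coordinate -/
def X3 (σ : ℝ) (w : Fin 3 → Poly2) : Finset ℝ :=
  ((S3 w ×ˢ S3 w).filter (fun ab => ab.1 0 ≠ ab.2 0)).image (fun ab => cross σ ab.1 ab.2)

theorem card_X3_le (σ : ℝ) {w : Fin 3 → Poly2} {t : ℕ} (hw : ∀ i, (w i).support.card ≤ t) :
    (X3 σ w).card ≤ 9 * t ^ 2 := by
  unfold X3
  refine Finset.card_image_le.trans ((Finset.card_filter_le _ _).trans ?_)
  rw [Finset.card_product]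
  have h := card_S3_le hw
  calc (S3 w).card * (S3 w).card ≤ (3 * t) * (3 * t) := Nat.mul_le_mul h h
    _ = 9 * t ^ 2 := by ring

theorem cross_mem_X3 {σ : ℝ} {w : Fin 3 → Poly2} {a b : Expo} (ha : a ∈ S3 w) (hb : b ∈ S3 w)
    (h0 : a 0 ≠ b 0) : cross σ a b ∈ X3 σ w := by
  unfold X3
  exact Finset.mem_image.mpr ⟨(a, b), Finset.mem_filter.mpr ⟨Finset.mem_product.mpr ⟨ha, hb⟩, h0⟩, rfl⟩

/-- off `X3` the chart weight is injective on the carrier set -/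
theorem eq_of_wt_eq_S3 {σ : ℝ} (hσ : σ = 1 ∨ σ = -1) {w : Fin 3 → Poly2} {μ : ℝ} (hμ : μ ∉ X3 σ w)
    {a b : Expo} (ha : a ∈ S3 w) (hb : b ∈ S3 w) (hw : wt (dir σ μ) a = wt (dir σ μ) b) : a = b := by
  by_cases h0 : a 0 = b 0
  · exact eq_of_wt_eq hσ h0 hw
  · have hμ' := wt_eq_imp_cross h0 hw
    rw [hμ'] at hμ
    exact absurd (cross_mem_X3 ha hb h0) hμ

/-- a tie inside the carrier set happens only at an exceptional chart value -/
theorem tie_S3_mem_X3 {σ : ℝ} (hσ : σ = 1 ∨ σ = -1) {w : Fin 3 → Poly2} {T : Finset Expo} (hT : T ⊆ S3 w)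
    {μ : ℝ} (h : TieIn (dir σ μ) T) : μ ∈ X3 σ w := by
  obtain ⟨p, hp, q, hq, hpq, -, hqp⟩ := h
  have h0 : q 0 ≠ p 0 := fun h0 => hpq (eq_of_wt_eq hσ h0 hqp).symm
  rw [wt_eq_imp_cross h0 hqp]
  exact cross_mem_X3 (hT hq) (hT hp) h0

/-- `IsUniqueTop ν G p` is `IsUTop ν G.support p` -/
theorem isUniqueTop_iff (ν : Fin 2 → ℝ) (G : Poly2) (p : Expo) : IsUniqueTop ν G p ↔ IsUTop ν G.support p :=
  Iff.rfl

/-- off `X3`, every nonzero `G` carried by `S3 w` has a unique top -/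
theorem exists_utop3 {σ : ℝ} (hσ : σ = 1 ∨ σ = -1) {w : Fin 3 → Poly2} {μ : ℝ} (hμ : μ ∉ X3 σ w) {G : Poly2}
    (hG : G ≠ 0) (hsub : G.support ⊆ S3 w) : ∃ p, IsUniqueTop (dir σ μ) G p := by
  obtain ⟨p, hp, hmax⟩ := Finset.exists_max_image G.support (wt (dir σ μ)) (support_nonempty' hG)
  exact ⟨p, hp, fun s hs hsp => lt_of_le_of_ne (hmax s hs) fun h => hsp (eq_of_wt_eq_S3 hσ hμ (hsub hs) (hsub hp) h)⟩

/-- off `X3`, two distinct carrier points have distinct weights -/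
theorem wt_ne3 {σ : ℝ} (hσ : σ = 1 ∨ σ = -1) {w : Fin 3 → Poly2} {μ : ℝ} (hμ : μ ∉ X3 σ w) {a b : Expo}
    (ha : a ∈ S3 w) (hb : b ∈ S3 w) (hab : a ≠ b) : wt (dir σ μ) a ≠ wt (dir σ μ) b :=
  fun h => hab (eq_of_wt_eq_S3 hσ hμ ha hb h)

/-- arc index: the number of exceptional chart values below `μ` -/
def idx3 (σ : ℝ) (w : Fin 3 → Poly2) (μ : ℝ) : ℕ := ((X3 σ w).filter (fun z => z < μ)).card

theorem idx3_le (σ : ℝ) (w : Fin 3 → Poly2) (μ : ℝ) : idx3 σ w μ ≤ (X3 σ w).card := Finset.card_filter_le _ _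

theorem gap_of_idx3_eq {σ : ℝ} {w : Fin 3 → Poly2} {x y : ℝ} (_hxy : x < y) (h : idx3 σ w x = idx3 σ w y) :
    ∀ z ∈ X3 σ w, ¬ (x < z ∧ z < y) := by
  rintro z hz ⟨hxz, hzy⟩
  have hsub : (X3 σ w).filter (fun z => z < x) ⊂ (X3 σ w).filter (fun z => z < y) := by
    rw [Finset.ssubset_iff_of_subset]
    · exact ⟨z, Finset.mem_filter.mpr ⟨hz, hzy⟩, fun h => by
        have := (Finset.mem_filter.mp h).2; linarith⟩
    · intro u hu
      obtain ⟨hu1, hu2⟩ := Finset.mem_filter.mp hu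
      exact Finset.mem_filter.mpr ⟨hu1, by linarith⟩
  have := Finset.card_lt_card hsub
  unfold idx3 at h
  omega

/-- `μ` lies on arc `b`: not exceptional, with `b` exceptional values below it -/
def OnArc (σ : ℝ) (w : Fin 3 → Poly2) (b : ℕ) (μ : ℝ) : Prop := μ ∉ X3 σ w ∧ idx3 σ w μ = b

/-- no exceptional value in the CLOSED interval between two points of one arc -/
theorem closedGap_of_onArc {σ : ℝ} {w : Fin 3 → Poly2} {b : ℕ} {x y : ℝ} (_hxy : x ≤ y) (hx : OnArc σ w b x)
    (hy : OnArc σ w b y) : ∀ z ∈ X3 σ w, ¬ (x ≤ z ∧ z ≤ y) := by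
  rintro z hz ⟨hxz, hzy⟩
  rcases eq_or_lt_of_le hxz with h | h
  · exact hx.1 (h ▸ hz)
  rcases eq_or_lt_of_le hzy with h' | h'
  · exact hy.1 (h' ▸ hz)
  exact gap_of_idx3_eq (lt_of_lt_of_le h h'.le) (hx.2.trans hy.2.symm) z hz ⟨h, h'⟩

/-- unique tops of an `S3`-carried polynomial are CONSTANT along an arc -/
theorem utop_const3 {σ : ℝ} (hσ : σ = 1 ∨ σ = -1) {w : Fin 3 → Poly2} {b : ℕ} {x y : ℝ} (hx : OnArc σ w b x)
    (hy : OnArc σ w b y) {G : Poly2} (hsub : G.support ⊆ S3 w) {p p' : Expo} (hp : IsUniqueTop (dir σ x) G p)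
    (hp' : IsUniqueTop (dir σ y) G p') : p = p' := by
  by_contra hne
  rcases lt_trichotomy x y with hxy | hxy | hxy
  · obtain ⟨μ, h1, h2, htie⟩ := exists_tie_between hσ G.support hxy hp hp' hne
    exact closedGap_of_onArc hxy.le hx hy μ (tie_S3_mem_X3 hσ hsub htie) ⟨h1.le, h2.le⟩
  · subst hxy; exact hne (utop_unique hp hp')
  · obtain ⟨μ, h1, h2, htie⟩ := exists_tie_between hσ G.support hxy hp' hp (Ne.symm hne)
    exact closedGap_of_onArc hxy.le hy hx μ (tie_S3_mem_X3 hσ hsub htie) ⟨h1.le, h2.le⟩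

/-- transport of a unique top along an arc -/
theorem utop_onArc {σ : ℝ} (hσ : σ = 1 ∨ σ = -1) {w : Fin 3 → Poly2} {b : ℕ} {x y : ℝ} (hx : OnArc σ w b x)
    (hy : OnArc σ w b y) {G : Poly2} (hG : G ≠ 0) (hsub : G.support ⊆ S3 w) {p : Expo}
    (hp : IsUniqueTop (dir σ x) G p) : IsUniqueTop (dir σ y) G p := by
  obtain ⟨p', hp'⟩ := exists_utop3 hσ hy.1 hG hsub
  rwa [utop_const3 hσ hx hy hsub hp hp']

/-- the SIGN of a weight difference of two carrier points is constant along an arc -/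
theorem sameSign3 {σ : ℝ} (_hσ : σ = 1 ∨ σ = -1) {w : Fin 3 → Poly2} {b : ℕ} {x y : ℝ} (hx : OnArc σ w b x)
    (hy : OnArc σ w b y) {p q : Expo} (hp : p ∈ S3 w) (hq : q ∈ S3 w) :
    (0 < wt (dir σ x) p - wt (dir σ x) q ↔ 0 < wt (dir σ y) p - wt (dir σ y) q) := by
  by_cases h0 : p 0 = q 0
  · have e : wt (dir σ x) p - wt (dir σ x) q = wt (dir σ y) p - wt (dir σ y) q := by
      rw [wt_sub_eq, wt_sub_eq, h0]; ring
    rw [e]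
  · have hc : cross σ p q ∈ X3 σ w := cross_mem_X3 hp hq h0
    rw [wt_sub_eq_cross x h0, wt_sub_eq_cross y h0]
    -- `cross σ p q` is not in the closed interval between `x` and `y`, so `x - c` and `y - c` have the same sign
    have key : (0 < x - cross σ p q ↔ 0 < y - cross σ p q) ∧ (x - cross σ p q < 0 ↔ y - cross σ p q < 0) := by
      rcases le_total x y with hxy | hxy
      · have h := closedGap_of_onArc hxy hx hy _ hc
        push Not at h
        constructor
        · constructor
          · intro h1; linarith
          · intro h1
            by_contra h2; push Not at h2
            have hxz : x ≤ cross σ p q := by linarith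
            have := h hxz; linarith
        · constructor
          · intro h1
            by_contra h2; push Not at h2
            have := h (by linarith); linarith
          · intro h1; linarith
      · have h := closedGap_of_onArc hxy hy hx _ hc
        push Not at h
        constructor
        · constructor
          · intro h1
            by_contra h2; push Not at h2
            have := h (by linarith); linarith
          · intro h1; linarith
        · constructor
          · intro h1; linarith
          · intro h1
            by_contra h2; push Not at h2
            have := h (by linarith); linarith
    have hd : (((p 0 : ℕ) : ℝ) - ((q 0 : ℕ) : ℝ)) ≠ 0 := sub_ne_zero_of_ne0 h0
    rcases lt_or_gt_of_ne hd with hneg | hpos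
    · rw [mul_pos_iff, mul_pos_iff]
      constructor
      · rintro (⟨h1, h2⟩ | ⟨h1, h2⟩)
        · exact absurd h2 (not_lt.mpr hneg.le)
        · exact Or.inr ⟨key.2.mp h1, h2⟩
      · rintro (⟨h1, h2⟩ | ⟨h1, h2⟩)
        · exact absurd h2 (not_lt.mpr hneg.le)
        · exact Or.inr ⟨key.2.mpr h1, h2⟩
    · rw [mul_pos_iff, mul_pos_iff]
      constructor
      · rintro (⟨h1, h2⟩ | ⟨h1, h2⟩)
        · exact Or.inl ⟨key.1.mp h1, h2⟩
        · exact absurd h2 (not_lt.mpr hpos.le)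
      · rintro (⟨h1, h2⟩ | ⟨h1, h2⟩)
        · exact Or.inl ⟨key.1.mpr h1, h2⟩
        · exact absurd h2 (not_lt.mpr hpos.le)

/-! ### Rank 3 — R2: homogeneity helpers and the ECHELON basis on an arc -/

/-- `∂/∂Xᵢ` lowers the degree of a homogeneous polynomial by one (the 7-line proof of
`Literature.Algebra.Polynomial.JacobianCriterion.isHomogeneous_pderiv`, Humphreys § 3.10, copied for `Fin 3`). -/
theorem isHomogeneous_pderiv3 {p : Poly3} {n : ℕ} (hp : p.IsHomogeneous n) (i : Fin 3) :
    (pderiv i p).IsHomogeneous (n - 1) := by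
  classical
  intro d hd
  rw [coeff_pderiv] at hd
  have h := hp (left_ne_zero_of_mul hd)
  rw [map_add, Finsupp.weight_single, smul_eq_mul, Pi.one_apply, mul_one] at h
  change Finsupp.weight 1 d = n - 1
  omega

/-- substitution of LINEAR FORMS preserves homogeneity -/
theorem isHomogeneous_bind₁_lin {P : Poly3} {m : ℕ} (hP : P.IsHomogeneous m) (L : Fin 3 → Poly3)
    (hL : ∀ i, (L i).IsHomogeneous 1) : (bind₁ L P).IsHomogeneous m := by
  classical
  rw [P.as_sum, map_sum]
  refine IsHomogeneous.sum _ _ _ fun d hd => ?_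
  rw [bind₁_monomial]
  have h := hP (mem_support_iff.mp hd)
  have hdeg : ∑ i ∈ d.support, 1 * d i = m := by
    have h' : Finsupp.weight (1 : Fin 3 → ℕ) d = m := h
    rw [Finsupp.weight_apply, Finsupp.sum] at h'
    simpa [smul_eq_mul] using h'
  rw [← zero_add m]
  refine (isHomogeneous_C _ _).mul ?_
  rw [← hdeg]
  exact IsHomogeneous.prod _ _ _ fun i _ => (hL i).pow (d i)

theorem mem_support_of_C_mul {b : ℂ} {G : Poly2} {s : Expo} (hs : s ∈ (C b * G).support) : s ∈ G.support := by
  rw [mem_support_iff, coeff_C_mul] at hs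
  exact mem_support_iff.mpr (right_ne_zero_of_mul hs)

theorem support_sub_C_mul_subset {G H : Poly2} {b : ℂ} {S : Finset Expo} (hG : G.support ⊆ S) (hH : H.support ⊆ S) :
    (G - C b * H).support ⊆ S := by
  intro s hs
  rcases Finset.mem_union.mp ((MvPolynomial.support_sub ..) hs) with h | h
  · exact hG h
  · exact hH (mem_support_of_C_mul h)

theorem not_mem_support_elim {G H : Poly2} {p : Expo} (hc : coeff p H ≠ 0) :
    p ∉ (G - C (coeff p G / coeff p H) * H).support := by
  intro h
  apply mem_support_iff.mp h
  rw [coeff_sub, coeff_C_mul]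
  field_simp
  ring

/-- THE ECHELON LEMMA (weak form = what the transfer needs): at a non-exceptional chart value `μ₀` there is a
change of generators `w' = B·w` (B = permutation ∘ unipotent, so invertible) and `P' = P ∘ B⁻¹` homogeneous of the
same degree with `P'(w') = P(w)`, all rows carried by `S3 w`, row 0 having the overall top carrier point `p₀` as its
UNIQUE top and rows 1, 2 not containing `p₀`.  (Row 1's unique top `p₁ ≠ p₀`, when row 1 is nonzero, then exists
by `exists_utop3` and has a different weight by injectivity; both tops are constant along the arc by `utop_onArc`.) -/
theorem echelon3 {σ : ℝ} (hσ : σ = 1 ∨ σ = -1) {w : Fin 3 → Poly2} (hne : (S3 w).Nonempty) {μ₀ : ℝ}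
    (hμ : μ₀ ∉ X3 σ w) (P : Poly3) {m : ℕ} (hP : P.IsHomogeneous m) :
    ∃ (w' : Fin 3 → Poly2) (P' : Poly3) (p₀ : Expo), P'.IsHomogeneous m ∧ aeval w' P' = aeval w P ∧
      (∀ i, (w' i).support ⊆ S3 w) ∧ IsUniqueTop (dir σ μ₀) (w' 0) p₀ ∧
      p₀ ∉ (w' 1).support ∧ p₀ ∉ (w' 2).support := by
  classical
  -- the overall top carrier point `p₀` and a generator `w a` containing it
  obtain ⟨p₀, hp₀S, hmax⟩ := Finset.exists_max_image (S3 w) (wt (dir σ μ₀)) hne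
  obtain ⟨a, ha⟩ := mem_S3.mp hp₀S
  -- permute so that this generator comes first
  set π : Equiv.Perm (Fin 3) := Equiv.swap 0 a with hπ
  set wπ : Fin 3 → Poly2 := w ∘ π with hwπ
  have hwπ0 : wπ 0 = w a := by simp [hwπ, hπ]
  have hSπ : ∀ i, (wπ i).support ⊆ S3 w := fun i => support_subset_S3 w (π i)
  set Pπ : Poly3 := rename π P with hPπ
  have hPπ_hom : Pπ.IsHomogeneous m := hP.rename_isHomogeneous
  have hev1 : aeval wπ Pπ = aeval w P := by
    rw [hPπ, aeval_rename]
    have hfun : (wπ ∘ ⇑π : Fin 3 → Poly2) = w := by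
      funext i; simp [hwπ, hπ, Function.comp, Equiv.swap_apply_self]
    rw [hfun]
  -- eliminate `p₀` from generators 1 and 2
  have hc0 : coeff p₀ (wπ 0) ≠ 0 := by rw [hwπ0]; exact mem_support_iff.mp ha
  set β : ℂ := coeff p₀ (wπ 1) / coeff p₀ (wπ 0) with hβ
  set γ : ℂ := coeff p₀ (wπ 2) / coeff p₀ (wπ 0) with hγ
  set L : Fin 3 → Poly3 := ![X 0, X 1 + C β * X 0, X 2 + C γ * X 0] with hL
  refine ⟨![wπ 0, wπ 1 - C β * wπ 0, wπ 2 - C γ * wπ 0], bind₁ L Pπ, p₀, ?_, ?_, ?_, ?_, ?_, ?_⟩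
  · -- homogeneity of `P' = Pπ ∘ L`
    refine isHomogeneous_bind₁_lin hPπ_hom L fun i => ?_
    fin_cases i
    · exact isHomogeneous_X ℂ 0
    · exact (isHomogeneous_X ℂ 1).add ((isHomogeneous_X ℂ 0).C_mul β)
    · exact (isHomogeneous_X ℂ 2).add ((isHomogeneous_X ℂ 0).C_mul γ)
  · -- evaluation: `P'(w') = Pπ(wπ) = P(w)`
    rw [← hev1, aeval_bind₁]
    have hfun : (fun i => aeval ![wπ 0, wπ 1 - C β * wπ 0, wπ 2 - C γ * wπ 0] (L i)) = wπ := by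
      funext i
      fin_cases i
      · simp [hL]
      · simp [hL, MvPolynomial.algebraMap_eq]
      · simp [hL, MvPolynomial.algebraMap_eq]
    rw [hfun]
  · intro i
    fin_cases i
    · exact hSπ 0
    · exact support_sub_C_mul_subset (hSπ 1) (hSπ 0)
    · exact support_sub_C_mul_subset (hSπ 2) (hSπ 0)
  · -- unique top of row 0 = `w a` at `μ₀` is `p₀`
    refine ⟨?_, fun s hs hsp => ?_⟩
    · show p₀ ∈ (wπ 0).support
      rw [hwπ0]; exact ha
    · have hsS : s ∈ S3 w := hSπ 0 hs
      exact lt_of_le_of_ne (hmax s hsS) (wt_ne3 hσ hμ hsS hp₀S hsp)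
  · exact not_mem_support_elim hc0
  · exact not_mem_support_elim hc0

/-! ### Rank 3 — R3: line-specials, and the tower on an arc -/

/-- edge-normal chart values of `G` lying on arc `b` -/
def Ef (σ : ℝ) (w : Fin 3 → Poly2) (b : ℕ) (G : Poly2) : Finset ℝ := (Eset σ G).filter (fun μ => OnArc σ w b μ)

theorem mem_Ef {σ : ℝ} (hσ : σ = 1 ∨ σ = -1) {w : Fin 3 → Poly2} {b : ℕ} {G : Poly2} {μ : ℝ} :
    μ ∈ Ef σ w b G ↔ IsEdgeDir (dir σ μ) G ∧ OnArc σ w b μ := by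
  unfold Ef; rw [Finset.mem_filter, mem_Eset hσ]

theorem Ef_subset_Eset (σ : ℝ) (w : Fin 3 → Poly2) (b : ℕ) (G : Poly2) : Ef σ w b G ⊆ Eset σ G :=
  Finset.filter_subset _ _

theorem Ef_zero (σ : ℝ) (w : Fin 3 → Poly2) (b : ℕ) : Ef σ w b 0 = ∅ := by
  unfold Ef; rw [Eset_zero]; simp

/-- line-specials of `F` for the line datum `(k, p₀, p₁)`, on arc `b` -/
def Spec3 (σ : ℝ) (w : Fin 3 → Poly2) (b : ℕ) (F : Poly2) (k : ℕ) (p₀ p₁ : Expo) : Finset ℝ :=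
  (Ef σ w b F).filter (fun μ => IsLineSpecial (dir σ μ) F k p₀ p₁)

theorem special_tie3 {ν : Fin 2 → ℝ} {F : Poly2} {k : ℕ} {p₀ p₁ : Expo} (h : IsLineSpecial ν F k p₀ p₁) :
    TieIn ν F.support := by
  obtain ⟨p, hp, q, hq, hpq, hptop, hqp, -, -⟩ := h
  exact ⟨p, hp, q, hq, hpq, hptop, hqp⟩

/-- a line-special direction has a top point ON the line -/
theorem special_line_top {ν : Fin 2 → ℝ} {F : Poly2} {k : ℕ} {p₀ p₁ : Expo} (h : IsLineSpecial ν F k p₀ p₁) :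
    ∃ a ∈ F.support, lam k p₀ p₁ a = 0 ∧ ∀ r ∈ F.support, wt ν r ≤ wt ν a := by
  obtain ⟨p, hp, q, hq, _, hptop, hqp, -, hl⟩ := h
  rcases hl with h | h
  · exact ⟨p, hp, h, hptop⟩
  · exact ⟨q, hq, h, fun r hr => (hptop r hr).trans_eq hqp.symm⟩

/-- `lam k p₀ p₁` is affine with gradient `⊥ (p₀ − p₁)`: equal values ⇒ the difference is parallel to `p₀ − p₁` -/
theorem lam_eq_lam {k : ℕ} {p₀ p₁ a a' : Expo} (h : lam k p₀ p₁ a = lam k p₀ p₁ a') :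
    (((a 0 : ℕ) : ℤ) - ((a' 0 : ℕ) : ℤ)) * (((p₀ 1 : ℕ) : ℤ) - ((p₁ 1 : ℕ) : ℤ))
      = (((a 1 : ℕ) : ℤ) - ((a' 1 : ℕ) : ℤ)) * (((p₀ 0 : ℕ) : ℤ) - ((p₁ 0 : ℕ) : ℤ)) := by
  unfold lam idet at h
  linear_combination h

/-- LINE-POINT CONSTANCY: two line-specials on one arc share their on-line top point -/
theorem linePoint_eq {σ : ℝ} (hσ : σ = 1 ∨ σ = -1) {w : Fin 3 → Poly2} {b : ℕ} {x y : ℝ} (_hxy : x < y)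
    (hx : OnArc σ w b x) (hy : OnArc σ w b y) {p₀ p₁ : Expo} (hp₀ : p₀ ∈ S3 w) (hp₁ : p₁ ∈ S3 w) (hne : p₀ ≠ p₁)
    {k : ℕ} {F : Poly2} {a a' : Expo} (ha : lam k p₀ p₁ a = 0) (ha' : lam k p₀ p₁ a' = 0)
    (haS : a ∈ F.support) (ha'S : a' ∈ F.support)
    (hatop : ∀ r ∈ F.support, wt (dir σ x) r ≤ wt (dir σ x) a)
    (ha'top : ∀ r ∈ F.support, wt (dir σ y) r ≤ wt (dir σ y) a') : a = a' := by
  have hpar := lam_eq_lam (ha.trans ha'.symm)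
  have hparR : (((a 0 : ℕ) : ℝ) - ((a' 0 : ℕ) : ℝ)) * (((p₀ 1 : ℕ) : ℝ) - ((p₁ 1 : ℕ) : ℝ))
      = (((a 1 : ℕ) : ℝ) - ((a' 1 : ℕ) : ℝ)) * (((p₀ 0 : ℕ) : ℝ) - ((p₁ 0 : ℕ) : ℝ)) := by
    exact_mod_cast hpar
  have i1 := hatop a' ha'S
  have i2 := ha'top a haS
  have gx : wt (dir σ x) p₀ - wt (dir σ x) p₁ ≠ 0 := sub_ne_zero.mpr (wt_ne3 hσ hx.1 hp₀ hp₁ hne)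
  have gy : wt (dir σ y) p₀ - wt (dir σ y) p₁ ≠ 0 := sub_ne_zero.mpr (wt_ne3 hσ hy.1 hp₀ hp₁ hne)
  have hs := sameSign3 hσ hx hy hp₀ hp₁
  have ex := wt_sub_eq σ x a a'
  have ey := wt_sub_eq σ y a a'
  have gxe := wt_sub_eq σ x p₀ p₁
  have gye := wt_sub_eq σ y p₀ p₁
  set A := wt (dir σ x) a - wt (dir σ x) a' with hA
  set B := wt (dir σ y) a - wt (dir σ y) a' with hB
  set gX := wt (dir σ x) p₀ - wt (dir σ x) p₁ with hgX
  set gY := wt (dir σ y) p₀ - wt (dir σ y) p₁ with hgY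
  set Δ0 := ((a 0 : ℕ) : ℝ) - ((a' 0 : ℕ) : ℝ) with hΔ0
  set Δ1 := ((a 1 : ℕ) : ℝ) - ((a' 1 : ℕ) : ℝ) with hΔ1
  set d0 := ((p₀ 0 : ℕ) : ℝ) - ((p₁ 0 : ℕ) : ℝ) with hd0
  set d1 := ((p₀ 1 : ℕ) : ℝ) - ((p₁ 1 : ℕ) : ℝ) with hd1
  have hA0 : 0 ≤ A := by rw [hA]; linarith
  have hB0 : B ≤ 0 := by rw [hB]; linarith
  have hgpos : 0 < gX * gY := by
    rcases lt_or_gt_of_ne gx with h | h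
    · have h' : gY < 0 := by
        rcases lt_or_gt_of_ne gy with h2 | h2
        · exact h2
        · exact absurd (hs.mpr h2) (not_lt.mpr h.le)
      exact mul_pos_of_neg_of_neg h h'
    · exact mul_pos h (hs.mp h)
  have key1 : Δ0 * gX = d0 * A := by rw [ex, gxe]; linear_combination σ * hparR
  have key2 : Δ0 * gY = d0 * B := by rw [ey, gye]; linear_combination σ * hparR
  have hsq : Δ0 ^ 2 * (gX * gY) = d0 ^ 2 * (A * B) := by
    calc Δ0 ^ 2 * (gX * gY) = (Δ0 * gX) * (Δ0 * gY) := by ring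
      _ = (d0 * A) * (d0 * B) := by rw [key1, key2]
      _ = d0 ^ 2 * (A * B) := by ring
  have hΔ0z : Δ0 = 0 := by
    by_contra hne0
    have h0 : 0 < Δ0 ^ 2 := lt_of_le_of_ne (sq_nonneg Δ0) (Ne.symm (pow_ne_zero 2 hne0))
    have h1 : 0 < Δ0 ^ 2 * (gX * gY) := mul_pos h0 hgpos
    have h2' : 0 ≤ d0 ^ 2 * A := mul_nonneg (sq_nonneg d0) hA0
    have h2 : d0 ^ 2 * (A * B) ≤ 0 := by nlinarith [h2', hB0]
    linarith
  have hΔ1z : Δ1 = 0 := by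
    have e1 : A = σ * Δ1 := by rw [ex, hΔ0z]; ring
    have e2 : B = σ * Δ1 := by rw [ey, hΔ0z]; ring
    have : σ * Δ1 = 0 := by linarith
    rcases mul_eq_zero.mp this with h | h
    · exact absurd h (sigma_ne_zero hσ)
    · exact h
  apply expo_eq_of_coords
  · have : ((a 0 : ℕ) : ℝ) = ((a' 0 : ℕ) : ℝ) := by linarith
    exact_mod_cast this
  · have : ((a 1 : ℕ) : ℝ) = ((a' 1 : ℕ) : ℝ) := by linarith
    exact_mod_cast this

/-- AT MOST TWO line-specials per (chart-arc, level) -/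
theorem spec3_le_two {σ : ℝ} (hσ : σ = 1 ∨ σ = -1) (w : Fin 3 → Poly2) (b : ℕ) (F : Poly2) (k : ℕ) {p₀ p₁ : Expo}
    (hp₀ : p₀ ∈ S3 w) (hp₁ : p₁ ∈ S3 w) (hne : p₀ ≠ p₁) : (Spec3 σ w b F k p₀ p₁).card ≤ 2 := by
  by_contra h3; push Not at h3
  set f := Spec3 σ w b F k p₀ p₁ with hf
  have hne' : f.Nonempty := Finset.card_pos.mp (by omega)
  set x := f.min' hne' with hx
  set y := f.max' hne' with hy
  have hxf : x ∈ f := Finset.min'_mem f hne'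
  have hyf : y ∈ f := Finset.max'_mem f hne'
  have hcard : ((f.erase x).erase y).card ≥ 1 := by
    have h1 := Finset.card_erase_of_mem hxf
    have h2 : ((f.erase x).erase y).card ≥ (f.erase x).card - 1 := by
      by_cases hy' : y ∈ f.erase x
      · rw [Finset.card_erase_of_mem hy']
      · rw [Finset.erase_eq_of_notMem hy']; omega
    omega
  obtain ⟨m, hm⟩ := Finset.card_pos.mp (by omega : 0 < ((f.erase x).erase y).card)
  have hmy : m ≠ y := Finset.ne_of_mem_erase hm
  have hm' := Finset.mem_of_mem_erase hm
  have hmx : m ≠ x := Finset.ne_of_mem_erase hm'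
  have hmf : m ∈ f := Finset.mem_of_mem_erase hm'
  have hxm : x < m := lt_of_le_of_ne (Finset.min'_le f m hmf) (Ne.symm hmx)
  have hmy' : m < y := lt_of_le_of_ne (Finset.le_max' f m hmf) hmy
  have unpack : ∀ u ∈ f, OnArc σ w b u ∧ IsLineSpecial (dir σ u) F k p₀ p₁ := by
    intro u hu
    obtain ⟨hu1, hu2⟩ := Finset.mem_filter.mp hu
    exact ⟨((mem_Ef hσ).mp hu1).2, hu2⟩
  obtain ⟨ox, hsx⟩ := unpack x hxf
  obtain ⟨om, hsm⟩ := unpack m hmf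
  obtain ⟨oy, hsy⟩ := unpack y hyf
  obtain ⟨ax, haxS, hax, htx⟩ := special_line_top hsx
  obtain ⟨am, hamS, ham, htm⟩ := special_line_top hsm
  obtain ⟨ay, hayS, hay, hty⟩ := special_line_top hsy
  have e1 : ax = am := linePoint_eq hσ hxm ox om hp₀ hp₁ hne hax ham haxS hamS htx htm
  have e2 : am = ay := linePoint_eq hσ hmy' om oy hp₀ hp₁ hne ham hay hamS hayS htm hty
  subst e1; subst e2
  have hu := utop_between hσ hxm hmy' haxS htx hty
  exact not_tie_of_utop hu (special_tie3 hsm)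

theorem support_pderiv_deg3 {Q : Poly3} {s : Fin 3 →₀ ℕ} (hs : s ∈ (pderiv 2 Q).support) :
    s + Finsupp.single 2 1 ∈ Q.support := by
  rw [MvPolynomial.mem_support_iff, coeff_pderiv] at hs
  rw [MvPolynomial.mem_support_iff]
  intro h; apply hs; rw [h, zero_mul]

theorem deg2_lt_of_totalDegree (P : Poly3) : ∀ s ∈ P.support, s 2 < P.totalDegree + 1 := by
  intro s hs
  have h1 : s 2 ≤ s.sum (fun _ e => e) := by
    by_cases h : (2 : Fin 3) ∈ s.support
    · exact Finset.single_le_sum (fun j _ => Nat.zero_le (s j)) h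
    · rw [Finsupp.notMem_support_iff.mp h]; exact Nat.zero_le _
  have h2 := le_totalDegree hs
  omega

section ArcTower
variable {σ : ℝ} (hσ : σ = 1 ∨ σ = -1) (w : Fin 3 → Poly2) (b : ℕ) (w' : Fin 3 → Poly2) {p₀ p₁ : Expo}
  (hp₀ : p₀ ∈ S3 w) (hp₁ : p₁ ∈ S3 w) (hne : p₀ ≠ p₁)
  (htop : ∀ μ, OnArc σ w b μ →
    IsUniqueTop (dir σ μ) (w' 0) p₀ ∧ IsUniqueTop (dir σ μ) (w' 1) p₁ ∧ wt (dir σ μ) p₀ ≠ wt (dir σ μ) p₁)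
include hσ htop

/-- ONE LEVEL of the tower: an edge normal on the arc is a line-special, or an edge normal of `Ω(w')`, or an edge
normal of the next level `(∂₂Q)(w')` — `wronskianTransfer` + `wronskianRule` + `ostrowski`. -/
theorem step3 (Q : Poly3) (k : ℕ) (hQ : Q.IsHomogeneous k) :
    Ef σ w b (aeval w' Q) ⊆
      Spec3 σ w b (aeval w' Q) k p₀ p₁ ∪ Ef σ w b (omega w') ∪ Ef σ w b (aeval w' (pderiv 2 Q)) := by
  intro μ hμ
  obtain ⟨hedge, harc⟩ := (mem_Ef hσ).mp hμ
  obtain ⟨h0, h1, h01⟩ := htop μ harc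
  rcases wronskianTransfer (dir σ μ) (aeval w' Q) (w' 0) (w' 1) k p₀ p₁ (ne_zero_of_isEdgeDir hedge) h0 h1 h01
      hedge with hsp | hE
  · exact Finset.mem_union_left _ (Finset.mem_union_left _ (Finset.mem_filter.mpr ⟨hμ, hsp⟩))
  · rw [← wronskianRule w' Q k hQ] at hE
    by_cases hΩ : omega w' = 0
    · exfalso; rw [hΩ, zero_mul] at hE; exact ne_zero_of_isEdgeDir hE rfl
    by_cases hD : aeval w' (pderiv 2 Q) = 0
    · exfalso; rw [hD, mul_zero] at hE; exact ne_zero_of_isEdgeDir hE rfl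
    rcases (ostrowski _ _ _ hΩ hD).mp hE with h | h
    · exact Finset.mem_union_left _ (Finset.mem_union_right _ ((mem_Ef hσ).mpr ⟨h, harc⟩))
    · exact Finset.mem_union_right _ ((mem_Ef hσ).mpr ⟨h, harc⟩)

include hp₀ hp₁ hne in
/-- THE TOWER on an arc: `|Ef_b(Q(w'))| ≤ n · (2 + |Eset σ Ω(w')|)` whenever `deg_{X₂} Q < n`, `Q` homogeneous -/
theorem tower3 : ∀ (n : ℕ) (Q : Poly3) (k : ℕ), Q.IsHomogeneous k → (∀ s ∈ Q.support, s 2 < n) →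
    (Ef σ w b (aeval w' Q)).card ≤ n * (2 + (Eset σ (omega w')).card) := by
  intro n
  induction n with
  | zero =>
    intro Q k _ hQ
    have hQ0 : Q = 0 := by
      by_contra h
      obtain ⟨d, hd⟩ := MvPolynomial.ne_zero_iff.mp h
      exact absurd (hQ d (MvPolynomial.mem_support_iff.mpr hd)) (Nat.not_lt_zero _)
    subst hQ0
    rw [map_zero, Ef_zero]; simp
  | succ n ih =>
    intro Q k hQh hQ
    have hQ' : ∀ s ∈ (pderiv 2 Q).support, s 2 < n := by
      intro s hs
      have := hQ _ (support_pderiv_deg3 hs)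
      simp only [Finsupp.add_apply, Finsupp.single_eq_same] at this
      omega
    have ih' := ih (pderiv 2 Q) (k - 1) (isHomogeneous_pderiv3 hQh 2) hQ'
    have hstep := step3 hσ w b w' htop Q k hQh
    have hsp := spec3_le_two hσ w b (aeval w' Q) k hp₀ hp₁ hne
    have hEf : (Ef σ w b (omega w')).card ≤ (Eset σ (omega w')).card :=
      Finset.card_le_card (Ef_subset_Eset σ w b (omega w'))
    calc (Ef σ w b (aeval w' Q)).card
        ≤ (Spec3 σ w b (aeval w' Q) k p₀ p₁ ∪ Ef σ w b (omega w') ∪ Ef σ w b (aeval w' (pderiv 2 Q))).card :=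
          Finset.card_le_card hstep
      _ ≤ (Spec3 σ w b (aeval w' Q) k p₀ p₁).card + (Ef σ w b (omega w')).card +
            (Ef σ w b (aeval w' (pderiv 2 Q))).card := by
          refine (Finset.card_union_le _ _).trans (Nat.add_le_add_right ?_ _)
          exact Finset.card_union_le _ _
      _ ≤ (n + 1) * (2 + (Eset σ (omega w')).card) := by nlinarith [hsp, ih', hEf]

end ArcTower

/-! ### Rank 3 — R4: degenerate branches, the count, `RankThreeLinearLaw`, `TwoProductsLinRankThree` -/

/-- a constant has no edge direction -/
theorem not_isEdgeDir_C (ν : Fin 2 → ℝ) (c : ℂ) : ¬ IsEdgeDir ν (C c : Poly2) := by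
  rintro ⟨p, hp, q, hq, hpq, -, -⟩
  have hp0 : p = 0 := by
    by_contra h; exact (mem_support_iff.mp hp) (by rw [coeff_C, if_neg (fun e => h e.symm)])
  have hq0 : q = 0 := by
    by_contra h; exact (mem_support_iff.mp hq) (by rw [coeff_C, if_neg (fun e => h e.symm)])
  exact hpq (hp0.trans hq0.symm)

/-- constant generators ⇒ constant composite -/
theorem aeval_C3 (c : Fin 3 → ℂ) (Q : Poly3) : ∃ a : ℂ, aeval (fun i => (C (c i) : Poly2)) Q = C a := by
  induction Q using MvPolynomial.induction_on with
  | C a => exact ⟨a, by simp⟩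
  | add p q hp hq =>
    obtain ⟨a, ha⟩ := hp; obtain ⟨b, hb⟩ := hq
    exact ⟨a + b, by rw [map_add, ha, hb, C_add]⟩
  | mul_X p i hp =>
    obtain ⟨a, ha⟩ := hp
    exact ⟨a * c i, by rw [map_mul, ha, aeval_X, C_mul]⟩

/-- RANK ONE: if rows 1, 2 vanish, a homogeneous `Q` of degree `m` composes to `c · (w' 0)^m` -/
theorem aeval_rank1 {w' : Fin 3 → Poly2} (h1 : w' 1 = 0) (h2 : w' 2 = 0) {Q : Poly3} {m : ℕ}
    (hQ : Q.IsHomogeneous m) : aeval w' Q = C (coeff (Finsupp.single 0 m) Q) * (w' 0) ^ m := by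
  classical
  conv_lhs => rw [Q.as_sum, map_sum]
  rw [Finset.sum_eq_single (Finsupp.single 0 m)]
  · rw [aeval_monomial, MvPolynomial.algebraMap_eq, Finsupp.prod_single_index (h := fun i k => w' i ^ k) (pow_zero _)]
  · intro d hd hne
    rw [aeval_monomial]
    have hd12 : d 1 ≠ 0 ∨ d 2 ≠ 0 := by
      by_contra hh; push Not at hh
      apply hne
      have hwt : Finsupp.weight (1 : Fin 3 → ℕ) d = m := hQ (mem_support_iff.mp hd)
      rw [Finsupp.weight_apply, Finsupp.sum_fintype _ _ (by simp)] at hwt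
      simp only [Fin.sum_univ_three, Pi.one_apply, smul_eq_mul, mul_one, hh.1, hh.2, add_zero] at hwt
      ext i
      fin_cases i
      · simpa using hwt
      · simpa using hh.1
      · simpa using hh.2
    rcases hd12 with h | h
    · rw [Finsupp.prod, Finset.prod_eq_zero (Finsupp.mem_support_iff.mpr h)
        (by show w' 1 ^ d 1 = 0; rw [h1]; exact zero_pow h), mul_zero]
    · rw [Finsupp.prod, Finset.prod_eq_zero (Finsupp.mem_support_iff.mpr h)
        (by show w' 2 ^ d 2 = 0; rw [h2]; exact zero_pow h), mul_zero]
  · intro hnot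
    rw [MvPolynomial.notMem_support_iff.mp hnot, map_zero, map_zero]

/-- `c · u^j` has no edge in a direction where `u` has a unique top -/
theorem not_isEdgeDir_C_mul_pow {ν : Fin 2 → ℝ} {u : Poly2} {p : Expo} (hu : IsUniqueTop ν u p) (c : ℂ) :
    ∀ j : ℕ, ¬ IsEdgeDir ν (C c * u ^ j) := by
  have hu0 : u ≠ 0 := by
    intro h; have := hu.1; rw [h] at this; simp at this
  intro j
  induction j with
  | zero => rw [pow_zero, mul_one]; exact not_isEdgeDir_C ν c
  | succ j ih =>
    intro hE
    by_cases hc : c = 0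
    · rw [hc, C_0, zero_mul] at hE; exact ne_zero_of_isEdgeDir hE rfl
    have hne : C c * u ^ j ≠ 0 := mul_ne_zero (by rwa [Ne, C_eq_zero]) (pow_ne_zero j hu0)
    rw [pow_succ, ← mul_assoc] at hE
    rcases (ostrowski ν _ _ hne hu0).mp hE with h | h
    · exact ih h
    · exact not_tie_of_utop hu h

theorem card_Eset_omega_le (σ : ℝ) {w : Fin 3 → Poly2} (w' : Fin 3 → Poly2) {t : ℕ}
    (hw : ∀ i, (w i).support.card ≤ t) (hsub : ∀ i, (w' i).support ⊆ S3 w) :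
    (Eset σ (omega w')).card ≤ 729 * t ^ 6 := by
  have hSt : ∀ i, (w' i).support.card ≤ 3 * t := fun i => (Finset.card_le_card (hsub i)).trans (card_S3_le hw)
  have hs := card_support_omega_le w' (3 * t) hSt
  calc (Eset σ (omega w')).card ≤ (omega w').support.card * (omega w').support.card := card_Eset_le σ (omega w')
    _ ≤ (3 * t) ^ 3 * (3 * t) ^ 3 := Nat.mul_le_mul hs hs
    _ = 729 * t ^ 6 := by ring

/-- ON ONE CHART-ARC: `|Ef_b(P(w))| ≤ (m+1)·(2 + 729 t⁶)` — the echelon lemma, the tower, and the two degenerate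
branches (rows 1, 2 both zero = rank one; all generators zero). -/
theorem arc_bound3 {σ : ℝ} (hσ : σ = 1 ∨ σ = -1) (w : Fin 3 → Poly2) {t : ℕ} (hw : ∀ i, (w i).support.card ≤ t)
    (P : Poly3) {m : ℕ} (hP : P.IsHomogeneous m) (b : ℕ) :
    (Ef σ w b (aeval w P)).card ≤ (m + 1) * (2 + 729 * t ^ 6) := by
  by_cases hE : Ef σ w b (aeval w P) = ∅
  · rw [hE]; simp
  obtain ⟨μ₀, hμ₀⟩ := Finset.nonempty_of_ne_empty hE
  obtain ⟨hedge0, harc0⟩ := (mem_Ef hσ).mp hμ₀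
  have hne : (S3 w).Nonempty := by
    by_contra hS
    have hw0 : ∀ i, w i = C 0 := by
      intro i
      have hsub := support_subset_S3 w i
      rw [Finset.not_nonempty_iff_eq_empty.mp hS, Finset.subset_empty, support_eq_empty] at hsub
      rw [hsub, C_0]
    obtain ⟨c, hc⟩ := aeval_C3 (fun _ => 0) P
    have hw' : w = fun i => (C ((fun _ : Fin 3 => (0 : ℂ)) i) : Poly2) := funext fun i => by simpa using hw0 i
    rw [hw', hc] at hedge0
    exact not_isEdgeDir_C _ c hedge0
  obtain ⟨w', P', p₀, hP', hev, hsub, h0, hn1, hn2⟩ := echelon3 hσ hne harc0.1 P hP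
  have hp₀S : p₀ ∈ S3 w := hsub 0 h0.1
  have hu0 : w' 0 ≠ 0 := by
    intro h; have := h0.1; rw [h] at this; simp at this
  -- the generic finishing step, given a second row with a unique top
  have finish : ∀ (w'' : Fin 3 → Poly2) (P'' : Poly3), P''.IsHomogeneous m → aeval w'' P'' = aeval w' P' →
      w'' 0 = w' 0 → (∀ i, (w'' i).support ⊆ S3 w) → p₀ ∉ (w'' 1).support → w'' 1 ≠ 0 →
      (Ef σ w b (aeval w' P')).card ≤ (m + 1) * (2 + 729 * t ^ 6) := by
    intro w'' P'' hP'' hev'' h0'' hsub'' hn1'' h1''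
    obtain ⟨p₁, hp₁⟩ := exists_utop3 hσ harc0.1 h1'' (hsub'' 1)
    have hp₁S : p₁ ∈ S3 w := hsub'' 1 hp₁.1
    have hne01 : p₀ ≠ p₁ := fun h => hn1'' (h ▸ hp₁.1)
    have htop : ∀ μ, OnArc σ w b μ → IsUniqueTop (dir σ μ) (w'' 0) p₀ ∧ IsUniqueTop (dir σ μ) (w'' 1) p₁ ∧
        wt (dir σ μ) p₀ ≠ wt (dir σ μ) p₁ := fun μ hμ =>
      ⟨by rw [h0'']; exact utop_onArc hσ harc0 hμ hu0 (hsub 0) h0, utop_onArc hσ harc0 hμ h1'' (hsub'' 1) hp₁,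
        wt_ne3 hσ hμ.1 hp₀S hp₁S hne01⟩
    have hdeg : ∀ s ∈ P''.support, s 2 < m + 1 := fun s hs =>
      lt_of_lt_of_le (deg2_lt_of_totalDegree P'' s hs) (Nat.add_le_add_right hP''.totalDegree_le 1)
    rw [← hev'']
    exact (tower3 hσ w b w'' hp₀S hp₁S hne01 htop (m + 1) P'' m hP'' hdeg).trans
      (Nat.mul_le_mul_left _ (Nat.add_le_add_left (card_Eset_omega_le σ w'' hw hsub'') 2))
  rw [← hev]
  by_cases h1 : w' 1 = 0
  · by_cases h2 : w' 2 = 0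
    · -- rank one: no edge normal on the arc at all
      have hempty : Ef σ w b (aeval w' P') = ∅ := by
        refine Finset.eq_empty_of_forall_notMem fun μ hμ => ?_
        obtain ⟨hedge, harc⟩ := (mem_Ef hσ).mp hμ
        rw [aeval_rank1 h1 h2 hP'] at hedge
        exact not_isEdgeDir_C_mul_pow (utop_onArc hσ harc0 harc hu0 (hsub 0) h0) _ m hedge
      rw [hempty]; simp
    · -- swap rows 1 and 2
      refine finish ![w' 0, w' 2, w' 1] (rename (Equiv.swap 1 2) P') hP'.rename_isHomogeneous ?_ rfl ?_ hn2 h2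
      · rw [aeval_rename]
        have hfun : ((![w' 0, w' 2, w' 1] : Fin 3 → Poly2) ∘ ⇑(Equiv.swap (1 : Fin 3) 2)) = w' := by
          funext i
          fin_cases i
          · simp [Equiv.swap_apply_of_ne_of_ne]
          · simp [Equiv.swap_apply_left]
          · simp [Equiv.swap_apply_right]
        rw [hfun]
      · intro i
        fin_cases i
        · exact hsub 0
        · exact hsub 2
        · exact hsub 1
  · exact finish w' P' hP' rfl rfl hsub hn1 h1

/-- PER CHART: `|Eset σ (P(w))| ≤ 9t² + (9t² + 1)(m+1)(2 + 729 t⁶)` -/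
theorem Eset_bound3 {σ : ℝ} (hσ : σ = 1 ∨ σ = -1) (w : Fin 3 → Poly2) {t : ℕ} (hw : ∀ i, (w i).support.card ≤ t)
    (P : Poly3) {m : ℕ} (hP : P.IsHomogeneous m) :
    (Eset σ (aeval w P)).card ≤ 9 * t ^ 2 + (9 * t ^ 2 + 1) * ((m + 1) * (2 + 729 * t ^ 6)) := by
  set D := aeval w P with hD
  set K := (m + 1) * (2 + 729 * t ^ 6) with hK
  have hsplit : Eset σ D ⊆ X3 σ w ∪ (Finset.range ((X3 σ w).card + 1)).biUnion (fun b => Ef σ w b D) := by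
    intro μ hμ
    by_cases hX : μ ∈ X3 σ w
    · exact Finset.mem_union_left _ hX
    · apply Finset.mem_union_right
      rw [Finset.mem_biUnion]
      exact ⟨idx3 σ w μ, Finset.mem_range.mpr (Nat.lt_succ_of_le (idx3_le σ w μ)),
        Finset.mem_filter.mpr ⟨hμ, hX, rfl⟩⟩
  have hX := card_X3_le σ hw
  calc (Eset σ D).card
      ≤ (X3 σ w ∪ (Finset.range ((X3 σ w).card + 1)).biUnion (fun b => Ef σ w b D)).card :=
        Finset.card_le_card hsplit
    _ ≤ (X3 σ w).card + ((Finset.range ((X3 σ w).card + 1)).biUnion (fun b => Ef σ w b D)).card :=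
        Finset.card_union_le _ _
    _ ≤ (X3 σ w).card + ∑ b ∈ Finset.range ((X3 σ w).card + 1), (Ef σ w b D).card :=
        Nat.add_le_add_left Finset.card_biUnion_le _
    _ ≤ (X3 σ w).card + ∑ _b ∈ Finset.range ((X3 σ w).card + 1), K :=
        Nat.add_le_add_left (Finset.sum_le_sum fun b _ => arc_bound3 hσ w hw P hP b) _
    _ = (X3 σ w).card + ((X3 σ w).card + 1) * K := by
        rw [Finset.sum_const, Finset.card_range, smul_eq_mul]
    _ ≤ 9 * t ^ 2 + (9 * t ^ 2 + 1) * K :=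
        Nat.add_le_add hX (Nat.mul_le_mul_right _ (Nat.add_le_add_right hX 1))

/-- THE CRUDE RANK-THREE VERTEX BOUND (kernel): for `t`-sparse generators `w₀, w₁, w₂` and ANY homogeneous `P` of
degree `m`, `nv(P(w)) ≤ 2·(9t² + (9t²+1)(m+1)(729t⁶+2)) + 4`. -/
theorem rankThree_nv_bound (w : Fin 3 → Poly2) {t : ℕ} (hw : ∀ i, (w i).support.card ≤ t) (P : Poly3) {m : ℕ}
    (hP : P.IsHomogeneous m) :
    nv (aeval w P) ≤ 2 * (9 * t ^ 2 + (9 * t ^ 2 + 1) * ((m + 1) * (2 + 729 * t ^ 6))) + 4 := by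
  have h1 := Eset_bound3 (σ := 1) (Or.inl rfl) w hw P hP
  have h2 := Eset_bound3 (σ := -1) (Or.inr rfl) w hw P hP
  have hn := nv_le (aeval w P)
  omega

theorem k3_arith (m t : ℕ) :
    2 * (9 * t ^ 2 + (9 * t ^ 2 + 1) * ((m + 1) * (2 + 729 * t ^ 6))) + 4 ≤ (m + 2) ^ 22 * (t + 2) ^ 22 := by
  set Z := 13122 * t ^ 8 + 1458 * t ^ 6 + 54 * t ^ 2 + 8 with hZ
  have hL : 2 * (9 * t ^ 2 + (9 * t ^ 2 + 1) * ((m + 1) * (2 + 729 * t ^ 6))) + 4 ≤ (m + 2) * Z := by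
    calc 2 * (9 * t ^ 2 + (9 * t ^ 2 + 1) * ((m + 1) * (2 + 729 * t ^ 6))) + 4
        ≤ (2 * (9 * t ^ 2 + (9 * t ^ 2 + 1) * ((m + 1) * (2 + 729 * t ^ 6))) + 4)
            + ((13122 * t ^ 8 + 1458 * t ^ 6 + 36 * t ^ 2 + 4) + (m + 1) * (18 * t ^ 2 + 4)) := Nat.le_add_right _ _
      _ = (m + 2) * Z := by rw [hZ]; ring
  have hZ8 : Z ≤ 14642 * (t + 2) ^ 8 := by
    have a1 : t ^ 8 ≤ (t + 2) ^ 8 := Nat.pow_le_pow_left (by omega) 8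
    have a2 : t ^ 6 ≤ (t + 2) ^ 8 :=
      (Nat.pow_le_pow_left (by omega : t ≤ t + 2) 6).trans (Nat.pow_le_pow_right (by omega) (by omega))
    have a3 : t ^ 2 ≤ (t + 2) ^ 8 :=
      (Nat.pow_le_pow_left (by omega : t ≤ t + 2) 2).trans (Nat.pow_le_pow_right (by omega) (by omega))
    have a4 : 1 ≤ (t + 2) ^ 8 := Nat.one_le_pow _ _ (by omega)
    rw [hZ]; linarith
  have h14 : 14642 ≤ (t + 2) ^ 14 :=
    calc 14642 ≤ 2 ^ 14 := by norm_num
      _ ≤ (t + 2) ^ 14 := Nat.pow_le_pow_left (by omega) 14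
  calc 2 * (9 * t ^ 2 + (9 * t ^ 2 + 1) * ((m + 1) * (2 + 729 * t ^ 6))) + 4 ≤ (m + 2) * Z := hL
    _ ≤ (m + 2) * (14642 * (t + 2) ^ 8) := Nat.mul_le_mul_left _ hZ8
    _ ≤ (m + 2) ^ 22 * ((t + 2) ^ 14 * (t + 2) ^ 8) :=
        Nat.mul_le_mul (Nat.le_self_pow (by norm_num) _) (Nat.mul_le_mul_right _ h14)
    _ = (m + 2) ^ 22 * (t + 2) ^ 22 := by ring

/-- **`PortPlan3.1` IN KERNEL, crude form ⇒ `RankThreeLinearLaw` holds with `c = 22`** (the memo's arc count gives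
`t³ + 9t²(4m+1)` = `RankThreeExplicitBound`, which stays PAPER; the exponent here is bookkeeping, not mathematics). -/
theorem rankThreeLinearLaw : RankThreeLinearLaw :=
  ⟨22, fun m t P w hP hw => (rankThree_nv_bound w hw P hP).trans (k3_arith m t)⟩

/-- **THE CLASS THEOREM IN KERNEL (rung 3-LIN of the K13 side ladder):** `∏ f − ∏ g` with all `2m` factors in the
LINEAR span of three `t`-sparse bivariate polynomials has `≤ (m+2)²² (t+2)²²` Newton-polygon vertices.
Nothing here closes 5906 / `PlanarCellBound`; VP ≠ VNP is NOT proved. -/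
theorem twoProductsLinRankThree : TwoProductsLinRankThree :=
  twoProductsLinRankThree_of_law rankThreeLinearLaw


end TowerKernel3


/-! ## Axiom audit (kernel theorems of this file use only the three standard axioms; no `sorryAx`) -/

/--
info: 'Summit.ValiantsHypothesis.ValiantsHypothesis.Cruxes.TwoProducts.ValIdea35g10.wronskianRule' depends on axioms: [propext,
 Classical.choice,
 Quot.sound]
-/
#guard_msgs in
#print axioms wronskianRule

/--
info: 'Summit.ValiantsHypothesis.ValiantsHypothesis.Cruxes.TwoProducts.ValIdea35g10.coeff_ell_top' depends on axioms: [propext,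
 Classical.choice,
 Quot.sound]
-/
#guard_msgs in
#print axioms coeff_ell_top

/--
info: 'Summit.ValiantsHypothesis.ValiantsHypothesis.Cruxes.TwoProducts.ValIdea35g10.wronskianTransfer' depends on axioms: [propext,
 Classical.choice,
 Quot.sound]
-/
#guard_msgs in
#print axioms wronskianTransfer

/--
info: 'Summit.ValiantsHypothesis.ValiantsHypothesis.Cruxes.TwoProducts.ValIdea35g10.dependentCase3' depends on axioms: [propext,
 Classical.choice,
 Quot.sound]
-/
#guard_msgs in
#print axioms dependentCase3

/--
info: 'Summit.ValiantsHypothesis.ValiantsHypothesis.Cruxes.TwoProducts.ValIdea35g10.twoProductsLinRankThree_of_law' depends on axioms: [propext,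
 Classical.choice,
 Quot.sound]
-/
#guard_msgs in
#print axioms twoProductsLinRankThree_of_law

/--
info: 'Summit.ValiantsHypothesis.ValiantsHypothesis.Cruxes.TwoProducts.ValIdea35g10.echelon3' depends on axioms: [propext,
 Classical.choice,
 Quot.sound]
-/
#guard_msgs in
#print axioms echelon3

/--
info: 'Summit.ValiantsHypothesis.ValiantsHypothesis.Cruxes.TwoProducts.ValIdea35g10.tower3' depends on axioms: [propext,
 Classical.choice,
 Quot.sound]
-/
#guard_msgs in
#print axioms tower3

/--
info: 'Summit.ValiantsHypothesis.ValiantsHypothesis.Cruxes.TwoProducts.ValIdea35g10.rankThreeLinearLaw' depends on axioms: [propext,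
 Classical.choice,
 Quot.sound]
-/
#guard_msgs in
#print axioms rankThreeLinearLaw

/--
info: 'Summit.ValiantsHypothesis.ValiantsHypothesis.Cruxes.TwoProducts.ValIdea35g10.twoProductsLinRankThree' depends on axioms: [propext,
 Classical.choice,
 Quot.sound]
-/
#guard_msgs in
#print axioms twoProductsLinRankThree

/-! ## ONSET OF RECORD, typed (rev 3; γ-ward item (ii) of crit-8 g4 VERDICT #44 / #47; memo §4): `RankThreeAffineLaw` (OPEN — the
next rung, NOT claimed), the class bridge `twoProductsAffRankThree_of_law`, and §4.2 IN KERNEL: band-separated layers are tame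
(`bandSeparated_nv_le`, `bandSeparatedLaw`, c = 23) — a corollary of `rankThreeLinearLaw`.  Everything above this line is rev 2, byte-for-byte. -/

section OnsetGamma
open scoped Classical

/-- **ONSET OF RECORD (OPEN; rung 3-AFF of the K13 side ladder; memo §4.1).** `Newt P̃(w₀,w₁,w₂)` has `poly(m,t)` vertices for an
ARBITRARY (non-homogeneous) `P̃` of total degree `≤ m` in three `t`-sparse carriers — equivalently homogeneous rank 4 with one carrier
a unit.  READING: `t` bounds the generators only; `P̃` has any number of monomials.  The homogeneous case is the kernel theorem
`rankThreeLinearLaw`; here Euler's identity is lost, `L_m D = Ω·∂₂P(w) + J(w₀,w₁)·∂_cP(w)` is a SUM of two products and the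
Wronskian transfer does not apply (memo §4.1).  This is NOT claimed; it is the typed target for the next rung. -/
def RankThreeAffineLaw : Prop :=
  ∃ c : ℕ, ∀ (m t : ℕ) (P : Poly3) (w : Fin 3 → Poly2),
    P.totalDegree ≤ m → (∀ i, (w i).support.card ≤ t) →
    nv (MvPolynomial.aeval w P) ≤ (m + 2) ^ c * (t + 2) ^ c

/-- The `TwoProducts` class at the onset: all `2m` rows in the AFFINE span `b + Σ aᵢ wᵢ` of three `t`-sparse generators
(= rows spanning a linear space `V` with `dim V ≤ 4` and `1 ∈ V`; the γ1 tables `1 + u_j`, KPTT's `fgh + 1`). -/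
def TwoProductsAffRankThree : Prop :=
  ∃ c : ℕ, ∀ (m t : ℕ) (f g : Fin m → Poly2) (w : Fin 3 → Poly2),
    (∀ j, ∃ (b : ℂ) (a : Fin 3 → ℂ), f j = C b + ∑ i, a i • w i) →
    (∀ j, ∃ (b : ℂ) (a : Fin 3 → ℂ), g j = C b + ∑ i, a i • w i) →
    (∀ i, (w i).support.card ≤ t) →
    nv (∏ j, f j - ∏ j, g j) ≤ (m + 2) ^ c * (t + 2) ^ c

/-- An affine form `C b + Σ C aᵢ Xᵢ` has total degree `≤ 1`. -/
theorem totalDegree_affForm_le (b : ℂ) (a : Fin 3 → ℂ) :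
    (C b + ∑ i : Fin 3, C (a i) * X i : Poly3).totalDegree ≤ 1 := by
  refine (totalDegree_add _ _).trans (max_le ?_ ?_)
  · rw [totalDegree_C]; exact Nat.zero_le _
  · refine totalDegree_finsetSum_le fun i _ => ?_
    rw [← smul_eq_C_mul]
    exact (totalDegree_smul_le _ _).trans (by rw [totalDegree_X])

theorem totalDegree_prodAff_le (m : ℕ) (b : Fin m → ℂ) (a : Fin m → Fin 3 → ℂ) :
    (∏ j : Fin m, (C (b j) + ∑ i : Fin 3, C (a j i) * X i) : Poly3).totalDegree ≤ m := by
  refine (totalDegree_finsetProd _ _).trans ?_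
  calc ∑ j : Fin m, (C (b j) + ∑ i : Fin 3, C (a j i) * X i : Poly3).totalDegree
      ≤ ∑ _j : Fin m, 1 := Finset.sum_le_sum fun j _ => totalDegree_affForm_le (b j) (a j)
    _ = m := by simp

theorem aeval_affForm (w : Fin 3 → Poly2) (b : ℂ) (a : Fin 3 → ℂ) :
    aeval w (C b + ∑ i : Fin 3, C (a i) * X i : Poly3) = C b + ∑ i, a i • w i := by
  rw [map_add, aeval_C, MvPolynomial.algebraMap_eq, aeval_linForm]

/-- CLASS BRIDGE at the onset: `RankThreeAffineLaw → TwoProductsAffRankThree` (`P̃ := ∏ⱼ(bⱼ + Σᵢ aⱼᵢXᵢ) − ∏ⱼ(b'ⱼ + Σᵢ a'ⱼᵢXᵢ)`,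
total degree `≤ m`, `P̃(w) = ∏ f − ∏ g`). -/
theorem twoProductsAffRankThree_of_law (h : RankThreeAffineLaw) : TwoProductsAffRankThree := by
  obtain ⟨c, hc⟩ := h
  refine ⟨c, fun m t f g w hf hg hw => ?_⟩
  choose b a ha using hf
  choose b' a' hb using hg
  have hP : ((∏ j : Fin m, (C (b j) + ∑ i : Fin 3, C (a j i) * X i))
      - ∏ j : Fin m, (C (b' j) + ∑ i : Fin 3, C (a' j i) * X i) : Poly3).totalDegree ≤ m :=
    (totalDegree_sub _ _).trans (max_le (totalDegree_prodAff_le m b a) (totalDegree_prodAff_le m b' a'))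
  have hev : aeval w ((∏ j : Fin m, (C (b j) + ∑ i : Fin 3, C (a j i) * X i))
      - ∏ j : Fin m, (C (b' j) + ∑ i : Fin 3, C (a' j i) * X i) : Poly3) = ∏ j, f j - ∏ j, g j := by
    rw [map_sub, map_prod, map_prod]
    simp_rw [aeval_affForm, ← ha, ← hb]
  rw [← hev]
  exact hc m t _ w hP hw

/-- The homogeneous law is the degree-pure case of the affine law's conclusion (bookkeeping: `rankThreeLinearLaw` restated on a
single homogeneous component). -/
theorem nv_layer_le (m t d : ℕ) (hd : d ≤ m) (P : Poly3) (w : Fin 3 → Poly2) (hw : ∀ i, (w i).support.card ≤ t) :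
    nv (aeval w (homogeneousComponent d P)) ≤ (m + 2) ^ 22 * (t + 2) ^ 22 := by
  have h := (rankThree_nv_bound w hw (homogeneousComponent d P) (homogeneousComponent_isHomogeneous d P)).trans (k3_arith d t)
  refine h.trans (Nat.mul_le_mul_right _ (Nat.pow_le_pow_left (by omega) _))

/-! ### §4.2 in kernel: band-separated layers are tame -/

/-- If `A` and `B` have disjoint supports, `supp A ⊆ supp (A + B)`. -/
theorem support_subset_support_add_of_disjoint {A B : Poly2} (h : Disjoint A.support B.support) :
    A.support ⊆ (A + B).support := by
  intro s hs
  rw [mem_support_iff] at hs ⊢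
  have hsB : s ∉ B.support := Finset.disjoint_left.mp h (mem_support_iff.mpr hs)
  rw [notMem_support_iff] at hsB
  rw [coeff_add, hsB, add_zero]
  exact hs

/-- Extreme points of the Newton polygon of `F` that come from exponents of `A ⊆ F` (support-wise) are extreme for `A`. -/
theorem extreme_of_support_subset {A F : Poly2} (hAF : A.support ⊆ F.support) {v : Fin 2 → ℝ}
    (hv : v ∈ Set.extremePoints ℝ (convexHull ℝ (emb '' (F.support : Set (Fin 2 →₀ ℕ)))))
    (hvA : v ∈ emb '' (A.support : Set (Fin 2 →₀ ℕ))) :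
    v ∈ Set.extremePoints ℝ (convexHull ℝ (emb '' (A.support : Set (Fin 2 →₀ ℕ)))) := by
  have hsub : convexHull ℝ (emb '' (A.support : Set (Fin 2 →₀ ℕ))) ⊆ convexHull ℝ (emb '' (F.support : Set (Fin 2 →₀ ℕ))) :=
    convexHull_mono (Set.image_mono (by exact_mod_cast hAF))
  exact inter_extremePoints_subset_extremePoints_of_subset hsub ⟨subset_convexHull ℝ _ hvA, hv⟩

/-- TWO LAYERS: disjoint supports ⇒ `nv (A + B) ≤ nv A + nv B` (no cancellation, every vertex of the sum is a vertex of a layer). -/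
theorem nv_add_le_of_disjoint (A B : Poly2) (h : Disjoint A.support B.support) : nv (A + B) ≤ nv A + nv B := by
  have hA := support_subset_support_add_of_disjoint h
  have hB : B.support ⊆ (A + B).support := by
    rw [add_comm]; exact support_subset_support_add_of_disjoint h.symm
  unfold nv
  set EA := Set.extremePoints ℝ (convexHull ℝ (emb '' (A.support : Set (Fin 2 →₀ ℕ)))) with hEA
  set EB := Set.extremePoints ℝ (convexHull ℝ (emb '' (B.support : Set (Fin 2 →₀ ℕ)))) with hEB
  have hcover : Set.extremePoints ℝ (convexHull ℝ (emb '' ((A + B).support : Set (Fin 2 →₀ ℕ)))) ⊆ EA ∪ EB := by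
    intro v hv
    have hvS : v ∈ emb '' ((A + B).support : Set (Fin 2 →₀ ℕ)) := extremePoints_convexHull_subset hv
    obtain ⟨s, hs, rfl⟩ := hvS
    have hs' : s ∈ (A + B).support := by exact_mod_cast hs
    rcases Finset.mem_union.mp (support_add hs') with hsA | hsB
    · exact Or.inl (extreme_of_support_subset hA hv ⟨s, by exact_mod_cast hsA, rfl⟩)
    · exact Or.inr (extreme_of_support_subset hB hv ⟨s, by exact_mod_cast hsB, rfl⟩)
  have hfinA : EA.Finite := ((A.support.finite_toSet).image emb).subset extremePoints_convexHull_subset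
  have hfinB : EB.Finite := ((B.support.finite_toSet).image emb).subset extremePoints_convexHull_subset
  exact (Set.ncard_le_ncard hcover (hfinA.union hfinB)).trans (Set.ncard_union_le _ _)

/-- LAYERED SUMS: pairwise disjoint supports ⇒ `nv (Σ_{d<n} G d) ≤ Σ_{d<n} nv (G d)`. -/
theorem nv_sum_le_of_pairwise_disjoint (G : ℕ → Poly2)
    (h : ∀ d d', d ≠ d' → Disjoint (G d).support (G d').support) :
    ∀ n : ℕ, nv (∑ d ∈ Finset.range n, G d) ≤ ∑ d ∈ Finset.range n, nv (G d) := by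
  intro n
  induction n with
  | zero => simp [nv_zero]
  | succ n ih =>
    rw [Finset.sum_range_succ, Finset.sum_range_succ]
    have hdis : Disjoint (∑ d ∈ Finset.range n, G d).support (G n).support := by
      refine Finset.disjoint_left.mpr fun s hs hsn => ?_
      obtain ⟨d, hd, hsd⟩ := Finset.mem_biUnion.mp (support_sum hs)
      have hne : d ≠ n := by
        have := Finset.mem_range.mp hd; omega
      exact Finset.disjoint_left.mp (h d n hne) hsd hsn
    exact (nv_add_le_of_disjoint _ _ hdis).trans (Nat.add_le_add_right ih _)

/-- The layers of `P̃(w)`: `D_d := P_d(w)`, `P_d` the degree-`d` homogeneous component (memo §4.2). -/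
def layer (w : Fin 3 → Poly2) (P : Poly3) (d : ℕ) : Poly2 := aeval w (homogeneousComponent d P)

/-- BAND-SEPARATED = the layers have pairwise disjoint supports (no inter-layer coincidence of monomials — on the digit grid
`A_s`: no carries between the bands `dS` and `d'S`). -/
def BandSeparated (w : Fin 3 → Poly2) (P : Poly3) : Prop :=
  ∀ d d', d ≠ d' → Disjoint (layer w P d).support (layer w P d').support

theorem aeval_eq_sum_layers (w : Fin 3 → Poly2) (P : Poly3) (m : ℕ) (hP : P.totalDegree ≤ m) :
    aeval w P = ∑ d ∈ Finset.range (m + 1), layer w P d := by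
  unfold layer
  rw [← map_sum]
  congr 1
  conv_lhs => rw [← sum_homogeneousComponent P]
  refine Finset.sum_subset (Finset.range_mono (Nat.succ_le_succ hP)) fun k _ hk' => ?_
  rw [Finset.mem_range, not_lt] at hk'
  exact homogeneousComponent_eq_zero _ _ (by omega)

/-- **§4.2 IN KERNEL — BAND-SEPARATED LAYERS ARE TAME.** For ANY `P̃` of total degree `≤ m` in three `t`-sparse carriers whose
layers `P_d(w)` have pairwise disjoint supports, `nv P̃(w) ≤ (m+1)·(m+2)²²·(t+2)²²`.  Consequence for the refute lens: every escape
table at the onset (rung 3-AFF) must have INTER-LAYER support collisions (carries); without them the γ1 tables are tame. -/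
theorem bandSeparated_nv_le (m t : ℕ) (P : Poly3) (w : Fin 3 → Poly2)
    (hP : P.totalDegree ≤ m) (hw : ∀ i, (w i).support.card ≤ t) (hsep : BandSeparated w P) :
    nv (aeval w P) ≤ (m + 1) * ((m + 2) ^ 22 * (t + 2) ^ 22) := by
  rw [aeval_eq_sum_layers w P m hP]
  refine (nv_sum_le_of_pairwise_disjoint (layer w P) hsep (m + 1)).trans ?_
  calc ∑ d ∈ Finset.range (m + 1), nv (layer w P d)
      ≤ ∑ _d ∈ Finset.range (m + 1), (m + 2) ^ 22 * (t + 2) ^ 22 :=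
        Finset.sum_le_sum fun d hd => nv_layer_le m t d (by have := Finset.mem_range.mp hd; omega) P w hw
    _ = (m + 1) * ((m + 2) ^ 22 * (t + 2) ^ 22) := by simp

/-- The band-separated sub-law in the `(m+2)^c (t+2)^c` currency (`c = 23`). -/
def BandSeparatedLaw : Prop :=
  ∃ c : ℕ, ∀ (m t : ℕ) (P : Poly3) (w : Fin 3 → Poly2),
    P.totalDegree ≤ m → (∀ i, (w i).support.card ≤ t) → BandSeparated w P →
    nv (MvPolynomial.aeval w P) ≤ (m + 2) ^ c * (t + 2) ^ c

theorem bandSeparatedLaw : BandSeparatedLaw := by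
  refine ⟨23, fun m t P w hP hw hsep => (bandSeparated_nv_le m t P w hP hw hsep).trans ?_⟩
  have h1 : m + 1 ≤ m + 2 := by omega
  have h2 : (t + 2) ^ 22 ≤ (t + 2) ^ 23 := Nat.pow_le_pow_right (by omega) (by omega)
  calc (m + 1) * ((m + 2) ^ 22 * (t + 2) ^ 22) ≤ (m + 2) * ((m + 2) ^ 22 * (t + 2) ^ 23) :=
        Nat.mul_le_mul h1 (Nat.mul_le_mul_left _ h2)
    _ = (m + 2) ^ 23 * (t + 2) ^ 23 := by ring

/-- The onset law trivially contains the band-separated sub-law and the homogeneous law (sanity of the typing: both kernel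
theorems are instances of what `RankThreeAffineLaw` asserts). -/
theorem rankThreeAffineLaw_implies (h : RankThreeAffineLaw) : BandSeparatedLaw ∧ RankThreeLinearLaw := by
  obtain ⟨c, hc⟩ := h
  exact ⟨⟨c, fun m t P w hP hw _ => hc m t P w hP hw⟩, ⟨c, fun m t P w hP hw => hc m t P w (hP.totalDegree_le) hw⟩⟩

/--
info: 'Summit.ValiantsHypothesis.ValiantsHypothesis.Cruxes.TwoProducts.ValIdea35g10.bandSeparatedLaw' depends on axioms: [propext,
 Classical.choice,
 Quot.sound]
-/
#guard_msgs in
#print axioms bandSeparatedLaw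

/--
info: 'Summit.ValiantsHypothesis.ValiantsHypothesis.Cruxes.TwoProducts.ValIdea35g10.twoProductsAffRankThree_of_law' depends on axioms: [propext,
 Classical.choice,
 Quot.sound]
-/
#guard_msgs in
#print axioms twoProductsAffRankThree_of_law


/-! #### Sharpenings (s1)/(s2) of crit-8 g4 VERDICT #51 (rev 4) and the KILL-PATH link to 5906's currency -/

/-- Vertex count of an arbitrary finite exponent set (so that covers by SETS, not only by polynomials, can be counted). -/
def vc (S : Finset (Fin 2 →₀ ℕ)) : ℕ :=
  (Set.extremePoints ℝ (convexHull ℝ (emb '' (S : Set (Fin 2 →₀ ℕ))))).ncard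

theorem nv_eq_vc (D : Poly2) : nv D = vc D.support := rfl

theorem vc_extreme_of_subset {A S : Finset (Fin 2 →₀ ℕ)} (hAS : A ⊆ S) {v : Fin 2 → ℝ}
    (hv : v ∈ Set.extremePoints ℝ (convexHull ℝ (emb '' (S : Set (Fin 2 →₀ ℕ)))))
    (hvA : v ∈ emb '' (A : Set (Fin 2 →₀ ℕ))) :
    v ∈ Set.extremePoints ℝ (convexHull ℝ (emb '' (A : Set (Fin 2 →₀ ℕ)))) := by
  have hsub : convexHull ℝ (emb '' (A : Set (Fin 2 →₀ ℕ))) ⊆ convexHull ℝ (emb '' (S : Set (Fin 2 →₀ ℕ))) :=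
    convexHull_mono (Set.image_mono (by exact_mod_cast hAS))
  exact inter_extremePoints_subset_extremePoints_of_subset hsub ⟨subset_convexHull ℝ _ hvA, hv⟩

theorem vc_finite (S : Finset (Fin 2 →₀ ℕ)) :
    (Set.extremePoints ℝ (convexHull ℝ (emb '' (S : Set (Fin 2 →₀ ℕ))))).Finite :=
  ((S.finite_toSet).image emb).subset extremePoints_convexHull_subset

/-- TWO-SET COVER: `S ⊆ A ∪ B` with `A, B ⊆ S` ⇒ `vc S ≤ vc A + vc B`. -/
theorem vc_le_add (S A B : Finset (Fin 2 →₀ ℕ)) (hcov : S ⊆ A ∪ B) (hA : A ⊆ S) (hB : B ⊆ S) :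
    vc S ≤ vc A + vc B := by
  unfold vc
  have hcover : Set.extremePoints ℝ (convexHull ℝ (emb '' (S : Set (Fin 2 →₀ ℕ)))) ⊆
      Set.extremePoints ℝ (convexHull ℝ (emb '' (A : Set (Fin 2 →₀ ℕ)))) ∪
        Set.extremePoints ℝ (convexHull ℝ (emb '' (B : Set (Fin 2 →₀ ℕ)))) := by
    intro v hv
    obtain ⟨s, hs, rfl⟩ := extremePoints_convexHull_subset hv
    have hs' : s ∈ S := by exact_mod_cast hs
    rcases Finset.mem_union.mp (hcov hs') with hsA | hsB
    · exact Or.inl (vc_extreme_of_subset hA hv ⟨s, by exact_mod_cast hsA, rfl⟩)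
    · exact Or.inr (vc_extreme_of_subset hB hv ⟨s, by exact_mod_cast hsB, rfl⟩)
  exact (Set.ncard_le_ncard hcover ((vc_finite A).union (vc_finite B))).trans (Set.ncard_union_le _ _)

/-- FINITE COVER: `S ⊆ ⋃_{d<n} T d` with every `T d ⊆ S` ⇒ `vc S ≤ Σ_{d<n} vc (T d)`. -/
theorem vc_le_sum (T : ℕ → Finset (Fin 2 →₀ ℕ)) :
    ∀ (n : ℕ) (S : Finset (Fin 2 →₀ ℕ)), S ⊆ (Finset.range n).biUnion T → (∀ d, d < n → T d ⊆ S) →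
      vc S ≤ ∑ d ∈ Finset.range n, vc (T d) := by
  intro n
  induction n with
  | zero =>
    intro S hcov _
    have hS : S = ∅ := Finset.subset_empty.mp (by simpa using hcov)
    subst hS
    simp [vc]
  | succ n ih =>
    intro S hcov hsub
    have hB : (Finset.range n).biUnion T ⊆ S :=
      Finset.biUnion_subset.mpr fun d hd => hsub d (by have := Finset.mem_range.mp hd; omega)
    have hTn : T n ⊆ S := hsub n (by omega)
    have hcov' : S ⊆ (Finset.range n).biUnion T ∪ T n := by
      intro s hs
      have := hcov hs
      rw [Finset.range_add_one, Finset.biUnion_insert, Finset.union_comm] at this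
      exact this
    have h1 := vc_le_add S _ _ hcov' hB hTn
    have h2 := ih ((Finset.range n).biUnion T) (subset_refl _)
      (fun d hd => Finset.subset_biUnion_of_mem T (Finset.mem_range.mpr hd))
    rw [Finset.sum_range_succ]
    omega

/-- (s1) NO INTER-LAYER ANNIHILATION: every monomial of every homogeneous layer `P_d(w)` survives in `P̃(w)` (shared monomials that do
not cancel to zero are harmless).  Weaker than `BandSeparated`; it is exactly what the proof of §4.2 consumes. -/
def NoAnnihilation (w : Fin 3 → Poly2) (P : Poly3) : Prop :=
  ∀ d, (layer w P d).support ⊆ (aeval w P).support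

/-- **(s1) IN KERNEL.** No inter-layer annihilation ⇒ `nv P̃(w) ≤ (m+1)·(m+2)²²·(t+2)²²`.  Residue of record for the refute lens,
sharpened: an escape table at rung 3-AFF must have a monomial of some homogeneous layer `P_d(w)` KILLED EXACTLY by the other layers
(on `A_s`: a carry that annihilates, not merely meets). -/
theorem noAnnihilation_nv_le (m t : ℕ) (P : Poly3) (w : Fin 3 → Poly2)
    (hP : P.totalDegree ≤ m) (hw : ∀ i, (w i).support.card ≤ t) (hna : NoAnnihilation w P) :
    nv (aeval w P) ≤ (m + 1) * ((m + 2) ^ 22 * (t + 2) ^ 22) := by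
  have hcov : (aeval w P).support ⊆ (Finset.range (m + 1)).biUnion (fun d => (layer w P d).support) := by
    rw [aeval_eq_sum_layers w P m hP]
    exact support_sum
  rw [nv_eq_vc]
  refine (vc_le_sum (fun d => (layer w P d).support) (m + 1) _ hcov (fun d _ => hna d)).trans ?_
  calc ∑ d ∈ Finset.range (m + 1), vc (layer w P d).support
      = ∑ d ∈ Finset.range (m + 1), nv (layer w P d) := by simp_rw [nv_eq_vc]
    _ ≤ ∑ _d ∈ Finset.range (m + 1), (m + 2) ^ 22 * (t + 2) ^ 22 :=
        Finset.sum_le_sum fun d hd => nv_layer_le m t d (by have := Finset.mem_range.mp hd; omega) P w hw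
    _ = (m + 1) * ((m + 2) ^ 22 * (t + 2) ^ 22) := by simp

/-- `BandSeparated` is the special case of `NoAnnihilation` with no shared monomials at all. -/
theorem noAnnihilation_of_bandSeparated (m : ℕ) (P : Poly3) (w : Fin 3 → Poly2) (hP : P.totalDegree ≤ m)
    (hsep : BandSeparated w P) : NoAnnihilation w P := by
  intro d s hs
  rw [aeval_eq_sum_layers w P m hP, mem_support_iff, coeff_sum]
  by_cases hd : d ∈ Finset.range (m + 1)
  · rw [Finset.sum_eq_single_of_mem d hd]
    · exact mem_support_iff.mp hs
    · intro d' _ hne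
      have hdis := hsep d d' (Ne.symm hne)
      exact notMem_support_iff.mp (Finset.disjoint_left.mp hdis hs)
  · exfalso
    have hgt : P.totalDegree < d := by
      rw [Finset.mem_range, not_lt] at hd; omega
    have h0 : layer w P d = 0 := by
      unfold layer; rw [homogeneousComponent_eq_zero _ _ hgt, map_zero]
    rw [h0] at hs
    simp at hs

/-- (s2) THE γ-RELEVANT TWIN in 5906's currency `2^{a m}·(t+2)^b` (OPEN).  A future refutation of the POLYNOMIAL-currency
`RankThreeAffineLaw` by a `2^{O(m)}`-respecting family would NOT touch `TwoProducts`; a refutation of THIS twin through the class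
(`TwoProductsAffRankThreeExp` below) REFUTES `TwoProducts` (`twoProducts_implies_affExp`). -/
def RankThreeAffineLawExp : Prop :=
  ∃ a b : ℕ, ∀ (m t : ℕ) (P : Poly3) (w : Fin 3 → Poly2),
    P.totalDegree ≤ m → (∀ i, (w i).support.card ≤ t) →
    nv (MvPolynomial.aeval w P) ≤ 2 ^ (a * m) * (t + 2) ^ b

/-- The class at the onset in 5906's currency. -/
def TwoProductsAffRankThreeExp : Prop :=
  ∃ a b : ℕ, ∀ (m t : ℕ) (f g : Fin m → Poly2) (w : Fin 3 → Poly2),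
    (∀ j, ∃ (b : ℂ) (a : Fin 3 → ℂ), f j = C b + ∑ i, a i • w i) →
    (∀ j, ∃ (b : ℂ) (a : Fin 3 → ℂ), g j = C b + ∑ i, a i • w i) →
    (∀ i, (w i).support.card ≤ t) →
    nv (∏ j, f j - ∏ j, g j) ≤ 2 ^ (a * m) * (t + 2) ^ b

/-- `(m+2)^c (t+2)^c ≤ 2^{c m} (t+2)^{2c}` — the polynomial currency is the stronger one. -/
theorem poly_le_exp_currency (c m t : ℕ) : (m + 2) ^ c * (t + 2) ^ c ≤ 2 ^ (c * m) * (t + 2) ^ (2 * c) := by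
  have h1 : m + 2 ≤ 2 ^ (m + 1) := by
    have := Nat.lt_two_pow_self (n := m + 1)
    omega
  have h2 : (m + 2) ^ c ≤ 2 ^ (c * m) * 2 ^ c := by
    calc (m + 2) ^ c ≤ (2 ^ (m + 1)) ^ c := Nat.pow_le_pow_left h1 c
      _ = 2 ^ (c * m) * 2 ^ c := by rw [← pow_mul, ← pow_add]; ring_nf
  have h3 : 2 ^ c ≤ (t + 2) ^ c := Nat.pow_le_pow_left (by omega) c
  calc (m + 2) ^ c * (t + 2) ^ c ≤ (2 ^ (c * m) * 2 ^ c) * (t + 2) ^ c := Nat.mul_le_mul_right _ h2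
    _ ≤ (2 ^ (c * m) * (t + 2) ^ c) * (t + 2) ^ c := Nat.mul_le_mul_right _ (Nat.mul_le_mul_left _ h3)
    _ = 2 ^ (c * m) * (t + 2) ^ (2 * c) := by ring

theorem rankThreeAffineLawExp_of_law (h : RankThreeAffineLaw) : RankThreeAffineLawExp := by
  obtain ⟨c, hc⟩ := h
  exact ⟨c, 2 * c, fun m t P w hP hw => (hc m t P w hP hw).trans (poly_le_exp_currency c m t)⟩

theorem twoProductsAffRankThreeExp_of_aff (h : TwoProductsAffRankThree) : TwoProductsAffRankThreeExp := by
  obtain ⟨c, hc⟩ := h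
  exact ⟨c, 2 * c, fun m t f g w hf hg hw => (hc m t f g w hf hg hw).trans (poly_le_exp_currency c m t)⟩

/-- CLASS BRIDGE in 5906's currency (same `P̃` as `twoProductsAffRankThree_of_law`). -/
theorem twoProductsAffRankThreeExp_of_lawExp (h : RankThreeAffineLawExp) : TwoProductsAffRankThreeExp := by
  obtain ⟨a₀, b₀, hc⟩ := h
  refine ⟨a₀, b₀, fun m t f g w hf hg hw => ?_⟩
  choose b a ha using hf
  choose b' a' hb using hg
  have hP : ((∏ j : Fin m, (C (b j) + ∑ i : Fin 3, C (a j i) * X i))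
      - ∏ j : Fin m, (C (b' j) + ∑ i : Fin 3, C (a' j i) * X i) : Poly3).totalDegree ≤ m :=
    (totalDegree_sub _ _).trans (max_le (totalDegree_prodAff_le m b a) (totalDegree_prodAff_le m b' a'))
  have hev : aeval w ((∏ j : Fin m, (C (b j) + ∑ i : Fin 3, C (a j i) * X i))
      - ∏ j : Fin m, (C (b' j) + ∑ i : Fin 3, C (a' j i) * X i) : Poly3) = ∏ j, f j - ∏ j, g j := by
    rw [map_sub, map_prod, map_prod]
    simp_rw [aeval_affForm, ← ha, ← hb]
  rw [← hev]
  exact hc m t _ w hP hw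

/-- A row `C b + Σ aᵢ • wᵢ` over three `t`-sparse generators has `≤ 3t + 1` monomials. -/
theorem card_support_affRow_le (t : ℕ) (w : Fin 3 → Poly2) (hw : ∀ i, (w i).support.card ≤ t) (b : ℂ) (a : Fin 3 → ℂ) :
    (C b + ∑ i, a i • w i : Poly2).support.card ≤ 3 * t + 1 := by
  have hC : (C b : Poly2).support.card ≤ 1 := by
    rw [C_apply]
    exact (Finset.card_le_card support_monomial_subset).trans (by simp)
  have hS : (∑ i : Fin 3, a i • w i : Poly2).support.card ≤ 3 * t := by
    refine (Finset.card_le_card support_sum).trans ((Finset.card_biUnion_le).trans ?_)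
    calc ∑ i : Fin 3, (a i • w i).support.card ≤ ∑ i : Fin 3, t :=
          Finset.sum_le_sum fun i _ => (Finset.card_le_card support_smul).trans (hw i)
      _ = 3 * t := by simp [mul_comm]
  calc (C b + ∑ i, a i • w i : Poly2).support.card ≤ ((C b : Poly2).support ∪ (∑ i : Fin 3, a i • w i : Poly2).support).card :=
        Finset.card_le_card support_add
    _ ≤ (C b : Poly2).support.card + (∑ i : Fin 3, a i • w i : Poly2).support.card := Finset.card_union_le _ _
    _ ≤ 3 * t + 1 := by omega

/-- **KILL-PATH LINK (refute lens bookkeeping).** `TwoProducts` (5906, verbatim) implies the onset class law in its own currency: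
rows in the affine span of three `t`-sparse generators are `(3t+1)`-sparse rows, and `(3t+3)^b ≤ (t+2)^{2b}`.  Contrapositive: a
refutation of `TwoProductsAffRankThreeExp` (e.g. a γ1 / `fgh + 1`-type family with more than `2^{O(m)}·poly(t)` vertices) REFUTES 5906. -/
theorem twoProducts_implies_affExp (h : Summit.ValiantsHypothesis.ValiantsHypothesis.Theses.NewtonUnitEquations.TwoProducts) :
    TwoProductsAffRankThreeExp := by
  obtain ⟨a₀, b₀, hab⟩ := h
  refine ⟨a₀, 2 * b₀, fun m t f g w hf hg hw => ?_⟩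
  have hf' : ∀ j, (f j).support.card ≤ 3 * t + 1 := by
    intro j; obtain ⟨b, a, hj⟩ := hf j; rw [hj]; exact card_support_affRow_le t w hw b a
  have hg' : ∀ j, (g j).support.card ≤ 3 * t + 1 := by
    intro j; obtain ⟨b, a, hj⟩ := hg j; rw [hj]; exact card_support_affRow_le t w hw b a
  have hmain : nv (∏ j, f j - ∏ j, g j) ≤ 2 ^ (a₀ * m) * (3 * t + 1 + 2) ^ b₀ := hab m (3 * t + 1) f g hf' hg'
  refine hmain.trans (Nat.mul_le_mul_left _ ?_)
  have h1 : 3 * t + 1 + 2 ≤ (t + 2) ^ 2 := by nlinarith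
  calc (3 * t + 1 + 2) ^ b₀ ≤ ((t + 2) ^ 2) ^ b₀ := Nat.pow_le_pow_left h1 b₀
    _ = (t + 2) ^ (2 * b₀) := by rw [← pow_mul]

/--
info: 'Summit.ValiantsHypothesis.ValiantsHypothesis.Cruxes.TwoProducts.ValIdea35g10.noAnnihilation_nv_le' depends on axioms: [propext,
 Classical.choice,
 Quot.sound]
-/
#guard_msgs in
#print axioms noAnnihilation_nv_le

/--
info: 'Summit.ValiantsHypothesis.ValiantsHypothesis.Cruxes.TwoProducts.ValIdea35g10.twoProducts_implies_affExp' depends on axioms: [propext,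
 Classical.choice,
 Quot.sound]
-/
#guard_msgs in
#print axioms twoProducts_implies_affExp

end OnsetGamma

/-! ## g11 (val-idea-35 g11) — THE UNIT / FIBRE TOWER AT RUNG 3-AFF: LEVEL-1 KERNEL PIECES (REV 5)

Rev-4 prefix (lines 1–2465, through `end OnsetGamma`) is byte-identical.  This section types the algebraic core of the g11 memo
`Cruxes/TwoProducts/EXPT-unit-tower-g11.md`:

* **U1 hull cover** (`nv_le_sum_of_hull_cover`): if `D = Σ_q T_q` and every `Newt(T_q) ⊆ Newt(D)`, then `nv D ≤ Σ_q nv T_q`.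
* **U2 the class `NoHullLoss ⊋ NoAnnihilation`** (`noHullLoss_of_noAnnihilation`, `noHullLoss_nv_le`, `noHullLossLaw`, c = 23): only
  layer CORNERS outside `Newt D` matter; interior annihilation is harmless.  Separating instance (memo §3.3): `P = X₀X₁ − X₂`,
  `w = (x, y, xy + x² + y²)` — `NoHullLoss` holds, `NoAnnihilation` fails at `(1,1)`.
* **U3 localisation** (`isUniqueTop_part_of_sum`): at a direction where no part ties, the top of the sum is the unique top of a part.
* **U4 unique-top algebra** (`IsUniqueTop.mul/.pow/.C_mul`, `isUniqueTop_sum`, `exists_isUniqueTop_of_not_isEdgeDir`) — workfile-currency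
  twins of port-4 g4's `isUniqueTop_mul/_pow/_C_mul` (Theorems ns `…RankTwoJacobian`), needed here as the substrate of U5.
* **U5 the DEAD-FIBRE INITIAL TERM** (`homEval`, `homEval_mul_X_sub_C(_pow)`, `isUniqueTop_homEval`, ★ `deadFibre_uniqueTop`): for
  `F, G` with the same unique `ν`-top `V`, `λ := F_V/G_V`, `N := F − λ·G` of unique top `E`, and any `φ ≠ 0` of degree `≤ J`:
  `homEval φ J F G = N^k · homEval (φ /ₘ (X−λ)^k) (J−k) F G` with `k = rootMultiplicity λ φ`, and its unique `ν`-top is `k•E + (J−k)•V`.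
  On an arc with pivot relation `c⁰ = c⁺ − c⁻` a fibre part satisfies `T_q · G^J = w'^{γ₀} · homEval φ_q J F G` (`F = w'^{c⁺}`, `G = w'^{c⁻}`),
  so `in_ν(T_q) = c · x^{q + k_q·e(ν)}`, `e(ν) := E − V` (memo §2; exact check `loc/unit_check.py`: 15 433 fibre parts, 815 dead, 0 mismatches).
* **U5′ tie transfer** (`uniqueTop_of_mul_eq`, `isEdgeDir_binomial_of_isEdgeDir_part`): a tie of a fibre part inside the arc is a tie of the
  ONE auxiliary binomial `N_A = w'^{c⁺} − λ·w'^{c⁻}` — a T1-A object (`w₀^a w₁^b − κ w₂^d`, degrees ≤ 2m), which the g9 Jacobian tower bounds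
  uniformly (memo §4: `w₀·w₁·jac(N,w₂) = F·Br`, ✓ `axialTransfer`).

HONEST FRAME.  These are LEMMAS of the level-1 law; the assembly (arcs × fibres × candidate tops) is on paper in the memo.  Nothing here
closes `RankThreeAffineLaw(Exp)`, `TwoProducts` (5906), PCB or `ResidualLawV25`; VP ≠ VNP is NOT proved. -/

section UnitTowerG11

/-! ### U1. HULL COVER: vertices of a sum whose parts stay inside its Newton polygon -/

/-- the Newton polygon (as a subset of `ℝ²`) of a finite exponent set -/
def hull (S : Finset Expo) : Set (Fin 2 → ℝ) := convexHull ℝ (emb '' (S : Set Expo))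

/-- vertex set of the Newton polygon of a finite exponent set -/
def vset (S : Finset Expo) : Set (Fin 2 → ℝ) := Set.extremePoints ℝ (hull S)

theorem vc_eq_ncard_vset (S : Finset Expo) : vc S = (vset S).ncard := rfl

theorem vset_finite (S : Finset Expo) : (vset S).Finite := vc_finite S

/-- a vertex of the big polygon lying in the point set of a part whose polygon is inside the big one is a vertex of the part -/
theorem mem_vset_of_hull_subset {S T : Finset Expo} (hTS : hull T ⊆ hull S) {v : Fin 2 → ℝ}
    (hv : v ∈ vset S) (hvT : v ∈ emb '' (T : Set Expo)) : v ∈ vset T :=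
  inter_extremePoints_subset_extremePoints_of_subset hTS ⟨subset_convexHull ℝ _ hvT, hv⟩

theorem hull_subset_of_subset_hull {S T : Finset Expo} (h : emb '' (T : Set Expo) ⊆ hull S) : hull T ⊆ hull S :=
  convexHull_min h (convex_convexHull ℝ _)

theorem ncard_biUnion_range_le (A : ℕ → Set (Fin 2 → ℝ)) (hA : ∀ q, (A q).Finite) :
    ∀ n, (⋃ q ∈ Finset.range n, A q).Finite ∧ (⋃ q ∈ Finset.range n, A q).ncard ≤ ∑ q ∈ Finset.range n, (A q).ncard := by
  intro n
  induction n with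
  | zero => simp
  | succ n ih =>
    rw [Finset.range_add_one, Finset.set_biUnion_insert, Finset.sum_insert Finset.notMem_range_self]
    exact ⟨(hA n).union ih.1, (Set.ncard_union_le _ _).trans (Nat.add_le_add_left ih.2 _)⟩

/-- **U1 (HULL COVER).**  If `D = Σ_{q<n} T q` and every part's support lies inside `Newt D`, then every vertex of `Newt D` is a
vertex of some `Newt (T q)`; hence `nv D ≤ Σ_{q<n} nv (T q)`.  (g10's `vc_le_sum` is the special case `supp (T q) ⊆ supp D`;
here interior monomials of the parts MAY be annihilated.) -/
theorem nv_le_sum_of_hull_cover (n : ℕ) (T : ℕ → Poly2) (D : Poly2) (hD : D = ∑ q ∈ Finset.range n, T q)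
    (hh : ∀ q, q < n → emb '' ((T q).support : Set Expo) ⊆ hull D.support) :
    nv D ≤ ∑ q ∈ Finset.range n, nv (T q) := by
  classical
  have hcov : vset D.support ⊆ ⋃ q ∈ Finset.range n, vset (T q).support := by
    intro v hv
    obtain ⟨s, hs, rfl⟩ := extremePoints_convexHull_subset hv
    have hs' : s ∈ D.support := by exact_mod_cast hs
    have hc : coeff s D ≠ 0 := mem_support_iff.mp hs'
    rw [hD, coeff_sum] at hc
    obtain ⟨q, hq, hcq⟩ := Finset.exists_ne_zero_of_sum_ne_zero hc
    have hsq : s ∈ (T q).support := mem_support_iff.mpr hcq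
    refine Set.mem_biUnion hq ?_
    exact mem_vset_of_hull_subset (hull_subset_of_subset_hull (hh q (Finset.mem_range.mp hq))) hv
      ⟨s, by exact_mod_cast hsq, rfl⟩
  obtain ⟨hfin, hle⟩ := ncard_biUnion_range_le (fun q => vset (T q).support) (fun q => vset_finite _) n
  calc nv D = (vset D.support).ncard := rfl
    _ ≤ (⋃ q ∈ Finset.range n, vset (T q).support).ncard := Set.ncard_le_ncard hcov hfin
    _ ≤ ∑ q ∈ Finset.range n, (vset (T q).support).ncard := hle
    _ = ∑ q ∈ Finset.range n, nv (T q) := rfl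

/-! ### U2. NO HULL LOSS (strictly weaker than `NoAnnihilation`, same bound) -/

/-- (s1′) NO HULL LOSS: every homogeneous layer `P_d(w)` stays inside `Newt P̃(w)` — its monomials may be annihilated by the other
layers, but not its CORNERS beyond the polygon of the composite. -/
def NoHullLoss (w : Fin 3 → Poly2) (P : Poly3) : Prop :=
  ∀ d, emb '' ((layer w P d).support : Set Expo) ⊆ hull (aeval w P).support

/-- containment BY NAME: `NoAnnihilation ⇒ NoHullLoss` -/
theorem noHullLoss_of_noAnnihilation (w : Fin 3 → Poly2) (P : Poly3) (h : NoAnnihilation w P) : NoHullLoss w P := by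
  intro d v hv
  obtain ⟨s, hs, rfl⟩ := hv
  exact subset_convexHull ℝ _ ⟨s, by exact_mod_cast h d (by exact_mod_cast hs), rfl⟩

/-- **U2.** No hull loss ⇒ `nv P̃(w) ≤ Σ_d nv P_d(w)`; with a per-layer bound `B` (in the g10 file: `nv_layer_le`,
`B = (m+2)²²(t+2)²²`) this is `(m+1)·B`. -/
theorem noHullLoss_nv_le_of_layer_bound (m : ℕ) (P : Poly3) (w : Fin 3 → Poly2) (hP : P.totalDegree ≤ m)
    (B : ℕ) (hB : ∀ d, d ≤ m → nv (layer w P d) ≤ B) (h : NoHullLoss w P) :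
    nv (aeval w P) ≤ (m + 1) * B := by
  have h1 := nv_le_sum_of_hull_cover (m + 1) (fun d => layer w P d) (aeval w P) (aeval_eq_sum_layers w P m hP)
    (fun d _ => h d)
  refine h1.trans ?_
  calc ∑ q ∈ Finset.range (m + 1), nv (layer w P q) ≤ ∑ _q ∈ Finset.range (m + 1), B :=
        Finset.sum_le_sum fun d hd => hB d (by have := Finset.mem_range.mp hd; omega)
    _ = (m + 1) * B := by simp

/-! ### U3. LOCALISED COVER: a unique top of the sum is a top monomial of a part (no fibre cancellation at `ν`) -/

/-- If `v` is the unique `ν`-top of `D = Σ T q` and no part has a monomial `ν`-heavier than `v` (NO FIBRE CANCELLATION AT `ν`),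
then `v` is a `ν`-top monomial of some part. -/
theorem top_mem_part_of_sum (n : ℕ) (T : ℕ → Poly2) (D : Poly2) (hD : D = ∑ q ∈ Finset.range n, T q)
    (ν : Fin 2 → ℝ) (v : Expo) (hv : v ∈ D.support)
    (hle : ∀ q, q < n → ∀ s ∈ (T q).support, wt ν s ≤ wt ν v) :
    ∃ q, q < n ∧ v ∈ (T q).support ∧ ∀ s ∈ (T q).support, wt ν s ≤ wt ν v := by
  classical
  have hc : coeff v D ≠ 0 := mem_support_iff.mp hv
  rw [hD, coeff_sum] at hc
  obtain ⟨q, hq, hcq⟩ := Finset.exists_ne_zero_of_sum_ne_zero hc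
  exact ⟨q, Finset.mem_range.mp hq, mem_support_iff.mpr hcq, hle q (Finset.mem_range.mp hq)⟩

/-- … and if, moreover, that part has no tie at `ν`, `v` is its UNIQUE `ν`-top. -/
theorem isUniqueTop_part_of_sum (n : ℕ) (T : ℕ → Poly2) (D : Poly2) (hD : D = ∑ q ∈ Finset.range n, T q)
    (ν : Fin 2 → ℝ) (v : Expo) (hv : v ∈ D.support)
    (hle : ∀ q, q < n → ∀ s ∈ (T q).support, wt ν s ≤ wt ν v) (hnt : ∀ q, q < n → ¬ IsEdgeDir ν (T q)) :
    ∃ q, q < n ∧ IsUniqueTop ν (T q) v := by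
  obtain ⟨q, hq, hvq, htop⟩ := top_mem_part_of_sum n T D hD ν v hv hle
  refine ⟨q, hq, hvq, fun s hs hsv => lt_of_le_of_ne (htop s hs) fun heq => hnt q hq ?_⟩
  exact ⟨v, hvq, s, hs, Ne.symm hsv, htop, heq⟩

/-! ### U4. UNIQUE TOPS MULTIPLY (the constructive half of Ostrowski, with coefficients) -/

theorem wt_nsmul (ν : Fin 2 → ℝ) (k : ℕ) (e : Expo) : wt ν (k • e) = (k : ℝ) * wt ν e := by
  simp only [wt, Finsupp.smul_apply, smul_eq_mul, Nat.cast_mul]; ring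

theorem IsUniqueTop.coeff_ne_zero {ν : Fin 2 → ℝ} {F : Poly2} {p : Expo} (h : IsUniqueTop ν F p) : coeff p F ≠ 0 :=
  mem_support_iff.mp h.1

theorem IsUniqueTop.ne_zero {ν : Fin 2 → ℝ} {F : Poly2} {p : Expo} (h : IsUniqueTop ν F p) : F ≠ 0 := by
  intro hF; have := h.1; rw [hF] at this; simp at this

theorem IsUniqueTop.unique {ν : Fin 2 → ℝ} {F : Poly2} {p p' : Expo} (h : IsUniqueTop ν F p) (h' : IsUniqueTop ν F p') :
    p = p' := by
  by_contra hne
  have h1 := h.2 p' h'.1 (Ne.symm hne)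
  have h2 := h'.2 p h.1 hne
  linarith

theorem IsUniqueTop.not_isEdgeDir {ν : Fin 2 → ℝ} {F : Poly2} {p : Expo} (h : IsUniqueTop ν F p) : ¬ IsEdgeDir ν F := by
  rintro ⟨a, ha, b, hb, hab, hamax, hba⟩
  have ha' : a = p := by
    by_contra hh; have := h.2 a ha hh; have := hamax p h.1; linarith
  have hb' : b = p := by
    by_contra hh; have := h.2 b hb hh; have := hamax p h.1; linarith
  exact hab (ha'.trans hb'.symm)

/-- a nonzero polynomial without a tie at `ν` has a unique `ν`-top -/
theorem exists_isUniqueTop_of_not_isEdgeDir {ν : Fin 2 → ℝ} {F : Poly2} (hF : F ≠ 0) (h : ¬ IsEdgeDir ν F) :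
    ∃ p, IsUniqueTop ν F p := by
  obtain ⟨p, hp, hmax⟩ := Finset.exists_max_image F.support (wt ν) (support_nonempty' hF)
  refine ⟨p, hp, fun s hs hsp => lt_of_le_of_ne (hmax s hs) fun heq => h ⟨p, hp, s, hs, Ne.symm hsp, hmax, heq⟩⟩

theorem IsUniqueTop.decomp {ν : Fin 2 → ℝ} {F G : Poly2} {p q : Expo} (hF : IsUniqueTop ν F p) (hG : IsUniqueTop ν G q) :
    ∀ a ∈ F.support, ∀ b ∈ G.support, a + b = p + q → a = p ∧ b = q := by
  intro a ha b hb hab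
  have hw : wt ν a + wt ν b = wt ν p + wt ν q := by rw [← wt_add, hab, wt_add]
  have hap : a = p := by
    by_contra hne
    have h1 := hF.2 a ha hne
    have h2 := hG.le b hb
    linarith
  refine ⟨hap, ?_⟩
  rw [hap] at hab
  exact add_left_cancel hab

/-- **unique tops multiply**, with the coefficient -/
theorem IsUniqueTop.mul {ν : Fin 2 → ℝ} {F G : Poly2} {p q : Expo} (hF : IsUniqueTop ν F p) (hG : IsUniqueTop ν G q) :
    IsUniqueTop ν (F * G) (p + q) ∧ coeff (p + q) (F * G) = coeff p F * coeff q G := by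
  have hc : coeff (p + q) (F * G) = coeff p F * coeff q G := coeff_mul_of_unique F G p q (hF.decomp hG)
  refine ⟨⟨mem_support_iff.mpr (by rw [hc]; exact mul_ne_zero hF.coeff_ne_zero hG.coeff_ne_zero), ?_⟩, hc⟩
  intro s hs hne
  obtain ⟨a, ha, b, hb, rfl⟩ := Finset.mem_add.mp (MvPolynomial.support_mul F G hs)
  rw [wt_add, wt_add]
  rcases eq_or_ne a p with rfl | hap
  · have hbq : b ≠ q := fun h => hne (by rw [h])
    linarith [hG.2 b hb hbq]
  · linarith [hF.2 a ha hap, hG.le b hb]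

theorem IsUniqueTop.pow {ν : Fin 2 → ℝ} {F : Poly2} {p : Expo} (hF : IsUniqueTop ν F p) :
    ∀ k : ℕ, IsUniqueTop ν (F ^ k) (k • p) ∧ coeff (k • p) (F ^ k) = coeff p F ^ k := by
  intro k
  induction k with
  | zero =>
    refine ⟨⟨by simp, ?_⟩, by simp⟩
    intro s hs hne
    exfalso; apply hne
    rw [pow_zero] at hs
    rw [zero_nsmul]
    have h1 : s ∈ ({0} : Finset Expo) := by rwa [support_one] at hs
    simpa using h1
  | succ k ih =>
    obtain ⟨h1, h2⟩ := ih.1.mul hF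
    refine ⟨by rw [pow_succ, succ_nsmul]; exact h1, ?_⟩
    rw [pow_succ, succ_nsmul, h2, ih.2, pow_succ]

theorem IsUniqueTop.C_mul {ν : Fin 2 → ℝ} {F : Poly2} {p : Expo} (hF : IsUniqueTop ν F p) {c : ℂ} (hc : c ≠ 0) :
    IsUniqueTop ν (C c * F) p := by
  have hsupp : ∀ s, s ∈ (C c * F).support ↔ s ∈ F.support := by
    intro s; simp only [mem_support_iff, coeff_C_mul, ne_eq, mul_eq_zero, hc, false_or]
  exact ⟨(hsupp p).mpr hF.1, fun s hs hne => hF.2 s ((hsupp s).mp hs) hne⟩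

/-- tops of a sum: all parts have tops of weight `≤ W` at a common exponent `e` of weight `W`, every other monomial strictly lighter,
and the top coefficients do not cancel ⇒ `e` is the unique top of the sum. -/
theorem isUniqueTop_sum {ν : Fin 2 → ℝ} (n : ℕ) (S : ℕ → Poly2) (e : Expo)
    (hlt : ∀ j, j < n → ∀ s ∈ (S j).support, s ≠ e → wt ν s < wt ν e)
    (hc : ∑ j ∈ Finset.range n, coeff e (S j) ≠ 0) :
    IsUniqueTop ν (∑ j ∈ Finset.range n, S j) e := by
  classical
  refine ⟨mem_support_iff.mpr (by rwa [coeff_sum]), fun s hs hne => ?_⟩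
  obtain ⟨j, hj, hsj⟩ := Finset.mem_biUnion.mp (support_sum hs)
  exact hlt j (Finset.mem_range.mp hj) s hsj hne

/-! ### U5. THE DEAD-FIBRE INITIAL TERM in polynomial form

On an arc with pivot relation `c⁰ = c⁺ − c⁻` put `F := w'^{c⁺}`, `G := w'^{c⁻}` (both with the SAME unique top `V = π(c⁺) = π(c⁻)`),
`λ := F_V / G_V`, `N := F − λ G` (the auxiliary TWO-PRODUCTS BINOMIAL of the arc) and, for a fibre `{γ₀ + j c⁰ : j ≤ J}` with
coefficients `φ_j := P'_{γ₀+jc⁰}`, the FIBRE POLYNOMIAL `φ = Σ φ_j z^j`.  Then `T_q · G^J = w'^{γ₀} · homEval φ J F G`, and the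
theorem below says: `homEval φ J F G = N^k · Ψ` with `k = ord_{z=λ} φ` and `Ψ` of unique top `(J−k)V`; hence (U5′) the fibre part
`T_q` has a unique `ν`-top at `q + k·e(ν)`, `e(ν) = top_ν(N) − V`, whenever `ν` is not an edge direction of `N`. -/

/-- homogenised evaluation of a one-variable polynomial (degree `≤ M`) at the pair `(F, G)`: `Σ_{j ≤ M} φ_j · F^j · G^{M−j}` -/
def homEval (φ : Polynomial ℂ) (M : ℕ) (F G : Poly2) : Poly2 :=
  ∑ j ∈ Finset.range (M + 1), C (φ.coeff j) * F ^ j * G ^ (M - j)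

theorem homEval_mul_X_sub_C (χ : Polynomial ℂ) (M : ℕ) (hχ : χ.natDegree ≤ M) (c : ℂ) (F G : Poly2) :
    homEval (χ * (Polynomial.X - Polynomial.C c)) (M + 1) F G = (F - C c * G) * homEval χ M F G := by
  have hM1 : χ.coeff (M + 1) = 0 := Polynomial.coeff_eq_zero_of_natDegree_lt (by omega)
  have h0 : (χ * (Polynomial.X - Polynomial.C c)).coeff 0 = -(c * χ.coeff 0) := by
    rw [Polynomial.mul_coeff_zero, Polynomial.coeff_sub, Polynomial.coeff_X_zero, Polynomial.coeff_C_zero]; ring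
  have hS : ∀ i, (χ * (Polynomial.X - Polynomial.C c)).coeff (i + 1) = χ.coeff i - c * χ.coeff (i + 1) := by
    intro i; rw [Polynomial.coeff_mul_X_sub_C]; ring
  have hL : homEval (χ * (Polynomial.X - Polynomial.C c)) (M + 1) F G =
      (∑ i ∈ Finset.range (M + 1), C (χ.coeff i) * F ^ (i + 1) * G ^ (M - i))
        - (∑ i ∈ Finset.range (M + 1), C (c * χ.coeff (i + 1)) * F ^ (i + 1) * G ^ (M - i))
        - C (c * χ.coeff 0) * G ^ (M + 1) := by
    unfold homEval
    rw [Finset.sum_range_succ']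
    simp only [hS, h0, pow_zero, mul_one, Nat.add_sub_add_right, Nat.sub_zero, C_sub, C_neg, sub_mul,
      Finset.sum_sub_distrib, neg_mul]
    ring
  have e1 : ∀ i : ℕ, F * (C (χ.coeff i) * F ^ i * G ^ (M - i)) = C (χ.coeff i) * F ^ (i + 1) * G ^ (M - i) := by
    intro i; rw [pow_succ]; ring
  have e2 : ∀ i : ℕ, C c * G * (C (χ.coeff i) * F ^ i * G ^ (M - i)) = C (c * χ.coeff i) * F ^ i * G ^ (M - i + 1) := by
    intro i; rw [C_mul, pow_succ]; ring
  have hR : (F - C c * G) * homEval χ M F G =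
      (∑ i ∈ Finset.range (M + 1), C (χ.coeff i) * F ^ (i + 1) * G ^ (M - i))
        - ∑ i ∈ Finset.range (M + 1), C (c * χ.coeff i) * F ^ i * G ^ (M - i + 1) := by
    unfold homEval
    rw [sub_mul, Finset.mul_sum, Finset.mul_sum]
    simp only [e1, e2]
  have hshift : (∑ i ∈ Finset.range (M + 1), C (c * χ.coeff (i + 1)) * F ^ (i + 1) * G ^ (M - i))
      + C (c * χ.coeff 0) * G ^ (M + 1) = ∑ i ∈ Finset.range (M + 1), C (c * χ.coeff i) * F ^ i * G ^ (M - i + 1) := by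
    have key : ∑ j ∈ Finset.range (M + 2), C (c * χ.coeff j) * F ^ j * G ^ (M + 1 - j)
        = ∑ i ∈ Finset.range (M + 1), C (c * χ.coeff i) * F ^ i * G ^ (M - i + 1) := by
      rw [Finset.sum_range_succ, hM1, mul_zero, C_0, zero_mul, zero_mul, add_zero]
      refine Finset.sum_congr rfl fun i hi => ?_
      have hi' := Finset.mem_range.mp hi
      have : M + 1 - i = M - i + 1 := by omega
      rw [this]
    rw [← key]
    conv_rhs => rw [Finset.sum_range_succ']
    simp only [pow_zero, mul_one, Nat.add_sub_add_right, Nat.sub_zero]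
  rw [hL, hR, ← hshift, sub_sub]

theorem homEval_mul_X_sub_C_pow (χ : Polynomial ℂ) (M : ℕ) (hχ : χ.natDegree ≤ M) (c : ℂ) (F G : Poly2) :
    ∀ k, homEval (χ * (Polynomial.X - Polynomial.C c) ^ k) (M + k) F G = (F - C c * G) ^ k * homEval χ M F G := by
  intro k
  induction k with
  | zero => simp
  | succ k ih =>
    have hdeg : (χ * (Polynomial.X - Polynomial.C c) ^ k).natDegree ≤ M + k := by
      refine Polynomial.natDegree_mul_le.trans ?_
      have h1 : ((Polynomial.X - Polynomial.C c) ^ k).natDegree ≤ k * (Polynomial.X - Polynomial.C c).natDegree :=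
        Polynomial.natDegree_pow_le
      rw [Polynomial.natDegree_X_sub_C] at h1
      omega
    rw [pow_succ, ← mul_assoc, show M + (k + 1) = (M + k) + 1 by ring, homEval_mul_X_sub_C _ _ hdeg, ih]
    ring

/-- the NON-VANISHING branch: `ψ(λ) ≠ 0` ⇒ `homEval ψ M F G` has the unique top `M•V`, coefficient `G_V^M · ψ(λ)` -/
theorem isUniqueTop_homEval {ν : Fin 2 → ℝ} {F G : Poly2} {V : Expo} (hF : IsUniqueTop ν F V) (hG : IsUniqueTop ν G V)
    (ψ : Polynomial ℂ) (M : ℕ) (hψ : ψ.natDegree ≤ M) (hev : ψ.eval (coeff V F / coeff V G) ≠ 0) :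
    IsUniqueTop ν (homEval ψ M F G) (M • V) ∧
      coeff (M • V) (homEval ψ M F G) = coeff V G ^ M * ψ.eval (coeff V F / coeff V G) := by
  have hg : coeff V G ≠ 0 := hG.coeff_ne_zero
  have hterm : ∀ j, j ≤ M → IsUniqueTop ν (F ^ j * G ^ (M - j)) (M • V) ∧
      coeff (M • V) (F ^ j * G ^ (M - j)) = coeff V F ^ j * coeff V G ^ (M - j) := by
    intro j hj
    have h1 := (hF.pow j).1.mul (hG.pow (M - j)).1
    rw [← add_nsmul, Nat.add_sub_cancel' hj, (hF.pow j).2, (hG.pow (M - j)).2] at h1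
    exact h1
  have hsum : ∑ j ∈ Finset.range (M + 1), coeff (M • V) (C (ψ.coeff j) * F ^ j * G ^ (M - j))
      = coeff V G ^ M * ψ.eval (coeff V F / coeff V G) := by
    have hc : ∀ j ∈ Finset.range (M + 1), coeff (M • V) (C (ψ.coeff j) * F ^ j * G ^ (M - j))
        = ψ.coeff j * (coeff V F ^ j * coeff V G ^ (M - j)) := by
      intro j hj
      rw [mul_assoc, coeff_C_mul, (hterm j (by have := Finset.mem_range.mp hj; omega)).2]
    rw [Finset.sum_congr rfl hc, Polynomial.eval_eq_sum_range' (by omega : ψ.natDegree < M + 1), Finset.mul_sum]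
    refine Finset.sum_congr rfl fun j hj => ?_
    have hj' : j ≤ M := by have := Finset.mem_range.mp hj; omega
    rw [div_pow, show coeff V G ^ M = coeff V G ^ j * coeff V G ^ (M - j) by rw [← pow_add, Nat.add_sub_cancel' hj']]
    field_simp
  have hcoeff : coeff (M • V) (homEval ψ M F G) = coeff V G ^ M * ψ.eval (coeff V F / coeff V G) := by
    unfold homEval; rw [coeff_sum, hsum]
  refine ⟨?_, hcoeff⟩
  unfold homEval
  apply isUniqueTop_sum
  · intro j hj s hs hne
    have hj' : j ≤ M := by omega
    by_cases hcj : ψ.coeff j = 0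
    · rw [hcj, C_0, zero_mul, zero_mul] at hs; simp at hs
    · rw [mul_assoc] at hs
      exact ((hterm j hj').1.C_mul hcj).2 s hs hne
  · rw [hsum]; exact mul_ne_zero (pow_ne_zero _ hg) hev

/-- **U5 (DEAD-FIBRE INITIAL TERM).**  `F, G` with the same unique `ν`-top `V`, `λ = F_V/G_V`, `N = F − λ•G` with a unique `ν`-top `E`
(i.e. `ν` is not an edge direction of the arc's binomial), `φ ≠ 0` of degree `≤ J`, `k = ord_λ φ`:  then `k ≤ J` and `homEval φ J F G`
has the unique `ν`-top `k•E + (J−k)•V` (nonzero coefficient).  Live fibre = `k = 0` (top `J•V`, i.e. `x^q` after the bookkeeping);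
dead fibre = `k ≥ 1`: the top is displaced by `k` copies of `e(ν) = E − V`. -/
theorem deadFibre_uniqueTop {ν : Fin 2 → ℝ} {F G : Poly2} {V E : Expo} (hF : IsUniqueTop ν F V) (hG : IsUniqueTop ν G V)
    (φ : Polynomial ℂ) (hφ : φ ≠ 0) (J : ℕ) (hJ : φ.natDegree ≤ J)
    (hN : IsUniqueTop ν (F - C (coeff V F / coeff V G) * G) E) :
    φ.rootMultiplicity (coeff V F / coeff V G) ≤ J ∧
      IsUniqueTop ν (homEval φ J F G)
        (φ.rootMultiplicity (coeff V F / coeff V G) • E + (J - φ.rootMultiplicity (coeff V F / coeff V G)) • V) ∧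
      homEval φ J F G = (F - C (coeff V F / coeff V G) * G) ^ φ.rootMultiplicity (coeff V F / coeff V G) *
        homEval (φ /ₘ (Polynomial.X - Polynomial.C (coeff V F / coeff V G)) ^ φ.rootMultiplicity (coeff V F / coeff V G))
          (J - φ.rootMultiplicity (coeff V F / coeff V G)) F G := by
  set lam := coeff V F / coeff V G with hlam
  set k := φ.rootMultiplicity lam with hk
  set ψ := φ /ₘ (Polynomial.X - Polynomial.C lam) ^ k with hψ
  have hmonic : ((Polynomial.X - Polynomial.C lam) ^ k).Monic := (Polynomial.monic_X_sub_C lam).pow k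
  have hφψ : φ = (Polynomial.X - Polynomial.C lam) ^ k * ψ := by
    have h := Polynomial.modByMonic_add_div φ ((Polynomial.X - Polynomial.C lam) ^ k)
    have hmod : φ %ₘ (Polynomial.X - Polynomial.C lam) ^ k = 0 :=
      (Polynomial.modByMonic_eq_zero_iff_dvd hmonic).mpr (Polynomial.pow_rootMultiplicity_dvd φ lam)
    rw [hmod, zero_add] at h
    exact h.symm
  have hψ0 : ψ ≠ 0 := by
    intro h0; rw [h0, mul_zero] at hφψ; exact hφ hφψ
  have hev : ψ.eval lam ≠ 0 := by
    have h := Polynomial.eval_divByMonic_pow_rootMultiplicity_ne_zero lam hφ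
    exact h
  have hdegφ : φ.natDegree = k + ψ.natDegree := by
    conv_lhs => rw [hφψ]
    rw [Polynomial.natDegree_mul (pow_ne_zero _ (Polynomial.X_sub_C_ne_zero lam)) hψ0, Polynomial.natDegree_pow,
      Polynomial.natDegree_X_sub_C, mul_one]
  have hkJ : k ≤ J := by omega
  have hψdeg : ψ.natDegree ≤ J - k := by omega
  have hfac : homEval φ J F G = (F - C lam * G) ^ k * homEval ψ (J - k) F G := by
    have := homEval_mul_X_sub_C_pow ψ (J - k) hψdeg lam F G k
    rw [Nat.sub_add_cancel hkJ, mul_comm ψ, ← hφψ] at this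
    exact this
  refine ⟨hkJ, ?_, hfac⟩
  rw [hfac]
  exact ((hN.pow k).1.mul (isUniqueTop_homEval hF hG ψ (J - k) hψdeg hev).1).1

/-- **U5′ (the fibre part itself).**  If `T · G^J = H · Φ` with `G, H, Φ` of unique `ν`-tops `V, h, e`, then `T` has a unique `ν`-top
`p` with `p + J•V = h + e`.  (With `H = w'^{γ₀}`, `Φ = homEval φ_q J F G` from U5: `top_ν(T_q) = q + k_q · (E − V)`.)
Uses Ostrowski (`ostrowski` in this file's g10 part). -/
theorem uniqueTop_of_mul_eq (hO : Ostrowski) {ν : Fin 2 → ℝ} {T G H Φ : Poly2} {V h e : Expo} (J : ℕ)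
    (hG : IsUniqueTop ν G V) (hH : IsUniqueTop ν H h) (hΦ : IsUniqueTop ν Φ e) (heq : T * G ^ J = H * Φ) :
    ∃ p, IsUniqueTop ν T p ∧ p + J • V = h + e := by
  have hHΦ := (hH.mul hΦ).1
  have hT0 : T ≠ 0 := by
    intro h0; rw [h0, zero_mul] at heq; exact hHΦ.ne_zero heq.symm
  have hGJ := (hG.pow J).1
  have hnt : ¬ IsEdgeDir ν T := by
    intro hE
    have h1 : IsEdgeDir ν (T * G ^ J) := (hO ν T (G ^ J) hT0 hGJ.ne_zero).mpr (Or.inl hE)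
    rw [heq] at h1
    exact hHΦ.not_isEdgeDir h1
  obtain ⟨p, hp⟩ := exists_isUniqueTop_of_not_isEdgeDir hT0 hnt
  refine ⟨p, hp, ?_⟩
  have h1 := (hp.mul hGJ).1
  rw [heq] at h1
  exact h1.unique hHΦ

/-- no tie of `T` inside the arc unless the binomial `N` has one there: if `G, H` have unique tops and `Φ = N^k Ψ` with `Ψ` of unique
top, then a tie of `T` (with `T·G^J = H·Φ`) at `ν` forces a tie of `N` at `ν` (for `k ≥ 1`; for `k = 0` there is none). -/
theorem isEdgeDir_binomial_of_isEdgeDir_part (hO : Ostrowski) {ν : Fin 2 → ℝ} {T G H N Ψ : Poly2} {V h u : Expo} (J k : ℕ)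
    (hG : IsUniqueTop ν G V) (hH : IsUniqueTop ν H h) (hΨ : IsUniqueTop ν Ψ u) (hN0 : N ≠ 0)
    (heq : T * G ^ J = H * (N ^ k * Ψ)) (hT : IsEdgeDir ν T) : 1 ≤ k ∧ IsEdgeDir ν N := by
  have hT0 : T ≠ 0 := ne_zero_of_isEdgeDir hT
  have hGJ := (hG.pow J).1
  have h1 : IsEdgeDir ν (T * G ^ J) := (hO ν T (G ^ J) hT0 hGJ.ne_zero).mpr (Or.inl hT)
  rw [heq] at h1
  have hNk0 : N ^ k ≠ 0 := pow_ne_zero _ hN0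
  have h2 := (hO ν H (N ^ k * Ψ) hH.ne_zero (mul_ne_zero hNk0 hΨ.ne_zero)).mp h1
  rcases h2 with h2 | h2
  · exact absurd h2 hH.not_isEdgeDir
  have h3 := (hO ν (N ^ k) Ψ hNk0 hΨ.ne_zero).mp h2
  rcases h3 with h3 | h3
  · -- a tie of N^k ⇒ k ≥ 1 and a tie of N
    have hk : 1 ≤ k := by
      rcases Nat.eq_zero_or_pos k with hk0 | hk0
      · exfalso; rw [hk0, pow_zero] at h3
        exact (show ¬ IsEdgeDir ν (1 : Poly2) from fun hE => by
          obtain ⟨a, ha, b, hb, hab, -, -⟩ := hE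
          have ha0 : a ∈ ({0} : Finset Expo) := by rwa [support_one] at ha
          have hb0 : b ∈ ({0} : Finset Expo) := by rwa [support_one] at hb
          simp only [Finset.mem_singleton] at ha0 hb0
          exact hab (ha0.trans hb0.symm)) h3
      · exact hk0
    refine ⟨hk, ?_⟩
    -- peel the power
    have key : ∀ j, 1 ≤ j → IsEdgeDir ν (N ^ j) → IsEdgeDir ν N := by
      intro j hj
      induction j with
      | zero => omega
      | succ j ih =>
        intro hE
        rcases Nat.eq_zero_or_pos j with hj0 | hj0
        · rw [hj0, zero_add, pow_one] at hE; exact hE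
        · rw [pow_succ] at hE
          rcases (hO ν (N ^ j) N (pow_ne_zero _ hN0) hN0).mp hE with h | h
          · exact ih hj0 h
          · exact h
    exact key k hk h3
  · exact absurd h3 hΨ.not_isEdgeDir


/-! ### U6. Corollaries in the g10 currency -/

/-- **U2 IN KERNEL (law form).** `NoHullLoss ⇒ nv P̃(w) ≤ (m+1)·(m+2)²²·(t+2)²²` — same bound as `noAnnihilation_nv_le` on a STRICTLY
larger class (only hull containment of the layers is used). [val-idea-35 g11] -/
theorem noHullLoss_nv_le (m t : ℕ) (P : Poly3) (w : Fin 3 → Poly2)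
    (hP : P.totalDegree ≤ m) (hw : ∀ i, (w i).support.card ≤ t) (h : NoHullLoss w P) :
    nv (aeval w P) ≤ (m + 1) * ((m + 2) ^ 22 * (t + 2) ^ 22) :=
  noHullLoss_nv_le_of_layer_bound m P w hP _ (fun d hd => nv_layer_le m t d hd P w hw) h

/-- The NO-HULL-LOSS LAW (polynomial currency). -/
def NoHullLossLaw : Prop :=
  ∃ c : ℕ, ∀ (m t : ℕ) (P : Poly3) (w : Fin 3 → Poly2),
    P.totalDegree ≤ m → (∀ i, (w i).support.card ≤ t) → NoHullLoss w P →
    nv (MvPolynomial.aeval w P) ≤ (m + 2) ^ c * (t + 2) ^ c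

/-- **`NoHullLossLaw` holds with `c = 23`.** [val-idea-35 g11] -/
theorem noHullLossLaw : NoHullLossLaw := by
  refine ⟨23, fun m t P w hP hw h => (noHullLoss_nv_le m t P w hP hw h).trans ?_⟩
  have h1 : m + 1 ≤ m + 2 := by omega
  have h2 : (t + 2) ^ 22 ≤ (t + 2) ^ 23 := Nat.pow_le_pow_right (by omega) (by omega)
  calc (m + 1) * ((m + 2) ^ 22 * (t + 2) ^ 22) ≤ (m + 2) * ((m + 2) ^ 22 * (t + 2) ^ 23) :=
        Nat.mul_le_mul h1 (Nat.mul_le_mul_left _ h2)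
    _ = (m + 2) ^ 23 * (t + 2) ^ 23 := by ring

/-- `NoAnnihilation ⇒ NoHullLoss`, so the g10 law (s1) is an instance of `noHullLossLaw` (containment by name). -/
theorem noAnnihilation_nv_le' (m t : ℕ) (P : Poly3) (w : Fin 3 → Poly2)
    (hP : P.totalDegree ≤ m) (hw : ∀ i, (w i).support.card ≤ t) (hna : NoAnnihilation w P) :
    nv (aeval w P) ≤ (m + 1) * ((m + 2) ^ 22 * (t + 2) ^ 22) :=
  noHullLoss_nv_le m t P w hP hw (noHullLoss_of_noAnnihilation w P hna)

/-- U5′ specialised with the kernel `ostrowski` of this file. -/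
theorem uniqueTop_of_mul_eq' {ν : Fin 2 → ℝ} {T G H Φ : Poly2} {V h e : Expo} (J : ℕ)
    (hG : IsUniqueTop ν G V) (hH : IsUniqueTop ν H h) (hΦ : IsUniqueTop ν Φ e) (heq : T * G ^ J = H * Φ) :
    ∃ p, IsUniqueTop ν T p ∧ p + J • V = h + e :=
  uniqueTop_of_mul_eq ostrowski J hG hH hΦ heq

/-- U5′ (tie transfer) specialised with the kernel `ostrowski` of this file: a tie direction of the fibre part `T` (with
`T · G^J = H · (N^k · Ψ)`, `G, H, Ψ` of unique top) forces `k ≥ 1` and a tie of the auxiliary binomial `N`. -/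
theorem isEdgeDir_binomial_of_isEdgeDir_part' {ν : Fin 2 → ℝ} {T G H N Ψ : Poly2} {V h u : Expo} (J k : ℕ)
    (hG : IsUniqueTop ν G V) (hH : IsUniqueTop ν H h) (hΨ : IsUniqueTop ν Ψ u) (hN0 : N ≠ 0)
    (heq : T * G ^ J = H * (N ^ k * Ψ)) (hT : IsEdgeDir ν T) : 1 ≤ k ∧ IsEdgeDir ν N :=
  isEdgeDir_binomial_of_isEdgeDir_part ostrowski J k hG hH hΨ hN0 heq hT

/--
info: 'Summit.ValiantsHypothesis.ValiantsHypothesis.Cruxes.TwoProducts.ValIdea35g10.nv_le_sum_of_hull_cover' depends on axioms: [propext,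
 Classical.choice,
 Quot.sound]
-/
#guard_msgs in
#print axioms nv_le_sum_of_hull_cover

/--
info: 'Summit.ValiantsHypothesis.ValiantsHypothesis.Cruxes.TwoProducts.ValIdea35g10.noHullLossLaw' depends on axioms: [propext,
 Classical.choice,
 Quot.sound]
-/
#guard_msgs in
#print axioms noHullLossLaw

/--
info: 'Summit.ValiantsHypothesis.ValiantsHypothesis.Cruxes.TwoProducts.ValIdea35g10.deadFibre_uniqueTop' depends on axioms: [propext,
 Classical.choice,
 Quot.sound]
-/
#guard_msgs in
#print axioms deadFibre_uniqueTop

/--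
info: 'Summit.ValiantsHypothesis.ValiantsHypothesis.Cruxes.TwoProducts.ValIdea35g10.isEdgeDir_binomial_of_isEdgeDir_part'' depends on axioms: [propext,
 Classical.choice,
 Quot.sound]
-/
#guard_msgs in
#print axioms isEdgeDir_binomial_of_isEdgeDir_part'

end UnitTowerG11

/-! ═════════════════════════ REV 6 (val-idea-35 g11, crit-8 #64 (2)): THE LEVEL-1 CLASSES, TYPED ═════════════════════════
Memo `Cruxes/TwoProducts/EXPT-unit-tower-g11.md` §1–§3.  Typed here: the support condition `NoRayTriple`, the fibre decomposition
`D = Σ_q T_q` (kernel: `aeval_eq_sum_fibrePart`), fibre coincidences and `NFC`, the OPEN law `LevelOneLaw` (paper proof = memo §3, modulo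
T1-A-FULL = ✓-pending `…RankTwoJacobian.binomialAffine_nv_le` of val-port-4 g4), and the strictness `NoHullLoss ⊋ NoAnnihilation` by a kernel
instance.  Nothing here is a proof of `LevelOneLaw`, `RankThreeAffineLaw(Exp)` or `TwoProducts`. -/
section LevelOneClassesG11
open scoped Classical

/-- **NoRayTriple** (a condition on the three SUPPORTS only): no line through the origin meets `supp w₀`, `supp w₁` and `supp w₂`
— i.e. no triple `(e₀, e₁, e₂)` of exponents, one from each support, with all pairwise determinants zero (the zero exponent of a
constant term counts: `(0, e₁, e₂)` with `e₁ ∥ e₂` is a ray triple).  It excludes the COL arcs of memo §1 (three arc-tops on one ray),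
so that every arc has a rank-1 relation lattice `ℤ·c⁰`.  Binary digit tables `Σ x^{2^a}, Σ y^{2^a}, Σ (xy)^{2^a}` satisfy it. -/
def NoRayTriple (w : Fin 3 → Poly2) : Prop :=
  ∀ e₀ ∈ (w 0).support, ∀ e₁ ∈ (w 1).support, ∀ e₂ ∈ (w 2).support,
    ¬ (idet e₀ e₁ = 0 ∧ idet e₀ e₂ = 0 ∧ idet e₁ e₂ = 0)

/-- the pivot map `π_p(α) = Σᵢ αᵢ • pᵢ` (top exponent of `w^α` when `pᵢ` is the unique top of `wᵢ`) -/
def piv (p : Fin 3 → Expo) (α : Fin 3 →₀ ℕ) : Expo := ∑ i, (α i) • p i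

/-- the FIBRE of the outer polynomial over the point `q`: the part of `P` carried by the monomials `α` with `π_p(α) = q` -/
def fibre (P : Poly3) (p : Fin 3 → Expo) (q : Expo) : Poly3 :=
  ∑ α ∈ P.support.filter (fun α => piv p α = q), monomial α (coeff α P)

/-- the FIBRE PART `T_q := (fibre of P over q)(w)` -/
def fibrePart (w : Fin 3 → Poly2) (P : Poly3) (p : Fin 3 → Expo) (q : Expo) : Poly2 := aeval w (fibre P p q)

/-- the fibres partition the outer polynomial [folklore] -/
theorem sum_fibre (P : Poly3) (p : Fin 3 → Expo) :
    ∑ q ∈ P.support.image (piv p), fibre P p q = P := by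
  unfold fibre
  rw [Finset.sum_fiberwise_of_maps_to (fun α hα => Finset.mem_image_of_mem _ hα)]
  exact (MvPolynomial.as_sum P).symm

/-- **`D = Σ_q T_q`** — the fibre decomposition of memo §1, in kernel. [val-idea-35 g11] -/
theorem aeval_eq_sum_fibrePart (w : Fin 3 → Poly2) (P : Poly3) (p : Fin 3 → Expo) :
    aeval w P = ∑ q ∈ P.support.image (piv p), fibrePart w P p q := by
  unfold fibrePart
  rw [← map_sum, sum_fibre]

/-- off the fibre values the fibre is empty -/
theorem fibre_eq_zero_of_not_mem (P : Poly3) (p : Fin 3 → Expo) {q : Expo} (hq : q ∉ P.support.image (piv p)) :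
    fibre P p q = 0 := by
  unfold fibre
  apply Finset.sum_eq_zero
  intro α hα
  exfalso; apply hq
  rw [Finset.mem_filter] at hα
  exact Finset.mem_image.mpr ⟨α, hα.1, hα.2⟩

/-- the number of fibres is at most `|supp P|` (`≤ C(m+3,3)`) -/
theorem card_fibres_le (P : Poly3) (p : Fin 3 → Expo) : (P.support.image (piv p)).card ≤ P.support.card :=
  Finset.card_image_le

/-- **The ROW identity** (memo §10, hyperplane-section form): the coefficient of `x^u` in `P(w)` is the pairing of the coefficient
vector of `P` with the ROW `M(u) = (coeff_u w^α)_α`; hence `supp P(w) = U ∖ M⁻¹(ker P)`. [folklore] -/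
theorem coeff_aeval_rows (w : Fin 3 → Poly2) (P : Poly3) (u : Expo) :
    coeff u (aeval w P) = ∑ α ∈ P.support, coeff α P * coeff u (∏ i, w i ^ (α i)) := by
  rw [MvPolynomial.aeval_def, MvPolynomial.eval₂_eq', coeff_sum]
  refine Finset.sum_congr rfl fun α _ => ?_
  rw [MvPolynomial.algebraMap_eq, coeff_C_mul]

/-- A **fibre coincidence** at `ν` (memo §3.3 (R1), «second-level coincidence»): two DISTINCT fibre parts share one and the same
unique `ν`-top exponent `e` (so their leading terms can cancel in `D = Σ_q T_q`).  By U5 (`deadFibre_uniqueTop`) this needs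
`q − q′ = (k′ − k)·e(ν)` with `k, k′` the multiplicities of the dead fibres. -/
def FibreCoincidence (w : Fin 3 → Poly2) (P : Poly3) (ν : Fin 2 → ℝ) (p : Fin 3 → Expo) (q q' e : Expo) : Prop :=
  q ≠ q' ∧ IsUniqueTop ν (fibrePart w P p q) e ∧ IsUniqueTop ν (fibrePart w P p q') e

/-- **NFC** (no fibre cancellation possible): at every direction where the three letters have unique tops `pᵢ`, no two distinct
fibre parts (fibres taken w.r.t. these tops) share a unique top exponent.  This is the global, arc-free form of the hypothesis of the
level-1 law; it is stronger than what memo §3 uses (there only the ν-heaviest candidate needs to be attained once). -/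
def NFC (w : Fin 3 → Poly2) (P : Poly3) : Prop :=
  ∀ (ν : Fin 2 → ℝ) (p : Fin 3 → Expo), (∀ i, IsUniqueTop ν (w i) (p i)) →
    ∀ q q' e : Expo, ¬ FibreCoincidence w P ν p q q' e

/-- **LEVEL-1 LAW** (memo §3, THEOREM L1 — PAPER, typed OPEN here): outside COL arcs and fibre coincidences the onset polynomial
`P(w₀,w₁,w₂)` has polynomially many vertices.  Paper bound: `2·(3·C(t,2)+1)·(T(t)+1)·C(m+3,3)`, `T(t) = 4t⁶+5t²+3t+2`, i.e. `c = 10`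
suffices; the sub-arc count uses T1-A-FULL (`binomialAffine_nv_le`, val-port-4 g4, ✓-pending at the time of writing).  Kernel pieces
of the proof in this file: U1 `nv_le_sum_of_hull_cover`, U3 `isUniqueTop_part_of_sum`, U4, U5 `deadFibre_uniqueTop`,
`isEdgeDir_binomial_of_isEdgeDir_part'`, and `aeval_eq_sum_fibrePart` above; NOT in kernel: the arc bookkeeping and the envelope count. -/
def LevelOneLaw : Prop :=
  ∃ c : ℕ, ∀ (m t : ℕ) (P : Poly3) (w : Fin 3 → Poly2),
    P.totalDegree ≤ m → (∀ i, (w i).support.card ≤ t) → NoRayTriple w → NFC w P →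
    nv (MvPolynomial.aeval w P) ≤ (m + 2) ^ c * (t + 2) ^ c

/-! ### The strictness `NoHullLoss ⊋ NoAnnihilation` by a kernel instance (crit-8 #64): `P = X₀X₁ − X₂`, `w = (x, y, xy + x² + y²)`,
`D = −x² − y²`; the degree-2 layer `xy` is annihilated (`(1,1) ∉ supp D`) but sits at the midpoint of `Newt D = [(2,0),(0,2)]`. -/

/-- the letters of the separating instance -/
def wSep : Fin 3 → Poly2 := ![X 0, X 1, X 0 * X 1 + X 0 ^ 2 + X 1 ^ 2]

/-- the outer polynomial of the separating instance -/
def PSep : Poly3 := X 0 * X 1 - X 2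

theorem aeval_PSep : aeval wSep PSep = -(X 0 ^ 2 + X 1 ^ 2 : Poly2) := by
  simp only [PSep, wSep, map_sub, map_mul, aeval_X, Matrix.cons_val_zero, Matrix.cons_val_one, Matrix.head_cons,
    Matrix.cons_val_two, Matrix.tail_cons]
  ring

theorem homogeneousComponent_PSep (d : ℕ) :
    homogeneousComponent d PSep = (if d = 2 then (X 0 * X 1 : Poly3) else 0) - (if d = 1 then (X 2 : Poly3) else 0) := by
  have h2 : (X 0 * X 1 : Poly3).IsHomogeneous 2 :=
    (isHomogeneous_X ℂ (0 : Fin 3)).mul (isHomogeneous_X ℂ (1 : Fin 3))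
  have h1 : (X 2 : Poly3).IsHomogeneous 1 := isHomogeneous_X ℂ (2 : Fin 3)
  unfold PSep
  rw [map_sub, homogeneousComponent_of_mem h2, homogeneousComponent_of_mem h1]

/-- the three exponents that occur -/
def e20 : Expo := Finsupp.single 0 2
def e02 : Expo := Finsupp.single 1 2
def e11 : Expo := Finsupp.single 0 1 + Finsupp.single 1 1

theorem coeff_D_e20 : coeff e20 (aeval wSep PSep) ≠ 0 := by
  rw [aeval_PSep, e20]
  simp [coeff_X_pow, Finsupp.single_eq_single_iff]

theorem coeff_D_e02 : coeff e02 (aeval wSep PSep) ≠ 0 := by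
  rw [aeval_PSep, e02]
  simp [coeff_X_pow, Finsupp.single_eq_single_iff]

theorem coeff_D_e11 : coeff e11 (aeval wSep PSep) = 0 := by
  rw [aeval_PSep, e11]
  simp only [coeff_neg, coeff_add, coeff_X_pow, neg_eq_zero]
  have h1 : ¬ Finsupp.single (0 : Fin 2) 2 = Finsupp.single 0 1 + Finsupp.single 1 1 := by
    intro h; have := Finsupp.ext_iff.mp h 1; simp at this
  have h2 : ¬ Finsupp.single (1 : Fin 2) 2 = Finsupp.single 0 1 + Finsupp.single 1 1 := by
    intro h; have := Finsupp.ext_iff.mp h 0; simp at this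
  simp [h1, h2]

theorem layer_two : layer wSep PSep 2 = (X 0 * X 1 : Poly2) := by
  unfold layer; rw [homogeneousComponent_PSep]
  simp [wSep]

theorem layer_one : layer wSep PSep 1 = -(X 0 * X 1 + X 0 ^ 2 + X 1 ^ 2 : Poly2) := by
  unfold layer; rw [homogeneousComponent_PSep]
  simp [wSep]

theorem layer_other {d : ℕ} (h1 : d ≠ 1) (h2 : d ≠ 2) : layer wSep PSep d = 0 := by
  unfold layer; rw [homogeneousComponent_PSep]
  simp [h1, h2]

theorem X_mul_X_eq : (X 0 * X 1 : Poly2) = monomial e11 1 := by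
  rw [e11, X, X, monomial_mul, mul_one]

theorem X_pow_two_eq (i : Fin 2) : (X i ^ 2 : Poly2) = monomial (Finsupp.single i 2) 1 := by
  rw [X_pow_eq_monomial]

/-- `(1,1) ∈ supp (layer 2)` and `(1,1) ∉ supp D`: the instance ANNIHILATES. -/
theorem not_noAnnihilation_sep : ¬ NoAnnihilation wSep PSep := by
  intro h
  have hmem : e11 ∈ (layer wSep PSep 2).support := by
    rw [layer_two, X_mul_X_eq, support_monomial, if_neg one_ne_zero]; exact Finset.mem_singleton_self _
  have := h 2 hmem
  rw [MvPolynomial.mem_support_iff] at this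
  exact this coeff_D_e11

/-- the three relevant points lie in `Newt D` -/
theorem emb_mem_hull_of (s : Expo) (hs : s = e20 ∨ s = e02 ∨ s = e11) :
    emb s ∈ hull (aeval wSep PSep).support := by
  have h20 : emb e20 ∈ hull (aeval wSep PSep).support :=
    subset_convexHull ℝ _ ⟨e20, by exact_mod_cast MvPolynomial.mem_support_iff.mpr coeff_D_e20, rfl⟩
  have h02 : emb e02 ∈ hull (aeval wSep PSep).support :=
    subset_convexHull ℝ _ ⟨e02, by exact_mod_cast MvPolynomial.mem_support_iff.mpr coeff_D_e02, rfl⟩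
  rcases hs with rfl | rfl | rfl
  · exact h20
  · exact h02
  · have hmid := convex_convexHull ℝ _ h20 h02 (by norm_num : (0:ℝ) ≤ 1/2) (by norm_num : (0:ℝ) ≤ 1/2) (by norm_num)
    have heq : (1/2 : ℝ) • emb e20 + (1/2 : ℝ) • emb e02 = emb e11 := by
      funext i; fin_cases i <;> simp [emb, e20, e02, e11]
    rw [heq] at hmid; exact hmid

/-- …but no layer leaves the polygon: the instance has NO HULL LOSS. -/
theorem noHullLoss_sep : NoHullLoss wSep PSep := by
  intro d v hv
  obtain ⟨s, hs, rfl⟩ := hv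
  have hs' : s ∈ (layer wSep PSep d).support := by exact_mod_cast hs
  apply emb_mem_hull_of
  by_cases h2 : d = 2
  · subst h2
    rw [layer_two, X_mul_X_eq, support_monomial, if_neg one_ne_zero, Finset.mem_singleton] at hs'
    exact Or.inr (Or.inr hs')
  by_cases h1 : d = 1
  · subst h1
    rw [layer_one, support_neg] at hs'
    rw [X_mul_X_eq, X_pow_two_eq, X_pow_two_eq] at hs'
    have hs2 := support_add hs'
    rcases Finset.mem_union.mp hs2 with hA | hB
    · rcases Finset.mem_union.mp (support_add hA) with hA1 | hA2
      · rw [support_monomial, if_neg one_ne_zero, Finset.mem_singleton] at hA1; exact Or.inr (Or.inr hA1)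
      · rw [support_monomial, if_neg one_ne_zero, Finset.mem_singleton] at hA2; exact Or.inl hA2
    · rw [support_monomial, if_neg one_ne_zero, Finset.mem_singleton] at hB; exact Or.inr (Or.inl hB)
  · rw [layer_other h1 h2, support_zero] at hs'
    exact absurd hs' (Finset.notMem_empty _)

/-- **STRICTNESS BY NAME:** `NoHullLoss` does not imply `NoAnnihilation`. [val-idea-35 g11] -/
theorem noHullLoss_not_imp_noAnnihilation : ∃ (w : Fin 3 → Poly2) (P : Poly3), NoHullLoss w P ∧ ¬ NoAnnihilation w P :=
  ⟨wSep, PSep, noHullLoss_sep, not_noAnnihilation_sep⟩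

/--
info: 'Summit.ValiantsHypothesis.ValiantsHypothesis.Cruxes.TwoProducts.ValIdea35g10.aeval_eq_sum_fibrePart' depends on axioms: [propext,
 Classical.choice,
 Quot.sound]
-/
#guard_msgs in
#print axioms aeval_eq_sum_fibrePart

/--
info: 'Summit.ValiantsHypothesis.ValiantsHypothesis.Cruxes.TwoProducts.ValIdea35g10.noHullLoss_not_imp_noAnnihilation' depends on axioms: [propext,
 Classical.choice,
 Quot.sound]
-/
#guard_msgs in
#print axioms noHullLoss_not_imp_noAnnihilation

end LevelOneClassesG11

/-! ═════════════════════ REV 7 (val-idea-35 g11) — TRANCHE A OF THE `LevelOneLaw` KERNEL: THE PER-DIRECTION LEVEL-1 TOP THEOREM ═════════════════════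
Memo §3 (THEOREM L1), kernel core.  Given PROGRESSION DATA for the fibres of `π_p` on `supp P` (`cp, cm, J, base, idx` with `π cp = π cm` and
`α + J•cm = base(π α) + (idx α)•cp + (J − idx α)•cm` — this is what the rank-one relation lattice of an NC arc provides; its construction from
`NoRayTriple` is a later tranche), every fibre part `T_q` is ZERO or UNIQUELY TOPPED at a level-1 candidate `e` with `e + k•V = q + k•E`
(`V = π cp`, `E` = top of the arc binomial `N = F − λG`, `k ≤ J` the root multiplicity of the fibre polynomial at `λ`; `k = 0` when `N = 0`), and
under NFC + «no weight tie between candidates» the onset polynomial `P(w)` is zero or uniquely topped at a candidate — in particular `ν` is not an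
edge direction.  HONEST LABEL: this is level-1 custody for ONE direction ν given the progression data as HYPOTHESES; it does not prove `LevelOneLaw`
(Tranche B = the lattice: `NoRayTriple` at the tops ⇒ progression data with `c⁺, c⁻` of disjoint support; Tranche C = charts/arcs + counting), and
`RankThreeAffineLaw(Exp)` / `TwoProducts` are UNMOVED; VP ≠ VNP is NOT proved.  Pieces: `mono`, `aeval_monomial_eq`, `isUniqueTop_mono`, the fibre polynomial `fibrePoly`, ★ `fibrePart_mul_pow_eq` (the identity
`T_q · G^J = w^{base q} · homEval φ_q J F G`), ★ `fibrePart_zero_or_uniqueTop`, `isUniqueTop_finset_sum`, ★★ `levelOne_zero_or_uniqueTop`,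
`levelOne_not_isEdgeDir`. -/
section LevelOneTopG11
open scoped Classical

/-- the monomial `w^β = ∏ᵢ wᵢ^{βᵢ}` in the letters -/
def mono (w : Fin 3 → Poly2) (β : Fin 3 →₀ ℕ) : Poly2 := ∏ i, w i ^ (β i)

theorem mono_add (w : Fin 3 → Poly2) (β β' : Fin 3 →₀ ℕ) : mono w (β + β') = mono w β * mono w β' := by
  unfold mono
  rw [← Finset.prod_mul_distrib]
  exact Finset.prod_congr rfl fun i _ => by rw [Finsupp.add_apply, pow_add]

theorem mono_nsmul (w : Fin 3 → Poly2) (n : ℕ) (β : Fin 3 →₀ ℕ) : mono w (n • β) = mono w β ^ n := by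
  unfold mono
  rw [← Finset.prod_pow]
  exact Finset.prod_congr rfl fun i _ => by rw [Finsupp.smul_apply, smul_eq_mul, pow_mul']

theorem aeval_monomial_eq (w : Fin 3 → Poly2) (β : Fin 3 →₀ ℕ) (a : ℂ) :
    aeval w (monomial β a) = C a * mono w β := by
  rw [MvPolynomial.aeval_monomial, MvPolynomial.algebraMap_eq, Finsupp.prod_fintype _ _ (fun i => by simp)]
  rfl

theorem piv_add (p : Fin 3 → Expo) (β β' : Fin 3 →₀ ℕ) : piv p (β + β') = piv p β + piv p β' := by
  unfold piv
  rw [← Finset.sum_add_distrib]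
  exact Finset.sum_congr rfl fun i _ => by rw [Finsupp.add_apply, add_smul]

theorem piv_nsmul (p : Fin 3 → Expo) (n : ℕ) (β : Fin 3 →₀ ℕ) : piv p (n • β) = n • piv p β := by
  unfold piv
  rw [Finset.smul_sum]
  exact Finset.sum_congr rfl fun i _ => by rw [Finsupp.smul_apply, smul_eq_mul, mul_smul]

/-- unique tops multiply: `w^β` is uniquely topped at `π_p(β)` when every letter `wᵢ` is uniquely topped at `pᵢ` -/
theorem isUniqueTop_mono {ν : Fin 2 → ℝ} {w : Fin 3 → Poly2} {p : Fin 3 → Expo} (hw : ∀ i, IsUniqueTop ν (w i) (p i))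
    (β : Fin 3 →₀ ℕ) : IsUniqueTop ν (mono w β) (piv p β) := by
  have h0 := ((hw 0).pow (β 0)).1
  have h1 := ((hw 1).pow (β 1)).1
  have h2 := ((hw 2).pow (β 2)).1
  have h := ((h0.mul h1).1.mul h2).1
  have em : mono w β = w 0 ^ (β 0) * w 1 ^ (β 1) * w 2 ^ (β 2) := by
    unfold mono; rw [Fin.prod_univ_three]
  have ep : piv p β = β 0 • p 0 + β 1 • p 1 + β 2 • p 2 := by
    unfold piv; rw [Fin.sum_univ_three]
  rw [em, ep]; exact h

/-- the FIBRE POLYNOMIAL `φ_q = Σ_{α ∈ fibre q} P_α z^{idx α}` -/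
def fibrePoly (P : Poly3) (p : Fin 3 → Expo) (idx : (Fin 3 →₀ ℕ) → ℕ) (q : Expo) : Polynomial ℂ :=
  ∑ α ∈ P.support.filter (fun α => piv p α = q), Polynomial.monomial (idx α) (coeff α P)

theorem fibrePoly_coeff (P : Poly3) (p : Fin 3 → Expo) (idx : (Fin 3 →₀ ℕ) → ℕ) (q : Expo) (j : ℕ) :
    (fibrePoly P p idx q).coeff j = ∑ α ∈ (P.support.filter (fun α => piv p α = q)).filter (fun α => idx α = j), coeff α P := by
  unfold fibrePoly
  rw [Polynomial.finsetSum_coeff, Finset.sum_filter (fun α => idx α = j)]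
  exact Finset.sum_congr rfl fun α _ => by rw [Polynomial.coeff_monomial]

theorem fibrePoly_natDegree_le (P : Poly3) (p : Fin 3 → Expo) (idx : (Fin 3 →₀ ℕ) → ℕ) (q : Expo) (J : ℕ)
    (hidx : ∀ α ∈ P.support, idx α ≤ J) : (fibrePoly P p idx q).natDegree ≤ J := by
  unfold fibrePoly
  refine (Polynomial.natDegree_sum_le_of_forall_le _ _ fun α hα => ?_)
  exact (Polynomial.natDegree_monomial_le _).trans (hidx α (Finset.mem_filter.mp hα).1)

/-- ★ THE FIBRE IDENTITY: `T_q · G^J = w^{base q} · homEval φ_q J F G` (`F = w^{c⁺}`, `G = w^{c⁻}`). [val-idea-35 g11] -/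
theorem fibrePart_mul_pow_eq (w : Fin 3 → Poly2) (P : Poly3) (p : Fin 3 → Expo)
    (cp cm : Fin 3 →₀ ℕ) (J : ℕ) (base : Expo → (Fin 3 →₀ ℕ)) (idx : (Fin 3 →₀ ℕ) → ℕ)
    (hidx : ∀ α ∈ P.support, idx α ≤ J)
    (hprog : ∀ α ∈ P.support, α + J • cm = base (piv p α) + idx α • cp + (J - idx α) • cm) (q : Expo) :
    fibrePart w P p q * mono w cm ^ J = mono w (base q) * homEval (fibrePoly P p idx q) J (mono w cp) (mono w cm) := by
  set A := P.support.filter (fun α => piv p α = q) with hA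
  have lhs : fibrePart w P p q * mono w cm ^ J = ∑ α ∈ A, C (coeff α P) * (mono w (base q) * (mono w cp ^ idx α * mono w cm ^ (J - idx α))) := by
    unfold fibrePart fibre
    rw [← hA, map_sum, Finset.sum_mul]
    refine Finset.sum_congr rfl fun α hα => ?_
    have hαs : α ∈ P.support := (Finset.mem_filter.mp hα).1
    have hq : piv p α = q := (Finset.mem_filter.mp hα).2
    rw [aeval_monomial_eq, mul_assoc, ← mono_nsmul, ← mono_add, hprog α hαs, hq, mono_add, mono_add, mono_nsmul, mono_nsmul, mul_assoc]
  have rhs : homEval (fibrePoly P p idx q) J (mono w cp) (mono w cm) = ∑ α ∈ A, C (coeff α P) * (mono w cp ^ idx α * mono w cm ^ (J - idx α)) := by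
    unfold homEval
    have step : ∀ j ∈ Finset.range (J + 1), C ((fibrePoly P p idx q).coeff j) * mono w cp ^ j * mono w cm ^ (J - j) =
        ∑ α ∈ A.filter (fun α => idx α = j), C (coeff α P) * (mono w cp ^ idx α * mono w cm ^ (J - idx α)) := by
      intro j _
      rw [fibrePoly_coeff, ← hA, map_sum, Finset.sum_mul, Finset.sum_mul]
      refine Finset.sum_congr rfl fun α hα => ?_
      rw [(Finset.mem_filter.mp hα).2, mul_assoc]
    rw [Finset.sum_congr rfl step, Finset.sum_fiberwise_of_maps_to]
    intro α hα
    exact Finset.mem_range.mpr (Nat.lt_succ_of_le (hidx α (Finset.mem_filter.mp hα).1))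
  rw [lhs, rhs, Finset.mul_sum]
  refine Finset.sum_congr rfl fun α _ => ?_
  ring

/-- the base of a nonempty fibre projects to the fibre value: `π(base q) = q` -/
theorem piv_base_eq (P : Poly3) (p : Fin 3 → Expo) (cp cm : Fin 3 →₀ ℕ) (J : ℕ) (base : Expo → (Fin 3 →₀ ℕ))
    (idx : (Fin 3 →₀ ℕ) → ℕ) (hrel : piv p cp = piv p cm) (hidx : ∀ α ∈ P.support, idx α ≤ J)
    (hprog : ∀ α ∈ P.support, α + J • cm = base (piv p α) + idx α • cp + (J - idx α) • cm)
    {α : Fin 3 →₀ ℕ} (hα : α ∈ P.support) : piv p (base (piv p α)) = piv p α := by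
  have h := congrArg (piv p) (hprog α hα)
  rw [piv_add, piv_add, piv_add, piv_nsmul, piv_nsmul, piv_nsmul, hrel] at h
  have hk := hidx α hα
  have e : idx α • piv p cm + (J - idx α) • piv p cm = J • piv p cm := by rw [← add_smul, Nat.add_sub_cancel' hk]
  rw [add_assoc, e] at h
  exact (add_right_cancel h).symm

/-- a nonempty fibre has a nonzero fibre polynomial (the index is injective on a fibre) -/
theorem fibrePoly_ne_zero (P : Poly3) (p : Fin 3 → Expo) (cp cm : Fin 3 →₀ ℕ) (J : ℕ) (base : Expo → (Fin 3 →₀ ℕ))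
    (idx : (Fin 3 →₀ ℕ) → ℕ)
    (hprog : ∀ α ∈ P.support, α + J • cm = base (piv p α) + idx α • cp + (J - idx α) • cm)
    {q : Expo} {α : Fin 3 →₀ ℕ} (hα : α ∈ P.support) (hq : piv p α = q) : fibrePoly P p idx q ≠ 0 := by
  intro h0
  have hc := congrArg (fun φ => Polynomial.coeff φ (idx α)) h0
  simp only [Polynomial.coeff_zero] at hc
  rw [fibrePoly_coeff] at hc
  have hsingle : (P.support.filter (fun α' => piv p α' = q)).filter (fun α' => idx α' = idx α) = {α} := by
    ext α'
    simp only [Finset.mem_filter, Finset.mem_singleton, MvPolynomial.mem_support_iff]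
    constructor
    · rintro ⟨⟨hα', hq'⟩, hi⟩
      have h1 := hprog α' (MvPolynomial.mem_support_iff.mpr hα')
      have h2 := hprog α hα
      rw [hq', hi] at h1; rw [hq] at h2
      exact add_right_cancel (h1.trans h2.symm)
    · rintro rfl; exact ⟨⟨MvPolynomial.mem_support_iff.mp hα, hq⟩, rfl⟩
  rw [hsingle, Finset.sum_singleton] at hc
  exact (MvPolynomial.mem_support_iff.mp hα) hc

/-- ★ **EACH FIBRE PART IS ZERO OR UNIQUELY TOPPED AT A LEVEL-1 CANDIDATE** `e`, `e + k•V = q + k•E`, `k ≤ J`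
(`k = 0`, i.e. `e = q`, for a live fibre and whenever the arc binomial vanishes). [val-idea-35 g11, memo §3/U5′] -/
theorem fibrePart_zero_or_uniqueTop {ν : Fin 2 → ℝ} (w : Fin 3 → Poly2) (P : Poly3) (p : Fin 3 → Expo)
    (hw : ∀ i, IsUniqueTop ν (w i) (p i))
    (cp cm : Fin 3 →₀ ℕ) (J : ℕ) (base : Expo → (Fin 3 →₀ ℕ)) (idx : (Fin 3 →₀ ℕ) → ℕ)
    (hrel : piv p cp = piv p cm) (hidx : ∀ α ∈ P.support, idx α ≤ J)
    (hprog : ∀ α ∈ P.support, α + J • cm = base (piv p α) + idx α • cp + (J - idx α) • cm)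
    (E : Expo)
    (hN : mono w cp - C (coeff (piv p cp) (mono w cp) / coeff (piv p cp) (mono w cm)) * mono w cm = 0 ∨
      IsUniqueTop ν (mono w cp - C (coeff (piv p cp) (mono w cp) / coeff (piv p cp) (mono w cm)) * mono w cm) E)
    (q : Expo) :
    fibrePart w P p q = 0 ∨
      ∃ (e : Expo) (k : ℕ), k ≤ J ∧ IsUniqueTop ν (fibrePart w P p q) e ∧ e + k • piv p cp = q + k • E := by
  set F := mono w cp with hFdef
  set G := mono w cm with hGdef
  set V := piv p cp with hVdef
  set φ := fibrePoly P p idx q with hφdef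
  have hF : IsUniqueTop ν F V := isUniqueTop_mono hw cp
  have hG : IsUniqueTop ν G V := by rw [hrel]; exact isUniqueTop_mono hw cm
  have hid := fibrePart_mul_pow_eq w P p cp cm J base idx hidx hprog q
  by_cases hT : fibrePart w P p q = 0
  · exact Or.inl hT
  right
  -- the fibre is nonempty
  have hne : ∃ α ∈ P.support, piv p α = q := by
    by_contra hno
    push Not at hno
    apply hT
    unfold fibrePart fibre
    rw [Finset.filter_false_of_mem (fun α hα => hno α hα), Finset.sum_empty, map_zero]
  obtain ⟨α₀, hα₀, hq₀⟩ := hne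
  have hφ0 : φ ≠ 0 := fibrePoly_ne_zero P p cp cm J base idx hprog hα₀ hq₀
  have hφJ : φ.natDegree ≤ J := fibrePoly_natDegree_le P p idx q J hidx
  have hbase : IsUniqueTop ν (mono w (base q)) q := by
    have h1 := isUniqueTop_mono hw (base q)
    have h2 : piv p (base q) = q := by
      rw [← hq₀]; exact piv_base_eq P p cp cm J base idx hrel hidx hprog hα₀
    rwa [h2] at h1
  set lam := coeff V F / coeff V G with hlam
  rcases hN with hN0 | hN1
  · -- N = 0 : homEval φ J F G = C (φ.eval λ) * G^J, so T_q = C (φ.eval λ) * w^{base q}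
    have hFG : F = C lam * G := sub_eq_zero.mp hN0
    have hhom : homEval φ J F G = C (φ.eval lam) * G ^ J := by
      unfold homEval
      rw [Polynomial.eval_eq_sum_range' (Nat.lt_succ_of_le hφJ), map_sum, Finset.sum_mul]
      refine Finset.sum_congr rfl fun j hj => ?_
      have hjJ : j ≤ J := Nat.le_of_lt_succ (Finset.mem_range.mp hj)
      rw [hFG, mul_pow, ← C_pow, map_mul, mul_assoc, mul_assoc, ← pow_add, Nat.add_sub_cancel' hjJ, mul_assoc]
    rw [hhom] at hid
    have hGJ : G ^ J ≠ 0 := pow_ne_zero _ hG.ne_zero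
    have hT' : fibrePart w P p q = C (φ.eval lam) * mono w (base q) := by
      apply mul_right_cancel₀ hGJ
      rw [hid]; ring
    have hev : φ.eval lam ≠ 0 := by
      intro h0; apply hT; rw [hT', h0, C_0, zero_mul]
    refine ⟨q, 0, Nat.zero_le _, ?_, by simp⟩
    rw [hT']; exact hbase.C_mul hev
  · -- N uniquely topped at E : dead-fibre theorem U5 + transfer U6-type
    obtain ⟨hk, htop, _⟩ := deadFibre_uniqueTop hF hG φ hφ0 J hφJ hN1
    set k := φ.rootMultiplicity lam with hkdef
    obtain ⟨e, he, hsum⟩ := uniqueTop_of_mul_eq' J hG hbase htop hid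
    refine ⟨e, k, hk, he, ?_⟩
    -- e + J•V = q + (k•E + (J−k)•V)  ⇒  e + k•V = q + k•E
    have hJ : J • V = k • V + (J - k) • V := by rw [← add_smul, Nat.add_sub_cancel' hk]
    rw [hJ] at hsum
    have h2 : e + k • V + (J - k) • V = q + k • E + (J - k) • V := by
      rw [add_assoc, hsum]; abel
    exact add_right_cancel h2

/-- a finite sum one of whose parts is uniquely topped at `e`, all other parts lying strictly below `e`, is uniquely topped at `e` -/
theorem isUniqueTop_finset_sum {ν : Fin 2 → ℝ} {ι : Type*} (s : Finset ι) (T : ι → Poly2) {i₀ : ι} (hi₀ : i₀ ∈ s) {e : Expo}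
    (h0 : IsUniqueTop ν (T i₀) e) (hlt : ∀ i ∈ s, i ≠ i₀ → ∀ x ∈ (T i).support, wt ν x < wt ν e) :
    IsUniqueTop ν (∑ i ∈ s, T i) e := by
  have hcoeff : coeff e (∑ i ∈ s, T i) = coeff e (T i₀) := by
    rw [coeff_sum, ← Finset.add_sum_erase s _ hi₀]
    have hz : ∑ i ∈ s.erase i₀, coeff e (T i) = 0 := by
      refine Finset.sum_eq_zero fun i hi => ?_
      have hne : i ≠ i₀ := Finset.ne_of_mem_erase hi
      by_contra hc
      exact lt_irrefl _ (hlt i (Finset.mem_of_mem_erase hi) hne e (mem_support_iff.mpr hc))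
    rw [hz, add_zero]
  refine ⟨mem_support_iff.mpr (by rw [hcoeff]; exact h0.coeff_ne_zero), fun x hx hxe => ?_⟩
  obtain ⟨i, hi, hxi⟩ := Finset.mem_biUnion.mp (support_sum hx)
  by_cases hii : i = i₀
  · subst hii; exact h0.2 x hxi hxe
  · exact hlt i hi hii x hxi

/-- ★★ **THE PER-DIRECTION LEVEL-1 TOP THEOREM.**  With progression data for the fibres, the arc binomial zero or uniquely topped at `E`,
NO FIBRE COINCIDENCE at `ν` and NO WEIGHT TIE between the tops of distinct nonzero fibre parts, the onset polynomial `P(w)` is zero or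
uniquely topped, and its top is a level-1 candidate `e + k•V = q + k•E` (`q` a fibre value, `k ≤ J`). [val-idea-35 g11, memo §3 THEOREM L1] -/
theorem levelOne_zero_or_uniqueTop {ν : Fin 2 → ℝ} (w : Fin 3 → Poly2) (P : Poly3) (p : Fin 3 → Expo)
    (hw : ∀ i, IsUniqueTop ν (w i) (p i))
    (cp cm : Fin 3 →₀ ℕ) (J : ℕ) (base : Expo → (Fin 3 →₀ ℕ)) (idx : (Fin 3 →₀ ℕ) → ℕ)
    (hrel : piv p cp = piv p cm) (hidx : ∀ α ∈ P.support, idx α ≤ J)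
    (hprog : ∀ α ∈ P.support, α + J • cm = base (piv p α) + idx α • cp + (J - idx α) • cm)
    (E : Expo)
    (hN : mono w cp - C (coeff (piv p cp) (mono w cp) / coeff (piv p cp) (mono w cm)) * mono w cm = 0 ∨
      IsUniqueTop ν (mono w cp - C (coeff (piv p cp) (mono w cp) / coeff (piv p cp) (mono w cm)) * mono w cm) E)
    (hNFC : ∀ q q' e, ¬ FibreCoincidence w P ν p q q' e)
    (hgen : ∀ q q' e e', IsUniqueTop ν (fibrePart w P p q) e → IsUniqueTop ν (fibrePart w P p q') e' → e ≠ e' → wt ν e ≠ wt ν e') :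
    aeval w P = 0 ∨ ∃ e, IsUniqueTop ν (aeval w P) e ∧
      ∃ q ∈ P.support.image (piv p), ∃ k, k ≤ J ∧ e + k • piv p cp = q + k • E := by
  set Q := P.support.image (piv p) with hQ
  set Q' := Q.filter (fun q => fibrePart w P p q ≠ 0) with hQ'
  have hD : aeval w P = ∑ q ∈ Q, fibrePart w P p q := aeval_eq_sum_fibrePart w P p
  by_cases hemp : Q' = ∅
  · left
    rw [hD]
    refine Finset.sum_eq_zero fun q hq => ?_
    by_contra h
    have : q ∈ Q' := Finset.mem_filter.mpr ⟨hq, h⟩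
    rw [hemp] at this; exact absurd this (Finset.notMem_empty _)
  right
  -- tops of the nonzero parts
  have htop : ∀ q ∈ Q', ∃ (e : Expo) (k : ℕ), k ≤ J ∧ IsUniqueTop ν (fibrePart w P p q) e ∧ e + k • piv p cp = q + k • E := by
    intro q hq
    rcases fibrePart_zero_or_uniqueTop w P p hw cp cm J base idx hrel hidx hprog E hN q with h | h
    · exact absurd h (Finset.mem_filter.mp hq).2
    · exact h
  choose! top mult hmult htopU hcand using htop
  -- the heaviest top
  obtain ⟨q₀, hq₀, hmax⟩ := Finset.exists_max_image Q' (fun q => wt ν (top q)) (Finset.nonempty_iff_ne_empty.mpr hemp)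
  have hq₀Q : q₀ ∈ Q := (Finset.mem_filter.mp hq₀).1
  refine ⟨top q₀, ?_, q₀, hq₀Q, mult q₀, hmult q₀ hq₀, hcand q₀ hq₀⟩
  rw [hD]
  refine isUniqueTop_finset_sum Q (fun q => fibrePart w P p q) hq₀Q (htopU q₀ hq₀) fun q hq hne x hx => ?_
  have hqQ' : q ∈ Q' := Finset.mem_filter.mpr ⟨hq, ne_zero_iff.mpr ⟨x, mem_support_iff.mp hx⟩⟩
  have hU := htopU q hqQ'
  -- distinct parts have distinct tops (NFC) of distinct weights (hgen); the top of part q is ≤ the max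
  have hne_top : top q ≠ top q₀ := fun h => hNFC q q₀ (top q) ⟨hne, hU, h ▸ htopU q₀ hq₀⟩
  have hlt_top : wt ν (top q) < wt ν (top q₀) :=
    lt_of_le_of_ne (hmax q hqQ') (hgen q q₀ _ _ hU (htopU q₀ hq₀) hne_top)
  by_cases hxt : x = top q
  · rw [hxt]; exact hlt_top
  · exact (hU.2 x hx hxt).trans hlt_top

/-- COROLLARY: under the hypotheses of the level-1 top theorem, `ν` is NOT an edge direction of `P(w)`. -/
theorem levelOne_not_isEdgeDir {ν : Fin 2 → ℝ} (w : Fin 3 → Poly2) (P : Poly3) (p : Fin 3 → Expo)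
    (hw : ∀ i, IsUniqueTop ν (w i) (p i))
    (cp cm : Fin 3 →₀ ℕ) (J : ℕ) (base : Expo → (Fin 3 →₀ ℕ)) (idx : (Fin 3 →₀ ℕ) → ℕ)
    (hrel : piv p cp = piv p cm) (hidx : ∀ α ∈ P.support, idx α ≤ J)
    (hprog : ∀ α ∈ P.support, α + J • cm = base (piv p α) + idx α • cp + (J - idx α) • cm)
    (E : Expo)
    (hN : mono w cp - C (coeff (piv p cp) (mono w cp) / coeff (piv p cp) (mono w cm)) * mono w cm = 0 ∨
      IsUniqueTop ν (mono w cp - C (coeff (piv p cp) (mono w cp) / coeff (piv p cp) (mono w cm)) * mono w cm) E)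
    (hNFC : ∀ q q' e, ¬ FibreCoincidence w P ν p q q' e)
    (hgen : ∀ q q' e e', IsUniqueTop ν (fibrePart w P p q) e → IsUniqueTop ν (fibrePart w P p q') e' → e ≠ e' → wt ν e ≠ wt ν e') :
    ¬ IsEdgeDir ν (aeval w P) := by
  rcases levelOne_zero_or_uniqueTop w P p hw cp cm J base idx hrel hidx hprog E hN hNFC hgen with h | ⟨e, he, _⟩
  · intro hE; exact ne_zero_of_isEdgeDir hE h
  · exact he.not_isEdgeDir

/--
info: 'Summit.ValiantsHypothesis.ValiantsHypothesis.Cruxes.TwoProducts.ValIdea35g10.fibrePart_mul_pow_eq' depends on axioms: [propext,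
 Classical.choice,
 Quot.sound]
-/
#guard_msgs in
#print axioms fibrePart_mul_pow_eq

/--
info: 'Summit.ValiantsHypothesis.ValiantsHypothesis.Cruxes.TwoProducts.ValIdea35g10.fibrePart_zero_or_uniqueTop' depends on axioms: [propext,
 Classical.choice,
 Quot.sound]
-/
#guard_msgs in
#print axioms fibrePart_zero_or_uniqueTop

/--
info: 'Summit.ValiantsHypothesis.ValiantsHypothesis.Cruxes.TwoProducts.ValIdea35g10.levelOne_zero_or_uniqueTop' depends on axioms: [propext,
 Classical.choice,
 Quot.sound]
-/
#guard_msgs in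
#print axioms levelOne_zero_or_uniqueTop

/--
info: 'Summit.ValiantsHypothesis.ValiantsHypothesis.Cruxes.TwoProducts.ValIdea35g10.levelOne_not_isEdgeDir' depends on axioms: [propext,
 Classical.choice,
 Quot.sound]
-/
#guard_msgs in
#print axioms levelOne_not_isEdgeDir

end LevelOneTopG11

/-! ═════════════════════ REV 8 (val-idea-35 g11) — TRANCHE A′: SCOPE OF THE LEVEL-1 TOP THEOREM + THE ONE-SPARSE-LETTER SLICE `OLMLaw` ═════════════════════
(O1) **SCOPE SENTENCE for `levelOne_zero_or_uniqueTop` / `levelOne_not_isEdgeDir` (crit-8 g5 VERDICT #75 (1) / #77 O1, of record):**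
NFC-at-ν (`hNFC : ∀ q q' e, ¬ FibreCoincidence w P ν p q q' e`) FAILS on binary-digit (G1) letters for `m ≥ 3` — memo
`EXPT-unit-tower-g11.md` §12.2: the tail tops of `wᵢ = Σ_a x^{2^a pᵢ}`-type letters sit at `δᵢ = −pᵢ/2`, so `2δᵢ ∈ Λ` (self-similarity of the
digit tables) and distinct fibres acquire COINCIDENT displaced tops `q + k•E = q' + k'•E` — i.e. **the hypothesis excludes the hard core**
(gapless non-dissociated annihilating supports).  The theorem is level 1 of the tail tower («the easy envelope count»), nothing more; the named
open lemma of record is the ENVELOPE LEMMA = a depth-independent envelope count for the tail tower ≡ `poly(m,t,K)` for OLM at UNBOUNDED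
coefficient rank AND sparsity (crit-8 g5 #75 (3): OLM is settled on both margins — fixed coefficient rank by val-port-1's shifted-Jacobian chain
(✓ `Theorems/TwoProducts/RankThreeAffineSeparated.lean`), fixed `t` by binomial re-expansion `(m+1)^{t−1}·K·t` — and OPEN only jointly).
(O2) = the section `OLMSliceCrit8` below, text supplied by crit-8 g5 (`pub/ideators/val-idea-crit-8/olm-block-g5.lean` sha16 81468eaec1d94776,
kernel-checked by the critic against REV 7), pasted verbatim: `OLMLaw` = TYPED OPEN onset #3 of rung 3-AFF = the simplest MIXED-MONOMIAL residue
(columns `x^a y^b u^k`), a NECESSARY sub-law of `RankThreeAffineLaw` (`olmLaw_of_rankThreeAffineLaw`); a counterexample kills the side-ladder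
rung, NOT `TwoProducts`; tame margins: level 1 (memo §13.2), fixed coefficient rank (port-1's chain), fixed t (re-expansion); the re-aimed R1 toy
(memo §14, `rank_toy.py`) found nothing.  HONEST LABEL: nothing here moves `LevelOneLaw` / `RankThreeAffineLaw(Exp)` / `OLMLaw` / `TwoProducts`
(5906) / PCB / `ResidualLawV25`; side-ladder; 0 summit distance; VP ≠ VNP is NOT proved. -/
section LevelOneScopeG11
end LevelOneScopeG11

section OLMSliceCrit8
open scoped BigOperators
open MvPolynomial

/-- ONE-SPARSE-LETTER slice of rung 3-AFF («OLM», crit-8 g5 VERDICT #75 (4) / #77 O2): two letters are the coordinates `x, y`,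
the third is an arbitrary `t`-sparse `u ∈ ℂ[x,y]`; `P ∈ ℂ[X₀,X₁,X₂]` of total degree `≤ m`, mixed monomials allowed.  TYPED OPEN. -/
def OLMLaw : Prop :=
  ∃ c : ℕ, ∀ (m t : ℕ) (P : Poly3) (u : Poly2),
    P.totalDegree ≤ m → u.support.card ≤ t →
    nv (MvPolynomial.aeval ![X 0, X 1, u] P) ≤ (m + 2) ^ c * (t + 2) ^ c

/-- `RankThreeAffineLaw → OLMLaw`: instantiate the rung at the carriers `![X 0, X 1, u]` (sparsity `≤ t + 1`) and absorb
`(t + 3)^c ≤ (t + 2)^{2c}`. -/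
theorem olmLaw_of_rankThreeAffineLaw (h : RankThreeAffineLaw) : OLMLaw := by
  obtain ⟨c, hc⟩ := h
  refine ⟨2 * c, fun m t P u hP hu => ?_⟩
  have hw : ∀ i, ((![X 0, X 1, u] : Fin 3 → Poly2) i).support.card ≤ t + 1 := by
    intro i
    fin_cases i
    · simp [MvPolynomial.support_X]
    · simp [MvPolynomial.support_X]
    · simpa using hu.trans (Nat.le_succ t)
  have h1 := hc m (t + 1) P ![X 0, X 1, u] hP hw
  have h2 : (t + 1 + 2) ^ c ≤ ((t + 2) ^ 2) ^ c := Nat.pow_le_pow_left (by nlinarith) c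
  have h3 : (m + 2) ^ c ≤ (m + 2) ^ (2 * c) := Nat.pow_le_pow_right (by omega) (by omega)
  calc nv (MvPolynomial.aeval ![X 0, X 1, u] P) ≤ (m + 2) ^ c * (t + 1 + 2) ^ c := h1
    _ ≤ (m + 2) ^ (2 * c) * (t + 2) ^ (2 * c) := by
        rw [show (t + 2) ^ (2 * c) = ((t + 2) ^ 2) ^ c by rw [← pow_mul]]
        exact Nat.mul_le_mul h3 h2

/--
info: 'Summit.ValiantsHypothesis.ValiantsHypothesis.Cruxes.TwoProducts.ValIdea35g10.olmLaw_of_rankThreeAffineLaw' depends on axioms: [propext,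
 Classical.choice,
 Quot.sound]
-/
#guard_msgs in
#print axioms olmLaw_of_rankThreeAffineLaw

end OLMSliceCrit8

end Summit.ValiantsHypothesis.ValiantsHypothesis.Cruxes.TwoProducts.ValIdea35g10
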